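import Mathlib.Analysis.SpecialFunctions.Gamma.Deligne
import Mathlib.NumberTheory.Harmonic.ZetaAsymp
import Literature.Analysis.Complex.ArgumentPrincipleRectangle
import Literature.Analysis.Complex.BacklundArgVariation
import Literature.NumberTheory.LFunctions.RiemannXiProofs
import Literature.NumberTheory.LFunctions.RiemannXiLogDeriv
import Literature.NumberTheory.LFunctions.ZetaZerosProofs
import Literature.NumberTheory.LFunctions.ZetaZerosJensen
import Literature.NumberTheory.LFunctions.RiemannSiegelFacts
import Literature.NumberTheory.LFunctions.RiemannSiegelThetaBounds
import Literature.NumberTheory.LFunctions.ZeroCountingProofs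
import Literature.NumberTheory.LFunctions.LevinsonMontgomery
import Literature.NumberTheory.LFunctions.PrimeLogSeries
import HarnessLib

/-!
# `S(T)` as the variation of `arg ζ`: Backlund's formula and `S(T) = O(log T)`

Trunk T-ANT (`NumberTheory/LFunctions`), family RH; sibling of `RiemannSiegel.lean` (which *defines*
`Literature.zetaArgS T = S(T) := N(T) − θ(T)/π − 1`, Backlund's form) and of `ZeroCounting.lean`
(`Literature.NumberTheory.LFunctions.riemann_von_mangoldt`). Titchmarsh, *The Theory of the Riemann Zeta-Function*, §9.3 proves
`N(T) = 1 + θ(T)/π + S(T)` with `π S(T) = Δ arg ζ(s)` along `2 → 2 + iT → ½ + iT` (Thm. 9.3,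
(9.3.1)–(9.3.2)) by the argument principle for `ξ` on the rectangle with vertices `2, 2+iT, −1+iT, −1`
and the symmetry `ξ(1−s) = ξ(s)`; §9.4 deduces `S(T) = O(log T)` (Thm. 9.4, Backlund 1918) from
Jensen's formula, and with Stirling's formula for `θ` the Riemann–von Mangoldt formula
`N(T) = (T/2π) log(T/2π) − T/2π + O(log T)`.

Since the tree takes Backlund's form as the definition of `S`, the content of Thm. 9.3 becomes the
**theorem** `Literature.NumberTheory.LFunctions.pi_mul_zetaArgS_eq`:
for `T > 0` not the ordinate of a zero,
`π S(T) = Im (i ∫₀ᵀ (ζ'/ζ)(2+iy) dy) − Im ∫_{1/2}^{2} (ζ'/ζ)(x+iT) dx`.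
Proof (all in this file, on top of the tree's argument principle
`Literature.Analysis.Complex.integral_boundary_rect_logDeriv`, `ArgumentPrincipleRectangle.lean`):

* the zeros of `ξ` in `(−1, 2) × (−T, T)` are the zeros of `ζ` with `0 < Im ρ ≤ T` and their
  conjugates, with multiplicities `m(ρ)` (`Literature.NumberTheory.LFunctions.untop₀_meromorphicOrderAt_riemannXi`,
  `RiemannXiLogDeriv.lean`), so the argument principle on `R = [−1, 2] × [−T, T]` gives
  `∮_{∂R} ξ'/ξ = 2πi · 2N(T)` (`Literature.NumberTheory.LFunctions.finsum_order_riemannXi_eq`);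
* the symmetries `ξ'/ξ(1−s) = −ξ'/ξ(s)`, `ξ'/ξ(s̄) = conj ξ'/ξ(s)` fold `∂R` onto the quarter
  `2 → 2+iT → ½+iT` (`Literature.NumberTheory.LFunctions.rectBoundaryIntegral_eq_of_symmetric`):
  `π N(T) = Im(i∫₀ᵀ ξ'/ξ(2+iy) dy) − Im ∫_{1/2}^2 ξ'/ξ(x+iT) dx`;
* on that path `ξ'/ξ = 1/s + 1/(s−1) + Γℝ'/Γℝ + ζ'/ζ`; the first two terms contribute
  `arg(½+iT) + arg(−½+iT) = π` (`Literature.NumberTheory.LFunctions.im_integral_inv_add_inv_sub_one`), and `Γℝ'/Γℝ` contributes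
  exactly `θ(T)` (`Literature.NumberTheory.LFunctions.im_integral_logDeriv_Gammaℝ`: Cauchy–Goursat on `[½, 2] × [0, T]`, the
  integrand being real on the real axis and `Re Γℝ'/Γℝ(½+iu) = θ'(u)` by the tree's definition of `θ`).

Then (§9.4) `Literature.NumberTheory.LFunctions.abs_zetaArgS_le_of_not_ordinate`: the vertical term is `arg ζ(2+iT) − arg ζ(2)`,
at most `π` in modulus (`Re ζ > 0` on `Re s = 2`), and the horizontal term is bounded by Backlund's
lemma `Literature.Analysis.Complex.abs_im_integral_logDeriv_le_backlund` (`BacklundArgVariation.lean`; Jensen on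
the discs `|s − (2+iT)| ≤ 3/2 < 7/4`, where `|ζ| ≤ 40(T+4)`, `ZetaZerosJensen.lean`), giving an
explicit `|S(T)| ≤ C₁ + C₂ log(T + 4)` off the ordinates, extended to all `T` by the right
continuity of `N` and the bound `θ' ≪ log T`. Consequences: the named facts
`Literature.NumberTheory.LFunctions.isBigO_zetaArgS_log` (`RiemannSiegel.lean`, Titchmarsh Thm. 9.4) and
`Literature.NumberTheory.LFunctions.riemann_von_mangoldt` (`ZeroCounting.lean`, rh.S11) are **discharged**
(`isBigO_zetaArgS_log_holds`, `riemann_von_mangoldt_holds`), and with them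
`tendsto_zetaZeroCount_atTop`, `zetaZeroCount_eq_ncard`, `zetaOrdinate_mono`, `zetaOrdinate_pos`,
`exists_zero_of_zetaOrdinate` (`ZetaZeros.lean`) via the conditional API of `ZeroCountingProofs.lean`
and the left local constancy of `N` (`exists_pos_zetaZeroCount_sub_eq`).

Appended (§ `ray`): the form of `S(T)` integrated in `t` by Turing's method (Lehman 1970 Lemma 1;
Edwards §8.2): `Literature.NumberTheory.LFunctions.pi_mul_zetaArgS_eq_neg_integral_Ioi`, `π S(T) = −∫_{1/2}^{∞} Im ζ'/ζ(σ+iT) dσ`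
(`T > 0` not an ordinate), via `arg ζ(2+iT) = −Im ∫₂^∞ ζ'/ζ` (`integral_Ioi_logDeriv_riemannZeta`;
the principal `log ζ` is a primitive along `σ ≥ 2`, where `Re ζ > 0`, tending to `0`) and the decay
`‖ζ(s) − 1‖ ≤ 2^{2−σ}(π²/6 − 1)`, `‖ζ'/ζ(s)‖ ≤ 2^{2−σ} Σ Λ(n)/n²` for `σ ≥ 2` (and `Re ζ > 0`
there: `Literature.NumberTheory.LFunctions.Nicolas.riemannZeta_re_pos_of_two_le`, `PrimeLogSeries.lean`).

Everything here is proved; there are no named facts.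

## References

* E. C. Titchmarsh, *The Theory of the Riemann Zeta-Function*, 2nd ed. (rev. D. R. Heath-Brown),
  OUP 1986, §9.2–9.4 (Thms. 9.2, 9.3, 9.4).
* R. J. Backlund, *Über die Nullstellen der Riemannschen Zetafunktion*, Acta Math. 41 (1918),
  345–375.
* H. von Mangoldt, *Zu Riemanns Abhandlung „Ueber die Anzahl der Primzahlen unter einer gegebenen
  Grösse"*, J. reine angew. Math. 114 (1895); Math. Ann. 60 (1905).
* H. M. Edwards, *Riemann's Zeta Function*, Academic Press 1974, §6.6–6.7, §9.2–9.4.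
-/

noncomputable section

open Complex Set MeasureTheory Filter Topology intervalIntegral Metric Asymptotics
open scoped Real ComplexConjugate

namespace Literature.NumberTheory.LFunctions


/-! ### Folding the boundary integral over `∂([−1,2] × [−T,T])` onto the quarter `Re s ≥ ½, Im s ≥ 0` -/

/-- **Folding lemma.** If `F(1 − s) = −F(s)` and `F(s̄) = \overline{F(s)}` (as for `F = ξ'/ξ`),
and `F` is continuous on the right and top edges of `R = [−1, 2] × [−T, T]`, then the boundary
integral of `F` over `∂R` (Mathlib's four-term convention) equals
`4i (∫₀ᵀ Re F(2 + iy) dy − Im ∫_{1/2}^{2} F(x + iT) dx)`. [folklore] -/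
theorem rectBoundaryIntegral_eq_of_symmetric {F : ℂ → ℂ} {T : ℝ} (hT : 0 ≤ T)
    (h1 : ∀ s, F (1 - s) = -F s) (h2 : ∀ s, F (conj s) = conj (F s))
    (hright : ∀ y ∈ Icc (-T) T, ContinuousAt F (2 + y * I))
    (htop : ∀ x ∈ Icc (-1 : ℝ) 2, ContinuousAt F (x + T * I)) :
    Literature.Analysis.Complex.rectBoundaryIntegral F (-1) 2 (-T) T =
      4 * I * (((∫ y in (0 : ℝ)..T, (F (2 + y * I)).re : ℝ) : ℂ) -
        ((∫ x in (1 / 2 : ℝ)..2, F (x + T * I)).im : ℂ)) := by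
  set B : ℂ := ∫ x in (1 / 2 : ℝ)..2, F (x + T * I) with hB
  set C : ℂ := ∫ y in (0 : ℝ)..T, F (2 + y * I) with hC
  -- top edge
  have htop_int : ∀ {a b : ℝ}, -1 ≤ a → a ≤ b → b ≤ 2 →
      IntervalIntegrable (fun x : ℝ ↦ F (x + T * I)) volume a b := fun ha hab hb ↦
    Literature.Analysis.Complex.intervalIntegrable_of_continuousAt_horizontal T hab
      fun x hx ↦ htop x ⟨ha.trans hx.1, hx.2.trans hb⟩
  have hpt_top : ∀ x : ℝ, F (x + T * I) = -conj (F (((1 - x : ℝ) : ℂ) + T * I)) := by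
    intro x
    rw [← h2, ← h1]
    congr 1
    apply Complex.ext <;> simp
  have htopL : ∫ x in (-1 : ℝ)..(1 / 2), F (x + T * I) = -conj B := by
    rw [intervalIntegral.integral_congr fun x _ ↦ hpt_top x, intervalIntegral.integral_neg,
      intervalIntegral_conj, intervalIntegral.integral_comp_sub_left (fun u : ℝ ↦ F (u + T * I)) 1]
    norm_num [hB]
  have htop_eq : ∫ x in (-1 : ℝ)..2, F (x + T * I) = -conj B + B := by
    rw [← intervalIntegral.integral_add_adjacent_intervals (b := 1 / 2)
      (htop_int le_rfl (by norm_num) (by norm_num)) (htop_int (by norm_num) (by norm_num) le_rfl), htopL]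
  -- bottom edge
  have hbot_eq : ∫ x in (-1 : ℝ)..2, F (x + (-T : ℝ) * I) = conj (-conj B + B) := by
    rw [← htop_eq, ← intervalIntegral_conj]
    refine intervalIntegral.integral_congr fun x _ ↦ ?_
    rw [← h2]
    congr 1
    apply Complex.ext <;> simp
  -- right edge
  have hright_int : ∀ {a b : ℝ}, -T ≤ a → a ≤ b → b ≤ T →
      IntervalIntegrable (fun y : ℝ ↦ F (2 + y * I)) volume a b := fun ha hab hb ↦ by
    have := Literature.Analysis.Complex.intervalIntegrable_of_continuousAt_vertical (F := F) 2 hab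
      fun y hy ↦ by exact_mod_cast hright y ⟨ha.trans hy.1, hy.2.trans hb⟩
    exact_mod_cast this
  have hrightL : ∫ y in (-T : ℝ)..0, F (2 + y * I) = conj C := by
    have e : ∀ y : ℝ, F (2 + y * I) = conj (F (2 + (-y : ℝ) * I)) := by
      intro y
      rw [← h2]
      congr 1
      apply Complex.ext <;> simp
    rw [intervalIntegral.integral_congr fun y _ ↦ e y, intervalIntegral_conj,
      intervalIntegral.integral_comp_neg (fun u : ℝ ↦ F (2 + u * I))]
    simp [hC]
  have hright_eq : ∫ y in (-T : ℝ)..T, F (2 + y * I) = conj C + C := by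
    rw [← intervalIntegral.integral_add_adjacent_intervals (b := 0)
      (hright_int le_rfl (by linarith) hT) (hright_int (by linarith) hT le_rfl), hrightL]
  -- left edge
  have hleft_eq : ∫ y in (-T : ℝ)..T, F ((-1 : ℝ) + y * I) = -(conj C + C) := by
    have e : ∀ y : ℝ, F ((-1 : ℝ) + y * I) = -F (2 + (-y : ℝ) * I) := by
      intro y
      rw [← h1]
      congr 1
      apply Complex.ext <;> simp; norm_num
    rw [intervalIntegral.integral_congr fun y _ ↦ e y, intervalIntegral.integral_neg,
      intervalIntegral.integral_comp_neg (fun u : ℝ ↦ F (2 + u * I)), neg_neg, hright_eq]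
  rw [Literature.Analysis.Complex.rectBoundaryIntegral_def]
  push_cast
  rw [htop_eq, hright_eq]
  have hb' : ∫ x in (-1 : ℝ)..2, F (x + -(T : ℂ) * I) = conj (-conj B + B) := by
    rw [← hbot_eq]; push_cast; rfl
  have hl' : ∫ y in (-T : ℝ)..T, F (-1 + y * I) = -(conj C + C) := by
    rw [← hleft_eq]; push_cast; rfl
  have hCre : (∫ y in (0 : ℝ)..T, (F (2 + y * I)).re) = C.re := by
    have := ContinuousLinearMap.intervalIntegral_comp_comm (𝕜 := ℝ) reCLM
      (hright_int (by linarith) hT le_rfl)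
    simpa using this
  rw [hb', hl', hCre]
  apply Complex.ext <;> simp; ring


/-! ### `Γℝ` and the prefactor of `ξ` -/

/-- For `Re s > 0`, `s/2` is not a pole of `Γ` (hypothesis of `Literature.NumberTheory.LFunctions.logDeriv_Gammaℝ`,
`Literature.NumberTheory.LFunctions.RealZeros.hasDerivAt_Gammaℝ`). [folklore] -/
theorem half_ne_neg_nat_of_re_pos' {s : ℂ} (hs : 0 < s.re) (m : ℕ) : s / 2 ≠ -m := fun h ↦ by
  have := congrArg Complex.re h; simp at this; linarith

/-- `Γℝ` is complex differentiable on `Re s > 0`. [folklore] -/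
theorem differentiableAt_Gammaℝ_of_re_pos' {s : ℂ} (hs : 0 < s.re) : DifferentiableAt ℂ Gammaℝ s :=
  (Literature.NumberTheory.LFunctions.RealZeros.hasDerivAt_Gammaℝ (half_ne_neg_nat_of_re_pos' hs)).differentiableAt

/-- `Γℝ` is analytic on `Re s > 0`. [folklore] -/
theorem analyticAt_Gammaℝ_of_re_pos {s : ℂ} (hs : 0 < s.re) : AnalyticAt ℂ Gammaℝ s :=
  (show DifferentiableOn ℂ Gammaℝ {z : ℂ | 0 < z.re} from
    fun _ hz ↦ (differentiableAt_Gammaℝ_of_re_pos' hz).differentiableWithinAt).analyticAt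
    ((isOpen_lt continuous_const continuous_re).mem_nhds hs)

/-! ### The zeros of `ξ` in `[−1, 2] × [−T, T]` and the count `2 N(T)` -/

/-- `ξ` is analytic on a neighbourhood of every point. [folklore] -/
theorem analyticOnNhd_riemannXi (S : Set ℂ) : AnalyticOnNhd ℂ riemannXi S := fun z _ ↦
  differentiable_riemannXi.analyticAt z

/-- If no zero of `ζ` has ordinate `T ≠ 0`, then `ξ ≠ 0` on the horizontal lines `Im s = ±T`.
[folklore] -/
theorem riemannXi_ne_zero_of_im_eq {T : ℝ} (hT' : ∀ ρ : ℂ, riemannZeta ρ = 0 → ρ.im ≠ T) {s : ℂ}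
    (hs : s.im = T ∨ s.im = -T) : riemannXi s ≠ 0 := by
  intro h0
  obtain ⟨hζ, -, -⟩ := (riemannXi_eq_zero_iff_holds s).1 h0
  rcases hs with hs | hs
  · exact hT' s hζ hs
  · refine hT' (conj s) (by rw [riemannZeta_conj, hζ, map_zero]) ?_
    rw [conj_im, hs, neg_neg]

/-- `(zetaZeroCount T : ℤ)` is the `finsum` of the multiplicities over the box. [folklore] -/
theorem zetaZeroCount_eq_finsum (T : ℝ) :
    (zetaZeroCount T : ℤ) = ∑ᶠ ρ ∈ zetaZeroBox 0 T, riemannZetaZeroOrder ρ := by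
  unfold zetaZeroCount zetaZeroCountRe
  exact Int.toNat_of_nonneg (finsum_nonneg fun ρ ↦ finsum_nonneg fun hρ ↦
    riemannZetaZeroOrder_nonneg_of_mem_zetaZeroBox hρ)

/-- **The zeros of `ξ` in the open rectangle `(−1, 2) × (−T, T)`**, for `T > 0` not an ordinate,
are the zeros of `ζ` with `0 < Im ρ ≤ T` together with their conjugates. [folklore] -/
theorem setOf_riemannXi_eq_zero_eq_union {T : ℝ} (hT : 0 < T)
    (hT' : ∀ ρ : ℂ, riemannZeta ρ = 0 → ρ.im ≠ T) :
    {ρ : ℂ | riemannXi ρ = 0 ∧ ρ ∈ Ioo (-1 : ℝ) 2 ×ℂ Ioo (-T) T} =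
      zetaZeroBox 0 T ∪ conj '' zetaZeroBox 0 T := by
  ext ρ
  simp only [mem_setOf_eq, mem_reProdIm, mem_Ioo, mem_union, mem_image]
  constructor
  · rintro ⟨hξ, ⟨-, -⟩, him1, him2⟩
    obtain ⟨hζ, h0, h1⟩ := (riemannXi_eq_zero_iff_holds ρ).1 hξ
    have him : ρ.im ≠ 0 := Literature.NumberTheory.LFunctions.im_ne_zero_of_riemannZeta_eq_zero hζ h0 h1
    rcases lt_or_gt_of_ne him with hneg | hpos
    · right
      refine ⟨conj ρ, ⟨by rw [riemannZeta_conj, hζ, map_zero], ?_, ?_, ?_, ?_⟩, conj_conj ρ⟩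
      · rw [conj_re]; exact h0.le
      · rw [conj_re]; exact h1.le
      · rw [conj_im]; linarith
      · rw [conj_im]; linarith
    · left
      exact ⟨hζ, h0.le, h1.le, hpos, him2.le⟩
  · rintro (⟨hζ, h0, h1, h2, h3⟩ | ⟨w, ⟨hζ, h0, h1, h2, h3⟩, rfl⟩)
    · have hst := re_mem_Ioo_of_riemannZeta_eq_zero_of_im_ne_zero hζ h2.ne'
      refine ⟨(riemannXi_eq_zero_iff_holds ρ).2 ⟨hζ, hst⟩, ⟨by linarith [hst.1], by linarith [hst.2]⟩,
        by linarith, lt_of_le_of_ne h3 (hT' ρ hζ)⟩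
    · have hst := re_mem_Ioo_of_riemannZeta_eq_zero_of_im_ne_zero hζ h2.ne'
      have hζ' : riemannZeta (conj w) = 0 := by rw [riemannZeta_conj, hζ, map_zero]
      refine ⟨(riemannXi_eq_zero_iff_holds _).2 ⟨hζ', ?_, ?_⟩, ⟨?_, ?_⟩, ?_, ?_⟩
      · rw [conj_re]; exact hst.1
      · rw [conj_re]; exact hst.2
      · rw [conj_re]; linarith [hst.1]
      · rw [conj_re]; linarith [hst.2]
      · rw [conj_im]; have := lt_of_le_of_ne h3 (hT' w hζ); linarith
      · rw [conj_im]; linarith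

/-- **The zeros of `ξ` in `(−1, 2) × (−T, T)` number `2 N(T)`** (with multiplicity), for `T > 0`
not an ordinate of a zero. [folklore] -/
theorem finsum_order_riemannXi_eq {T : ℝ} (hT : 0 < T)
    (hT' : ∀ ρ : ℂ, riemannZeta ρ = 0 → ρ.im ≠ T) :
    ∑ᶠ ρ ∈ {ρ : ℂ | riemannXi ρ = 0 ∧ ρ ∈ Ioo (-1 : ℝ) 2 ×ℂ Ioo (-T) T},
        ((meromorphicOrderAt riemannXi ρ).untop₀ : ℂ) = 2 * (zetaZeroCount T : ℂ) := by
  rw [setOf_riemannXi_eq_zero_eq_union hT hT']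
  have hfin : (zetaZeroBox 0 T).Finite := zetaZeroBox_finite 0 T
  have hdisj : Disjoint (zetaZeroBox 0 T) (conj '' zetaZeroBox 0 T) := by
    rw [Set.disjoint_left]
    rintro ρ ⟨-, -, -, h2, -⟩ ⟨w, ⟨-, -, -, hw2, -⟩, rfl⟩
    rw [conj_im] at h2
    linarith
  rw [finsum_mem_union hdisj hfin (hfin.image _),
    finsum_mem_image (starRingEnd ℂ).injective.injOn]
  have hval : ∀ ρ ∈ zetaZeroBox 0 T,
      ((meromorphicOrderAt riemannXi ρ).untop₀ : ℂ) = (riemannZetaZeroOrder ρ : ℂ) := by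
    rintro ρ ⟨hζ, -, -, h2, -⟩
    have h := re_mem_Ioo_of_riemannZeta_eq_zero_of_im_ne_zero hζ h2.ne'
    rw [untop₀_meromorphicOrderAt_riemannXi h.1 (Literature.NumberTheory.LFunctions.ne_one_of_riemannZeta_eq_zero hζ)]
  have hval' : ∀ ρ ∈ zetaZeroBox 0 T,
      ((meromorphicOrderAt riemannXi (conj ρ)).untop₀ : ℂ) = (riemannZetaZeroOrder ρ : ℂ) := by
    rintro ρ ⟨hζ, -, -, h2, -⟩
    have hζ' : riemannZeta (conj ρ) = 0 := by rw [riemannZeta_conj, hζ, map_zero]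
    have h := re_mem_Ioo_of_riemannZeta_eq_zero_of_im_ne_zero hζ h2.ne'
    rw [untop₀_meromorphicOrderAt_riemannXi (by rw [conj_re]; exact h.1)
      (Literature.NumberTheory.LFunctions.ne_one_of_riemannZeta_eq_zero hζ'), riemannZetaZeroOrder_conj_holds ρ]
  rw [finsum_mem_congr rfl hval, finsum_mem_congr rfl hval', ← two_mul]
  congr 1
  have h := (AddMonoidHom.map_finsum_mem riemannZetaZeroOrder (Int.castAddHom ℂ) hfin).symm
  simp only [Int.coe_castAddHom] at h
  rw [h, ← zetaZeroCount_eq_finsum]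
  norm_cast


/-! ### Evaluation along the path `2 → 2 + iT → ½ + iT`: the elementary factors -/

/-- For `Im z > 0`, `arg z + arg(−z̄) = π` (the two points are mirror images in the imaginary
axis). [folklore] -/
theorem arg_add_arg_neg_conj {z : ℂ} (hz : 0 < z.im) : arg z + arg (-conj z) = π := by
  have h1 : (conj z).im < 0 := by simpa using hz
  have h2 : z.arg ≠ π := fun h ↦ by
    have := (arg_eq_pi_iff.1 h).2
    linarith
  rw [arg_neg_eq_arg_add_pi_of_im_neg h1, arg_conj, if_neg h2]
  ring

/-- The pieces `1/s + 1/(s − 1)` of `ξ'/ξ` contribute exactly `π` to the variation of the argument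
along `2 → 2 + iT → ½ + iT` (`T > 0`): the arguments of `½ + iT` and `−½ + iT` add up to `π`.
[folklore] -/
theorem im_integral_inv_add_inv_sub_one {T : ℝ} (hT : 0 < T) :
    (I * ∫ y in (0 : ℝ)..T, ((2 + (y : ℂ) * I)⁻¹ + (2 + (y : ℂ) * I - 1)⁻¹)).im -
      (∫ x in (1 / 2 : ℝ)..2, (((x : ℂ) + T * I)⁻¹ + ((x : ℂ) + T * I - 1)⁻¹)).im = π := by
  have hT0 : T ≠ 0 := hT.ne'
  -- the four exact integrals
  have v0 : I * ∫ y in (0 : ℝ)..T, (2 + (y : ℂ) * I)⁻¹ = log (2 + T * I) - log 2 := by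
    have := Literature.Analysis.Complex.integral_inv_sub_vertical_right 0 2 0 T (by simp)
    simpa using this
  have v1 : I * ∫ y in (0 : ℝ)..T, (2 + (y : ℂ) * I - 1)⁻¹ = log (2 + T * I - 1) - log (2 - 1) := by
    have := Literature.Analysis.Complex.integral_inv_sub_vertical_right 1 2 0 T (by simp)
    simpa using this
  have h0 : ∫ x in (1 / 2 : ℝ)..2, ((x : ℂ) + T * I)⁻¹ =
      log (2 + T * I) - log ((1 / 2 : ℝ) + T * I) := by
    have := Literature.Analysis.Complex.integral_inv_sub_horizontal 0 (1 / 2) 2 T (by simpa using hT0)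
    simpa using this
  have h1 : ∫ x in (1 / 2 : ℝ)..2, ((x : ℂ) + T * I - 1)⁻¹ =
      log (2 + T * I - 1) - log ((1 / 2 : ℝ) + T * I - 1) := by
    have := Literature.Analysis.Complex.integral_inv_sub_horizontal 1 (1 / 2) 2 T (by simpa using hT0)
    simpa using this
  -- integrability
  have hv_int : ∀ c : ℂ, c.re ≠ 2 → IntervalIntegrable (fun y : ℝ ↦ (2 + (y : ℂ) * I - c)⁻¹) volume 0 T := by
    intro c hc
    refine (Continuous.inv₀ (by fun_prop) fun y h ↦ hc ?_).intervalIntegrable _ _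
    have := congrArg Complex.re h
    simp at this
    linarith
  have hh_int : ∀ c : ℂ, c.im ≠ T → IntervalIntegrable (fun x : ℝ ↦ ((x : ℂ) + T * I - c)⁻¹) volume (1 / 2) 2 := by
    intro c hc
    refine (Continuous.inv₀ (by fun_prop) fun x h ↦ hc ?_).intervalIntegrable _ _
    have := congrArg Complex.im h
    simp at this
    linarith
  have ev : (I * ∫ y in (0 : ℝ)..T, ((2 + (y : ℂ) * I)⁻¹ + (2 + (y : ℂ) * I - 1)⁻¹)) =
      (log (2 + T * I) - log 2) + (log (2 + T * I - 1) - log (2 - 1)) := by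
    rw [intervalIntegral.integral_add (by simpa using hv_int 0 (by simp)) (hv_int 1 (by simp)),
      mul_add, v0, v1]
  have eh : (∫ x in (1 / 2 : ℝ)..2, (((x : ℂ) + T * I)⁻¹ + ((x : ℂ) + T * I - 1)⁻¹)) =
      (log (2 + T * I) - log ((1 / 2 : ℝ) + T * I)) +
        (log (2 + T * I - 1) - log ((1 / 2 : ℝ) + T * I - 1)) := by
    rw [intervalIntegral.integral_add (by simpa using hh_int 0 (by simpa using hT0.symm))
      (hh_int 1 (by simpa using hT0.symm)), h0, h1]
  rw [ev, eh]
  have key := arg_add_arg_neg_conj (z := (1 / 2 : ℝ) + T * I) (by simpa using hT)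
  have e1 : -conj (((1 / 2 : ℝ) : ℂ) + T * I) = ((1 / 2 : ℝ) : ℂ) + T * I - 1 := by
    apply Complex.ext <;> norm_num
  rw [e1] at key
  have a2 : arg (2 : ℂ) = 0 := by simp
  have a1 : arg (2 - 1 : ℂ) = 0 := by norm_num
  simp only [sub_im, add_im, log_im, a2, a1]
  linarith



/-! ### The `Γℝ` factor: its logarithmic derivative contributes `θ(T)` -/

/-- `logDeriv Γℝ` is analytic on `Re s > 0`. [folklore] -/
theorem analyticAt_logDeriv_Gammaℝ {s : ℂ} (hs : 0 < s.re) : AnalyticAt ℂ (logDeriv Gammaℝ) s := by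
  show AnalyticAt ℂ (fun z ↦ deriv Gammaℝ z / Gammaℝ z) s
  exact (analyticAt_Gammaℝ_of_re_pos hs).deriv.div (analyticAt_Gammaℝ_of_re_pos hs)
    (Gammaℝ_ne_zero_of_re_pos hs)

/-- `logDeriv Γℝ` is real on the positive real axis. [folklore] -/
theorem logDeriv_Gammaℝ_ofReal_im {x : ℝ} (hx : 0 < x) : (logDeriv Gammaℝ x).im = 0 := by
  rw [Literature.NumberTheory.LFunctions.logDeriv_Gammaℝ (half_ne_neg_nat_of_re_pos' (by simpa using hx))]
  have h1 : (Complex.log π).im = 0 := by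
    rw [Complex.log_im]
    exact Complex.arg_ofReal_of_nonneg Real.pi_pos.le
  have h2 : (Complex.digamma ((x : ℂ) / 2)).im = 0 := by
    rw [← Complex.conj_eq_iff_im, ← digamma_conj]
    congr 1
    rw [map_div₀, conj_ofReal, map_ofNat]
  simp [h1, h2]

/-- On the critical line, `Re logDeriv Γℝ (½ + iy) = θ'(y)` — this is how the tree *defines*
`θ' = riemannSiegelThetaDeriv`. [folklore] -/
theorem logDeriv_Gammaℝ_half_add_re (y : ℝ) :
    (logDeriv Gammaℝ ((1 / 2 : ℝ) + y * I)).re = riemannSiegelThetaDeriv y := by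
  rw [Literature.NumberTheory.LFunctions.logDeriv_Gammaℝ (half_ne_neg_nat_of_re_pos' (by simp)), riemannSiegelThetaDeriv]
  have h1 : (Complex.log π).re = Real.log π := Complex.log_ofReal_re π
  have h2 : ((1 / 2 : ℝ) + (y : ℂ) * I) / 2 = 1 / 4 + (y : ℂ) / 2 * I := by
    push_cast; ring
  rw [h2]
  simp [h1]
  ring

/-- **The `Γℝ` factor contributes exactly `θ(T)`**: by Cauchy–Goursat on `[½, 2] × [0, T]` for
the holomorphic `logDeriv Γℝ`, real on the bottom edge,
`Im(i ∫₀ᵀ logDeriv Γℝ(2+iy) dy) − Im ∫_{1/2}^{2} logDeriv Γℝ(x+iT) dx = Im(i ∫₀ᵀ logDeriv Γℝ(½+iy) dy) = θ(T)`.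
(Titchmarsh §9.3; the tree defines `θ(T) = ∫₀ᵀ Re (logDeriv Γℝ)(½ + iu) du`.) [folklore] -/
theorem im_integral_logDeriv_Gammaℝ {T : ℝ} (hT : 0 ≤ T) :
    (I * ∫ y in (0 : ℝ)..T, logDeriv Gammaℝ (2 + y * I)).im -
      (∫ x in (1 / 2 : ℝ)..2, logDeriv Gammaℝ (x + T * I)).im = riemannSiegelTheta T := by
  set G := logDeriv Gammaℝ with hG
  have han : ∀ z : ℂ, 0 < z.re → AnalyticAt ℂ G z := fun z hz ↦ analyticAt_logDeriv_Gammaℝ hz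
  have hCG := Literature.Analysis.Complex.rectBoundaryIntegral_eq_zero_of_differentiableOn (F := G)
    (a := 1 / 2) (b := 2) (c := 0) (d := T) (by norm_num) hT (fun z hz ↦ by
      refine (han z ?_).differentiableAt.differentiableWithinAt
      have := (mem_reProdIm.1 hz).1.1
      linarith)
  rw [Literature.Analysis.Complex.rectBoundaryIntegral_def] at hCG
  simp only [ofReal_ofNat] at hCG
  -- bottom edge: real values
  have hbot : (∫ x in (1 / 2 : ℝ)..2, G (x + (0 : ℝ) * I)).im = 0 := by
    have hint : IntervalIntegrable (fun x : ℝ ↦ G (x + (0 : ℝ) * I)) volume (1 / 2) 2 :=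
      Literature.Analysis.Complex.intervalIntegrable_of_continuousAt_horizontal (F := G) 0 (by norm_num)
        fun x hx ↦ (han _ (by simp; linarith [hx.1])).continuousAt
    have hcomm := ContinuousLinearMap.intervalIntegral_comp_comm (𝕜 := ℝ) imCLM hint
    simp only [imCLM_apply] at hcomm
    rw [← hcomm]
    have hzero : EqOn (fun x : ℝ ↦ (G (x + (0 : ℝ) * I)).im) (fun _ ↦ 0) (uIcc (1 / 2 : ℝ) 2) := by
      intro x hx
      rw [uIcc_of_le (by norm_num)] at hx
      have e : (x : ℂ) + (0 : ℝ) * I = (x : ℂ) := by simp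
      simp only [e]
      exact logDeriv_Gammaℝ_ofReal_im (by linarith [hx.1])
    rw [intervalIntegral.integral_congr hzero]
    simp
  -- left edge: `θ(T)` by definition
  have hleft : (I * ∫ y in (0 : ℝ)..T, G ((1 / 2 : ℝ) + y * I)).im = riemannSiegelTheta T := by
    have hint : IntervalIntegrable (fun y : ℝ ↦ G ((1 / 2 : ℝ) + y * I)) volume 0 T :=
      Literature.Analysis.Complex.intervalIntegrable_of_continuousAt_vertical (F := G) (1 / 2) hT
        fun y hy ↦ (han _ (by simp)).continuousAt
    rw [mul_im, I_re, I_im, zero_mul, one_mul, zero_add]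
    have hcomm := ContinuousLinearMap.intervalIntegral_comp_comm (𝕜 := ℝ) reCLM hint
    simp only [reCLM_apply] at hcomm
    rw [← hcomm, riemannSiegelTheta]
    exact intervalIntegral.integral_congr fun y _ ↦ logDeriv_Gammaℝ_half_add_re y
  have him := congrArg Complex.im hCG
  simp only [sub_im, add_im, zero_im] at him
  rw [hbot, hleft] at him
  linarith

/-! ### `ξ'/ξ = 1/s + 1/(s−1) + logDeriv Γℝ + ζ'/ζ` -/

/-- `ζ'/ζ` is continuous at every `s ≠ 1` with `ζ(s) ≠ 0`. [folklore] -/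
theorem continuousAt_logDeriv_riemannZeta {s : ℂ} (hs1 : s ≠ 1) (hζ : riemannZeta s ≠ 0) :
    ContinuousAt (fun z ↦ deriv riemannZeta z / riemannZeta z) s :=
  (analyticOn_riemannZeta s hs1).deriv.continuousAt.div
    (differentiableAt_riemannZeta hs1).continuousAt hζ

/-- `ξ'/ξ` is continuous at every point where `ξ ≠ 0` (pointwise form of
`Literature.NumberTheory.LFunctions.continuousOn_logDeriv_riemannXi`). [folklore] -/
theorem continuousAt_logDeriv_riemannXi {s : ℂ} (hs : riemannXi s ≠ 0) :
    ContinuousAt (fun z ↦ deriv riemannXi z / riemannXi z) s := by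
  have h := continuousOn_logDeriv_riemannXi.continuousAt
    ((isOpen_ne_fun differentiable_riemannXi.continuous continuous_const).mem_nhds hs)
  exact h

/-- **The logarithmic derivative of `ξ(s) = ½ s(s−1) Γℝ(s) ζ(s)`**: for `Re s > 0`, `s ≠ 1`,
`ζ(s) ≠ 0`, `ξ'/ξ(s) = 1/s + 1/(s − 1) + (Γℝ'/Γℝ)(s) + (ζ'/ζ)(s)` (Titchmarsh §2.12, §9.3). From
`Literature.NumberTheory.LFunctions.logDeriv_riemannXi_eq` (`ξ'/ξ = 1/s + Γℝ'/Γℝ + ζ₁'/ζ₁`, `RiemannXiLogDeriv.lean`) and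
`ζ₁'/ζ₁ = ζ'/ζ + 1/(s−1)` (`Literature.NumberTheory.LFunctions.logDeriv_riemannZeta_eq`). [folklore] -/
theorem logDeriv_riemannXi_eq_add_logDeriv_riemannZeta {s : ℂ} (hs : 0 < s.re) (hs1 : s ≠ 1)
    (hζ : riemannZeta s ≠ 0) :
    deriv riemannXi s / riemannXi s =
      (s⁻¹ + (s - 1)⁻¹) + logDeriv Gammaℝ s + deriv riemannZeta s / riemannZeta s := by
  have hζ₁ : riemannZeta₁ s ≠ 0 := fun h ↦ hζ ((Literature.NumberTheory.LFunctions.riemannZeta₁_eq_zero_iff hs1).1 h)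
  rw [← logDeriv_apply, ← logDeriv_apply, logDeriv_riemannXi_eq hs hζ₁,
    Literature.NumberTheory.LFunctions.logDeriv_riemannZeta_eq hs1 hζ]
  ring

/-! ### Backlund's formula: `S(T)` as the variation of `arg ζ` along `2 → 2 + iT → ½ + iT` -/

/-- **Backlund's formula** (Titchmarsh Thm. 9.3, eqs. (9.3.1)–(9.3.2); Backlund 1918). For `T > 0`
not the ordinate of a zero of `ζ`,
`π S(T) = Im (i ∫₀ᵀ (ζ'/ζ)(2 + iy) dy) − Im ∫_{1/2}^{2} (ζ'/ζ)(x + iT) dx`,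
i.e. `π S(T) = Δ arg ζ(s)` along the segments `2 → 2 + iT → ½ + iT`. Here `S(T) = zetaArgS T` is
the tree's Backlund-form *definition* `S(T) := N(T) − θ(T)/π − 1`, so this is the statement
`N(T) = 1 + θ(T)/π + (1/π) Δ arg ζ`, obtained from the argument principle for `ξ` on
`[−1, 2] × [−T, T]` (`2N(T)` zeros), the symmetries `ξ(1−s) = ξ(s) = conj ξ(s̄)` folding the
boundary onto the quarter `2 → 2+iT → ½+iT`, and the evaluation of the factors `s(s−1)` (`π`)
and `Γℝ` (`θ(T)`). [cite: Titchmarsh1986, Thm. 9.3] -/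
theorem pi_mul_zetaArgS_eq {T : ℝ} (hT : 0 < T) (hT' : ∀ ρ : ℂ, riemannZeta ρ = 0 → ρ.im ≠ T) :
    π * zetaArgS T =
      (I * ∫ y in (0 : ℝ)..T, deriv riemannZeta (2 + y * I) / riemannZeta (2 + y * I)).im -
        (∫ x in (1 / 2 : ℝ)..2, deriv riemannZeta (x + T * I) / riemannZeta (x + T * I)).im := by
  set F : ℂ → ℂ := fun z ↦ deriv riemannXi z / riemannXi z with hF
  -- the argument principle for `ξ` on `[−1, 2] × [−T, T]`
  have hAP := Literature.Analysis.Complex.integral_boundary_rect_logDeriv (f := riemannXi) (a := -1) (b := 2)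
    (c := -T) (d := T) (by norm_num) (by linarith) (analyticOnNhd_riemannXi _)
    (fun x _ ↦ riemannXi_ne_zero_of_im_eq hT' (Or.inr (by simp)))
    (fun x _ ↦ riemannXi_ne_zero_of_im_eq hT' (Or.inl (by simp)))
    (fun y _ ↦ riemannXi_ne_zero_of_re_le_zero (by simp))
    (fun y _ ↦ riemannXi_ne_zero_of_one_le_re (by simp))
  rw [finsum_order_riemannXi_eq hT hT'] at hAP
  have hAP' : Literature.Analysis.Complex.rectBoundaryIntegral F (-1) 2 (-T) T =
      2 * Real.pi * I * (2 * (zetaZeroCount T : ℂ)) := by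
    rw [Literature.Analysis.Complex.rectBoundaryIntegral_def]
    exact hAP
  -- folding
  have hζT : ∀ x : ℝ, riemannZeta (x + T * I) ≠ 0 := fun x h ↦ hT' _ h (by simp)
  have hfold := rectBoundaryIntegral_eq_of_symmetric (F := F) hT.le
    (fun s ↦ logDeriv_riemannXi_one_sub s) (fun s ↦ logDeriv_riemannXi_conj s)
    (fun y _ ↦ continuousAt_logDeriv_riemannXi (riemannXi_ne_zero_of_one_le_re (by simp)))
    (fun x _ ↦ continuousAt_logDeriv_riemannXi (riemannXi_ne_zero_of_im_eq hT' (Or.inl (by simp))))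
  rw [hfold] at hAP'
  have hCre : (∫ y in (0 : ℝ)..T, (F (2 + y * I)).re) = (∫ y in (0 : ℝ)..T, F (2 + y * I)).re := by
    have hint : IntervalIntegrable (fun y : ℝ ↦ F (2 + y * I)) volume 0 T := by
      have := Literature.Analysis.Complex.intervalIntegrable_of_continuousAt_vertical (F := F) 2 hT.le fun y _ ↦
        continuousAt_logDeriv_riemannXi (riemannXi_ne_zero_of_one_le_re (by simp))
      simpa using this
    have := ContinuousLinearMap.intervalIntegral_comp_comm (𝕜 := ℝ) reCLM hint
    simpa using this
  have hmain : (∫ y in (0 : ℝ)..T, F (2 + y * I)).re - (∫ x in (1 / 2 : ℝ)..2, F (x + T * I)).im =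
      π * zetaZeroCount T := by
    rw [← hCre]
    set A : ℝ := ∫ y in (0 : ℝ)..T, (F (2 + y * I)).re
    set B : ℂ := ∫ x in (1 / 2 : ℝ)..2, F (x + T * I)
    have := congrArg Complex.im hAP'
    simp only [mul_im, mul_re, I_re, I_im, ofReal_re, ofReal_im, sub_re, sub_im, re_ofNat, im_ofNat,
      natCast_re, natCast_im] at this
    simp at this
    linarith
  -- decomposition of `F` on the two segments
  have hdec : ∀ z : ℂ, 0 < z.re → z ≠ 1 → riemannZeta z ≠ 0 →
      F z = (z⁻¹ + (z - 1)⁻¹) + logDeriv Gammaℝ z + deriv riemannZeta z / riemannZeta z :=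
    fun z h0 h1 h2 ↦ logDeriv_riemannXi_eq_add_logDeriv_riemannZeta h0 h1 h2
  have hv1 : ∀ y : ℝ, (2 : ℂ) + y * I ≠ 1 := fun y h ↦ by
    have := congrArg Complex.re h; norm_num at this
  have hh1 : ∀ x : ℝ, (x : ℂ) + T * I ≠ 1 := fun x h ↦ by
    have := congrArg Complex.im h; simp at this; exact hT.ne' this
  have hCdec : ∫ y in (0 : ℝ)..T, F (2 + y * I) =
      (∫ y in (0 : ℝ)..T, ((2 + (y : ℂ) * I)⁻¹ + (2 + (y : ℂ) * I - 1)⁻¹)) +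
        (∫ y in (0 : ℝ)..T, logDeriv Gammaℝ (2 + y * I)) +
        ∫ y in (0 : ℝ)..T, deriv riemannZeta (2 + y * I) / riemannZeta (2 + y * I) := by
    have i1 : IntervalIntegrable (fun y : ℝ ↦ (2 + (y : ℂ) * I)⁻¹ + (2 + (y : ℂ) * I - 1)⁻¹)
        volume 0 T := by
      refine ((Continuous.inv₀ (by fun_prop) fun y h ↦ ?_).add
        (Continuous.inv₀ (by fun_prop) fun y h ↦ ?_)).intervalIntegrable _ _
      · have := congrArg Complex.re h; norm_num at this
      · have := congrArg Complex.re h; norm_num at this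
    have i2 : IntervalIntegrable (fun y : ℝ ↦ logDeriv Gammaℝ (2 + y * I)) volume 0 T := by
      have := Literature.Analysis.Complex.intervalIntegrable_of_continuousAt_vertical (F := logDeriv Gammaℝ) 2
        hT.le fun y _ ↦ (analyticAt_logDeriv_Gammaℝ (by simp)).continuousAt
      simpa using this
    have i3 : IntervalIntegrable
        (fun y : ℝ ↦ deriv riemannZeta (2 + y * I) / riemannZeta (2 + y * I)) volume 0 T := by
      have := Literature.Analysis.Complex.intervalIntegrable_of_continuousAt_vertical
        (F := fun z ↦ deriv riemannZeta z / riemannZeta z) 2 hT.le fun y _ ↦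
          continuousAt_logDeriv_riemannZeta (by exact_mod_cast hv1 y)
            (by exact_mod_cast Literature.NumberTheory.LFunctions.riemannZeta_two_add_ne_zero y)
      simpa using this
    rw [← intervalIntegral.integral_add i1 i2, ← intervalIntegral.integral_add (i1.add i2) i3]
    refine intervalIntegral.integral_congr fun y _ ↦ ?_
    exact hdec _ (by simp) (hv1 y) (Literature.NumberTheory.LFunctions.riemannZeta_two_add_ne_zero y)
  have hBdec : ∫ x in (1 / 2 : ℝ)..2, F (x + T * I) =
      (∫ x in (1 / 2 : ℝ)..2, (((x : ℂ) + T * I)⁻¹ + ((x : ℂ) + T * I - 1)⁻¹)) +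
        (∫ x in (1 / 2 : ℝ)..2, logDeriv Gammaℝ (x + T * I)) +
        ∫ x in (1 / 2 : ℝ)..2, deriv riemannZeta (x + T * I) / riemannZeta (x + T * I) := by
    have i1 : IntervalIntegrable (fun x : ℝ ↦ ((x : ℂ) + T * I)⁻¹ + ((x : ℂ) + T * I - 1)⁻¹)
        volume (1 / 2) 2 := by
      refine ((Continuous.inv₀ (by fun_prop) fun x h ↦ ?_).add
        (Continuous.inv₀ (by fun_prop) fun x h ↦ ?_)).intervalIntegrable _ _
      · have := congrArg Complex.im h; simp at this; exact hT.ne' this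
      · have := congrArg Complex.im h; simp at this; exact hT.ne' this
    have i2 : IntervalIntegrable (fun x : ℝ ↦ logDeriv Gammaℝ (x + T * I)) volume (1 / 2) 2 :=
      Literature.Analysis.Complex.intervalIntegrable_of_continuousAt_horizontal (F := logDeriv Gammaℝ) T
        (by norm_num) fun x hx ↦ (analyticAt_logDeriv_Gammaℝ (by simp; linarith [hx.1])).continuousAt
    have i3 : IntervalIntegrable
        (fun x : ℝ ↦ deriv riemannZeta (x + T * I) / riemannZeta (x + T * I)) volume (1 / 2) 2 :=
      Literature.Analysis.Complex.intervalIntegrable_of_continuousAt_horizontal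
        (F := fun z ↦ deriv riemannZeta z / riemannZeta z) T (by norm_num) fun x _ ↦
          continuousAt_logDeriv_riemannZeta (hh1 x) (hζT x)
    rw [← intervalIntegral.integral_add i1 i2, ← intervalIntegral.integral_add (i1.add i2) i3]
    refine intervalIntegral.integral_congr fun x hx ↦ ?_
    rw [uIcc_of_le (by norm_num)] at hx
    exact hdec _ (by simp; linarith [hx.1]) (hh1 x) (hζT x)
  have h4a := im_integral_inv_add_inv_sub_one hT
  have h4b := im_integral_logDeriv_Gammaℝ hT.le
  rw [hCdec, hBdec] at hmain
  set C0 : ℂ := ∫ y in (0 : ℝ)..T, ((2 + (y : ℂ) * I)⁻¹ + (2 + (y : ℂ) * I - 1)⁻¹)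
  set C1 : ℂ := ∫ y in (0 : ℝ)..T, logDeriv Gammaℝ (2 + y * I)
  set C2 : ℂ := ∫ y in (0 : ℝ)..T, deriv riemannZeta (2 + y * I) / riemannZeta (2 + y * I)
  set B0 : ℂ := ∫ x in (1 / 2 : ℝ)..2, (((x : ℂ) + T * I)⁻¹ + ((x : ℂ) + T * I - 1)⁻¹)
  set B1 : ℂ := ∫ x in (1 / 2 : ℝ)..2, logDeriv Gammaℝ (x + T * I)
  set B2 : ℂ := ∫ x in (1 / 2 : ℝ)..2, deriv riemannZeta (x + T * I) / riemannZeta (x + T * I)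
  simp only [mul_im, I_re, I_im, zero_mul, one_mul, zero_add, add_re, add_im] at hmain h4a h4b ⊢
  have hπ : π ≠ 0 := Real.pi_ne_zero
  have hS : π * zetaArgS T = π * zetaZeroCount T - riemannSiegelTheta T - π := by
    rw [zetaArgS, mul_sub, mul_sub, mul_div_cancel₀ _ hπ, mul_one]
  rw [hS]
  linarith


/-! ### `S(T) = O(log T)` (Titchmarsh Thm. 9.4) -/

/-- `Re ζ(2 + iy) ≥ 2 − π²/6 > 0`. [folklore] -/
theorem re_riemannZeta_two_add_pos (y : ℝ) : 0 < (riemannZeta (2 + y * I)).re := by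
  have h := Literature.NumberTheory.LFunctions.norm_riemannZeta_two_add_sub_one_le y
  have h1 : |(riemannZeta (2 + y * I) - 1).re| ≤ ‖riemannZeta (2 + y * I) - 1‖ := abs_re_le_norm _
  rw [sub_re, one_re] at h1
  have hπ : π ^ 2 / 6 - 1 < 1 := by
    have := Real.pi_lt_d2
    nlinarith [Real.pi_pos]
  have := (abs_le.1 (h1.trans h)).1
  linarith

/-- **The vertical term is at most `π`**: `Im(i ∫₀ᵀ ζ'/ζ(2+iy) dy) = arg ζ(2+iT) − arg ζ(2)` and
`Re ζ > 0` on `Re s = 2`. (Titchmarsh §9.3.) [cite: Titchmarsh1986, Thm. 9.4] -/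
theorem abs_im_integral_logDeriv_riemannZeta_vertical_le {T : ℝ} (hT : 0 ≤ T) :
    |(I * ∫ y in (0 : ℝ)..T, deriv riemannZeta (2 + y * I) / riemannZeta (2 + y * I)).im| ≤ π := by
  have hne1 : ∀ y : ℝ, ((2 : ℝ) : ℂ) + y * I ≠ 1 := fun y h ↦ by
    have := congrArg Complex.re h; norm_num at this
  have han : ∀ y ∈ Icc 0 T, AnalyticAt ℂ riemannZeta ((2 : ℝ) + y * I) := fun y _ ↦
    analyticOn_riemannZeta _ (hne1 y)
  have hslit : ∀ y ∈ Icc 0 T, riemannZeta ((2 : ℝ) + y * I) ∈ slitPlane := fun y _ ↦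
    Or.inl (by simpa using re_riemannZeta_two_add_pos y)
  have h := Literature.Analysis.Complex.integral_logDeriv_vertical (g := riemannZeta) 2 hT han hslit
  simp only [ofReal_ofNat] at h
  rw [h, sub_im, log_im, log_im]
  simp only [ofReal_zero, zero_mul, add_zero]
  have a1 := abs_arg_le_pi_div_two_iff.2 (re_riemannZeta_two_add_pos T).le
  have a2 := abs_arg_le_pi_div_two_iff.2 (re_riemannZeta_two_add_pos 0).le
  simp only [ofReal_zero, zero_mul, add_zero] at a2
  have := abs_sub (arg (riemannZeta (2 + T * I))) (arg (riemannZeta 2))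
  linarith

/-- **The horizontal term is `O(log T)`** by Backlund's lemma
(`Literature.Analysis.Complex.abs_im_integral_logDeriv_le_backlund`) on the discs `|s − (2+iT)| ≤ 3/2 < 7/4`, where
`|ζ| ≤ 40 (T + 4)` (`Literature.NumberTheory.LFunctions.norm_riemannZeta_le_of_mem_jensenDisc`) and `|ζ(2+iT)| ≥ 1/3`: for
`T ≥ 2` with `ζ ≠ 0` on `[½, 2] × {T}`,
`|Im ∫_{1/2}^{2} ζ'/ζ(x+iT) dx| ≤ π (log(120 (T+4))/log(7/6) + 1)`. (Titchmarsh §9.4.)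
[cite: Titchmarsh1986, Thm. 9.4] -/
theorem abs_im_integral_logDeriv_riemannZeta_horizontal_le {T : ℝ} (hT : 2 ≤ T)
    (hζ : ∀ x ∈ Icc (1 / 2 : ℝ) 2, riemannZeta (x + T * I) ≠ 0) :
    |(∫ x in (1 / 2 : ℝ)..2, deriv riemannZeta (x + T * I) / riemannZeta (x + T * I)).im| ≤
      π * (Real.log (120 * (T + 4)) / Real.log (7 / 6) + 1) := by
  have hT' : 2 ≤ |T| := by rwa [abs_of_nonneg (by linarith)]
  have hTabs : |T| = T := abs_of_nonneg (by linarith)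
  have hM : (1 : ℝ) ≤ 40 * (T + 4) := by linarith
  have hsub : closedBall ((2 : ℂ) + T * I) (7 / 4) ⊆ closedBall ((2 : ℂ) + T * I) (39 / 20) :=
    closedBall_subset_closedBall (by norm_num)
  have hg : ∀ z ∈ closedBall (((2 : ℝ) : ℂ) + T * I) (7 / 4), AnalyticAt ℂ riemannZeta z := by
    intro z hz
    simp only [ofReal_ofNat] at hz
    exact Literature.NumberTheory.LFunctions.analyticOnNhd_riemannZeta_jensenDisc hT' (by norm_num) z hz
  have hgM : ∀ z ∈ closedBall (((2 : ℝ) : ℂ) + T * I) (7 / 4), ‖riemannZeta z‖ ≤ 40 * (T + 4) := by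
    intro z hz
    simp only [ofReal_ofNat] at hz
    have := Literature.NumberTheory.LFunctions.norm_riemannZeta_le_of_mem_jensenDisc hT' (hsub hz)
    rwa [hTabs] at this
  have hc : riemannZeta ((2 : ℝ) + T * I) ≠ 0 := by
    simpa using Literature.NumberTheory.LFunctions.riemannZeta_two_add_ne_zero T
  have h := Literature.Analysis.Complex.abs_im_integral_logDeriv_le_backlund (g := riemannZeta) (c := 2) (y := T)
    (r := 3 / 2) (R := 7 / 4) (M := 40 * (T + 4)) (a := 1 / 2) (b := 2) (by norm_num) (by norm_num)
    hM hg hgM hc (by norm_num) (by norm_num) (by norm_num) hζ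
  refine h.trans ?_
  have hlog76 : 0 < Real.log (7 / 4 / (3 / 2)) := Real.log_pos (by norm_num)
  have hnorm : 1 / 3 ≤ ‖riemannZeta ((2 : ℝ) + T * I)‖ := by
    simpa using Literature.NumberTheory.LFunctions.one_third_le_norm_riemannZeta_two_add T
  have hpos : 0 < ‖riemannZeta ((2 : ℝ) + T * I)‖ := by linarith
  have h1 : Real.log (40 * (T + 4) / ‖riemannZeta ((2 : ℝ) + T * I)‖) ≤ Real.log (120 * (T + 4)) := by
    apply Real.log_le_log (div_pos (by linarith) hpos)
    rw [div_le_iff₀ hpos]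
    nlinarith
  have h2 : (7 : ℝ) / 4 / (3 / 2) = 7 / 6 := by norm_num
  rw [h2] at hlog76 ⊢
  have := div_le_div_of_nonneg_right h1 hlog76.le
  nlinarith [Real.pi_pos]

/-- **`S(T) ≪ log T` off the ordinates** (Titchmarsh Thm. 9.4, explicit form): for `T ≥ 2` not the
ordinate of a zero of `ζ`, `|S(T)| ≤ 2 + log(120 (T + 4))/log(7/6)`. [cite: Titchmarsh1986, Thm. 9.4] -/
theorem abs_zetaArgS_le_of_not_ordinate {T : ℝ} (hT : 2 ≤ T)
    (hT' : ∀ ρ : ℂ, riemannZeta ρ = 0 → ρ.im ≠ T) :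
    |zetaArgS T| ≤ 2 + Real.log (120 * (T + 4)) / Real.log (7 / 6) := by
  have hπ := Real.pi_pos
  have h := pi_mul_zetaArgS_eq (by linarith) hT'
  have hv := abs_im_integral_logDeriv_riemannZeta_vertical_le (T := T) (by linarith)
  have hh := abs_im_integral_logDeriv_riemannZeta_horizontal_le hT
    fun x _ h0 ↦ hT' _ h0 (by simp)
  have key : π * |zetaArgS T| ≤ π + π * (Real.log (120 * (T + 4)) / Real.log (7 / 6) + 1) := by
    rw [← abs_of_pos hπ, ← abs_mul, abs_of_pos hπ, h]
    exact (abs_sub _ _).trans (add_le_add hv hh)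
  have : π * |zetaArgS T| ≤ π * (2 + Real.log (120 * (T + 4)) / Real.log (7 / 6)) := by linarith
  exact le_of_mul_le_mul_left this hπ

/-- **Shifting off the ordinates.** For every `T ≥ 0` there is `T' ∈ (T, T + 1)` such that no zero
of `ζ` has ordinate in `(T, T']`; then `N(T') = N(T)` and `T'` is not an ordinate. [folklore] -/
theorem exists_gt_no_ordinate {T : ℝ} (hT : 0 ≤ T) :
    ∃ T' : ℝ, T < T' ∧ T' < T + 1 ∧ ∀ ρ : ℂ, riemannZeta ρ = 0 → ¬(T < ρ.im ∧ ρ.im ≤ T') := by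
  classical
  set Z : Set ℂ := {ρ ∈ zetaZeroBox 0 (T + 1) | T < ρ.im} with hZ
  have hfin : Z.Finite := (zetaZeroBox_finite 0 (T + 1)).subset (sep_subset _ _)
  set F : Finset ℝ := insert (T + 1) (hfin.toFinset.image Complex.im) with hF
  have hne : F.Nonempty := Finset.insert_nonempty _ _
  set m : ℝ := F.min' hne with hm
  have hmle : m ≤ T + 1 := Finset.min'_le _ _ (Finset.mem_insert_self _ _)
  have hmgt : T < m := by
    have hmem := Finset.min'_mem F hne
    rw [← hm] at hmem
    rcases Finset.mem_insert.1 hmem with h | h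
    · linarith
    · obtain ⟨ρ, hρ, hρm⟩ := Finset.mem_image.1 h
      rw [Set.Finite.mem_toFinset] at hρ
      rw [← hρm]
      exact hρ.2
  refine ⟨(T + m) / 2, by linarith, by linarith, ?_⟩
  rintro ρ hζ ⟨h1, h2⟩
  have him : ρ.im ≠ 0 := by
    intro h0
    rw [h0] at h1
    linarith
  have hst := re_mem_Ioo_of_riemannZeta_eq_zero_of_im_ne_zero hζ him
  have hρZ : ρ ∈ Z := ⟨⟨hζ, hst.1.le, hst.2.le, by linarith, by linarith⟩, h1⟩
  have hρF : ρ.im ∈ F :=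
    Finset.mem_insert_of_mem (Finset.mem_image.2 ⟨ρ, (Set.Finite.mem_toFinset hfin).2 hρZ, rfl⟩)
  have := Finset.min'_le F _ hρF
  rw [← hm] at this
  linarith

/-- If no zero of `ζ` has ordinate in `(T, T']` (`T ≤ T'`), then `N(T') = N(T)`. [folklore] -/
theorem zetaZeroCount_eq_of_no_ordinate {T T' : ℝ} (hTT' : T ≤ T')
    (h : ∀ ρ : ℂ, riemannZeta ρ = 0 → ¬(T < ρ.im ∧ ρ.im ≤ T')) :
    zetaZeroCount T' = zetaZeroCount T := by
  have hbox : zetaZeroBox 0 T' = zetaZeroBox 0 T := by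
    ext ρ
    constructor
    · rintro ⟨h0, h1, h2, h3, h4⟩
      exact ⟨h0, h1, h2, h3, le_of_not_gt fun hlt ↦ h ρ h0 ⟨hlt, h4⟩⟩
    · rintro ⟨h0, h1, h2, h3, h4⟩
      exact ⟨h0, h1, h2, h3, h4.trans hTT'⟩
  unfold zetaZeroCount zetaZeroCountRe
  rw [hbox]

/-- `|θ(T') − θ(T)| ≤ (1 + log(T+1)/2)(T' − T)` for `7 ≤ T ≤ T' ≤ T + 1`
(`|θ'(u) − ½ log(u/2π)| ≤ 2/u`, `Literature.NumberTheory.LFunctions.abs_riemannSiegelThetaDeriv_sub_log_le`). [folklore] -/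
theorem ZetaArgVariation.abs_riemannSiegelTheta_sub_le {T T' : ℝ} (hT : 7 ≤ T) (hTT' : T ≤ T') (hT' : T' ≤ T + 1) :
    |riemannSiegelTheta T' - riemannSiegelTheta T| ≤ (1 + Real.log (T + 1) / 2) * (T' - T) := by
  have hcont := continuous_riemannSiegelThetaDeriv_holds
  have hint : ∀ a b : ℝ, IntervalIntegrable riemannSiegelThetaDeriv volume a b := fun a b ↦
    hcont.intervalIntegrable a b
  have hsub : riemannSiegelTheta T' - riemannSiegelTheta T =
      ∫ u in T..T', riemannSiegelThetaDeriv u := by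
    simp only [riemannSiegelTheta]
    rw [intervalIntegral.integral_interval_sub_left (hint 0 T') (hint 0 T)]
  rw [hsub]
  have hbound : ∀ u ∈ Set.uIoc T T', ‖riemannSiegelThetaDeriv u‖ ≤ 1 + Real.log (T + 1) / 2 := by
    intro u hu
    rw [uIoc_of_le hTT'] at hu
    have hu1 : 1 ≤ u := by linarith [hu.1]
    have h1 := abs_riemannSiegelThetaDeriv_sub_log_le hu1
    have h2π : 1 ≤ u / (2 * π) := by
      rw [le_div_iff₀ (by positivity)]
      have := Real.pi_lt_d2
      linarith [hu.1]
    have hlog0 : 0 ≤ Real.log (u / (2 * π)) := Real.log_nonneg h2π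
    have hlog1 : Real.log (u / (2 * π)) ≤ Real.log (T + 1) := by
      apply Real.log_le_log (by positivity)
      rw [div_le_iff₀ (by positivity)]
      have := Real.pi_gt_three
      nlinarith [hu.2]
    have h2u : 2 / u ≤ 1 := by
      rw [div_le_iff₀ (by linarith)]
      linarith [hu.1]
    rw [Real.norm_eq_abs]
    have := abs_sub_abs_le_abs_sub (riemannSiegelThetaDeriv u) (Real.log (u / (2 * π)) / 2)
    rw [abs_of_nonneg (by linarith : 0 ≤ Real.log (u / (2 * π)) / 2)] at this
    linarith
  have := intervalIntegral.norm_integral_le_of_norm_le_const hbound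
  rw [Real.norm_eq_abs, abs_of_nonneg (by linarith : 0 ≤ T' - T)] at this
  exact this

/-- **`S(T) ≪ log T` for all large `T`** (Titchmarsh Thm. 9.4, explicit): for `T ≥ 7`,
`|S(T)| ≤ 3 + log(120 (T + 5))/log(7/6) + log(T + 1)/6`. At an ordinate `T` one passes to a
nearby non-ordinate `T' ∈ (T, T+1)` with `N(T') = N(T)` and uses `|θ(T') − θ(T)| ≤ 1 + ½ log(T+1)`.
[cite: Titchmarsh1986, Thm. 9.4] -/
theorem abs_zetaArgS_le {T : ℝ} (hT : 7 ≤ T) :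
    |zetaArgS T| ≤ 3 + Real.log (120 * (T + 5)) / Real.log (7 / 6) + Real.log (T + 1) / 6 := by
  obtain ⟨T', h1, h2, h3⟩ := exists_gt_no_ordinate (T := T) (by linarith)
  have hN : zetaZeroCount T' = zetaZeroCount T := zetaZeroCount_eq_of_no_ordinate h1.le h3
  have hT'ord : ∀ ρ : ℂ, riemannZeta ρ = 0 → ρ.im ≠ T' := fun ρ hρ he ↦
    h3 ρ hρ ⟨by linarith, he.le⟩
  have hS' := abs_zetaArgS_le_of_not_ordinate (by linarith) hT'ord
  have hθ := ZetaArgVariation.abs_riemannSiegelTheta_sub_le hT h1.le h2.le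
  have hπ := Real.pi_pos
  have hπ3 := Real.pi_gt_three
  have hdiff : zetaArgS T = zetaArgS T' + (riemannSiegelTheta T' - riemannSiegelTheta T) / π := by
    simp only [zetaArgS, hN]
    field_simp
    ring
  have hlogT1 : 0 ≤ Real.log (T + 1) := Real.log_nonneg (by linarith)
  have hθ' : |riemannSiegelTheta T' - riemannSiegelTheta T| ≤ 1 + Real.log (T + 1) / 2 := by
    refine hθ.trans ?_
    have : (1 + Real.log (T + 1) / 2) * (T' - T) ≤ (1 + Real.log (T + 1) / 2) * 1 :=
      mul_le_mul_of_nonneg_left (by linarith) (by linarith)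
    linarith
  have hdivle : |(riemannSiegelTheta T' - riemannSiegelTheta T) / π| ≤
      (1 + Real.log (T + 1) / 2) / 3 := by
    rw [abs_div, abs_of_pos hπ]
    calc |riemannSiegelTheta T' - riemannSiegelTheta T| / π
        ≤ (1 + Real.log (T + 1) / 2) / π := div_le_div_of_nonneg_right hθ' hπ.le
      _ ≤ (1 + Real.log (T + 1) / 2) / 3 :=
          div_le_div_of_nonneg_left (by linarith) (by norm_num) hπ3.le
  have hmono : Real.log (120 * (T' + 4)) / Real.log (7 / 6) ≤
      Real.log (120 * (T + 5)) / Real.log (7 / 6) := by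
    apply div_le_div_of_nonneg_right _ (Real.log_pos (by norm_num)).le
    exact Real.log_le_log (by linarith) (by linarith)
  rw [hdiff]
  have := abs_add_le (zetaArgS T') ((riemannSiegelTheta T' - riemannSiegelTheta T) / π)
  linarith

/-- **Titchmarsh Thm. 9.4 / Backlund 1918: `S(T) = O(log T)`** — discharge of the named fact
`Literature.NumberTheory.LFunctions.isBigO_zetaArgS_log` of `RiemannSiegel.lean`. [cite: Titchmarsh1986, Thm. 9.4] -/
theorem isBigO_zetaArgS_log_holds : isBigO_zetaArgS_log := by
  rw [isBigO_zetaArgS_log, Asymptotics.isBigO_iff]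
  refine ⟨25, ?_⟩
  filter_upwards [eventually_ge_atTop (240 : ℝ)] with T hT
  have hlogT : 1 ≤ Real.log T := by
    rw [← Real.log_exp 1]
    refine Real.log_le_log (Real.exp_pos 1) ?_
    have := Real.exp_one_lt_d9
    linarith
  have h76 : 1 / 7 ≤ Real.log (7 / 6) := by
    have := Real.one_sub_inv_le_log_of_pos (x := 7 / 6) (by norm_num)
    norm_num at this ⊢
    linarith
  have hl1 : Real.log (120 * (T + 5)) ≤ 2 * Real.log T := by
    rw [← Real.log_rpow (by linarith), Real.rpow_two]
    exact Real.log_le_log (by linarith) (by nlinarith)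
  have hl2 : Real.log (T + 1) ≤ 2 * Real.log T := by
    rw [← Real.log_rpow (by linarith), Real.rpow_two]
    exact Real.log_le_log (by linarith) (by nlinarith)
  have hS := abs_zetaArgS_le (T := T) (by linarith)
  have hq : Real.log (120 * (T + 5)) / Real.log (7 / 6) ≤ 14 * Real.log T := by
    rw [div_le_iff₀ (by linarith)]
    nlinarith
  rw [Real.norm_eq_abs, Real.norm_eq_abs, abs_of_pos (by linarith : 0 < Real.log T)]
  linarith

/-! ### Consequences: the Riemann–von Mangoldt formula and the ordinates API -/

/-- **rh.S11, the Riemann–von Mangoldt formula `N(T) = (T/2π) log(T/2π) − T/2π + O(log T)`** —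
discharge of the named fact `Literature.NumberTheory.LFunctions.riemann_von_mangoldt` (`ZeroCounting.lean`): by definition
`N(T) = θ(T)/π + 1 + S(T)`, with `θ(T) = (T/2) log(T/2π) − T/2 + O(log T)`
(`Literature.NumberTheory.LFunctions.isBigO_riemannSiegelTheta_sub_stirlingMain`) and `S(T) = O(log T)`. (von Mangoldt 1905;
Titchmarsh Thm. 9.4.) [cite: Titchmarsh1986, Thm. 9.4] -/
theorem riemann_von_mangoldt_holds : riemann_von_mangoldt := by
  have h1 := isBigO_riemannSiegelTheta_sub_stirlingMain.const_mul_left (1 / π)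
  have h2 := isBigO_zetaArgS_log_holds
  rw [isBigO_zetaArgS_log] at h2
  have h3 : (fun _ : ℝ ↦ (1 : ℝ)) =O[atTop] Real.log :=
    (Real.isLittleO_const_log_atTop (c := (1 : ℝ))).isBigO
  refine ((h1.add h3).add h2).congr_left fun T ↦ ?_
  have hπ : π ≠ 0 := Real.pi_ne_zero
  simp only [zetaArgS]
  field_simp
  ring

/-- `N(T) → ∞` — discharge of the named fact `Literature.NumberTheory.LFunctions.tendsto_zetaZeroCount_atTop` (`ZetaZeros.lean`).
[cite: Titchmarsh1986, Thm. 9.4] -/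
theorem tendsto_zetaZeroCount_atTop_holds : tendsto_zetaZeroCount_atTop :=
  riemann_von_mangoldt_holds.tendsto_zetaZeroCount_atTop

/-- `N(T) = #{n | γ_n ≤ T}` — discharge of the named fact `Literature.NumberTheory.LFunctions.zetaZeroCount_eq_ncard`
(`ZetaZeros.lean`). [cite: Titchmarsh1986, §9.1] -/
theorem zetaZeroCount_eq_ncard_holds : zetaZeroCount_eq_ncard :=
  riemann_von_mangoldt_holds.zetaZeroCount_eq_ncard

/-- The ordinates `γ_n` are non-decreasing — discharge of the named fact `Literature.NumberTheory.LFunctions.zetaOrdinate_mono`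
(`ZetaZeros.lean`). [cite: Titchmarsh1986, §9.1] -/
theorem zetaOrdinate_mono_holds : zetaOrdinate_mono :=
  riemann_von_mangoldt_holds.zetaOrdinate_mono

/-- `0 < γ_n` — discharge of the named fact `Literature.NumberTheory.LFunctions.zetaOrdinate_pos` (`ZetaZeros.lean`).
[cite: Titchmarsh1986, §9.1] -/
theorem zetaOrdinate_pos_holds : zetaOrdinate_pos :=
  riemann_von_mangoldt_holds.zetaOrdinate_pos

/-! ### The ordinates `γ_n` are attained -/

/-- If no zero of `ζ` in the box up to height `T'` has ordinate in `(T, T']` (`T ≤ T'`), the boxes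
at heights `T` and `T'` coincide. [folklore] -/
theorem zetaZeroBox_eq_of_forall_im_le {σ T T' : ℝ} (hTT' : T ≤ T')
    (h : ∀ ρ ∈ zetaZeroBox σ T', ρ.im ≤ T) : zetaZeroBox σ T' = zetaZeroBox σ T := by
  ext ρ
  constructor
  · intro hρ
    exact ⟨hρ.1, hρ.2.1, hρ.2.2.1, hρ.2.2.2.1, h ρ hρ⟩
  · rintro ⟨h0, h1, h2, h3, h4⟩
    exact ⟨h0, h1, h2, h3, h4.trans hTT'⟩

/-- If no zero of `ζ` has ordinate in `(T, T']` (`T ≤ T'`), then `N(T') = N(T)`. [folklore] -/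
theorem zetaZeroCount_eq_of_forall_im_le {T T' : ℝ} (hTT' : T ≤ T')
    (h : ∀ ρ ∈ zetaZeroBox 0 T', ρ.im ≤ T) : zetaZeroCount T' = zetaZeroCount T := by
  unfold zetaZeroCount zetaZeroCountRe
  rw [zetaZeroBox_eq_of_forall_im_le hTT' h]

/-- If no zero of `ζ` with `0 < Im ρ ≤ T` has ordinate exactly `T`, then `N` is locally constant
to the left of `T` as well: `N(T − ε) = N(T)` for some `ε > 0`. [folklore] -/
theorem exists_pos_zetaZeroCount_sub_eq {T : ℝ} (hT : ∀ ρ ∈ zetaZeroBox 0 T, ρ.im ≠ T) :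
    ∃ ε : ℝ, 0 < ε ∧ zetaZeroCount (T - ε) = zetaZeroCount T := by
  classical
  set F : Finset ℂ := (zetaZeroBox_finite 0 T).toFinset with hF
  set D : Finset ℝ := insert 1 (F.image fun ρ ↦ T - ρ.im) with hD
  have hDne : D.Nonempty := ⟨1, Finset.mem_insert_self _ _⟩
  have hDpos : ∀ d ∈ D, 0 < d := by
    intro d hd
    rcases Finset.mem_insert.1 hd with rfl | hd
    · exact one_pos
    · obtain ⟨ρ, hρ, rfl⟩ := Finset.mem_image.1 hd
      have hρ' : ρ ∈ zetaZeroBox 0 T := (Set.Finite.mem_toFinset _).1 hρ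
      have h4 := hρ'.2.2.2.2
      have h5 := hT ρ hρ'
      have : ρ.im < T := lt_of_le_of_ne h4 h5
      linarith
  set ε : ℝ := D.min' hDne with hε
  have hεpos : 0 < ε := hDpos _ (D.min'_mem hDne)
  have hεle : ∀ ρ ∈ F, ε ≤ T - ρ.im := fun ρ hρ ↦
    D.min'_le _ (Finset.mem_insert_of_mem (Finset.mem_image_of_mem _ hρ))
  refine ⟨ε, hεpos, (zetaZeroCount_eq_of_forall_im_le (by linarith) fun ρ hρ ↦ ?_).symm⟩
  have := hεle ρ ((Set.Finite.mem_toFinset _).2 hρ)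
  linarith

/-- **Each `γ_n` is the ordinate of a zero** — discharge of the named fact
`Literature.NumberTheory.LFunctions.exists_zero_of_zetaOrdinate` (`ZetaZeros.lean`): `N(γ_n) ≥ n + 1`
(`riemann_von_mangoldt.succ_le_zetaZeroCount`), and if no zero had ordinate exactly `γ_n` then `N`
would be locally constant to the left of `γ_n` (`exists_pos_zetaZeroCount_sub_eq`), contradicting
the minimality in `γ_n = inf {T | n + 1 ≤ N(T)}`; the zero found lies in the open strip
(`re_mem_Ioo_of_riemannZeta_eq_zero_of_im_ne_zero`). [cite: Titchmarsh1986, §9.1] -/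
theorem exists_zero_of_zetaOrdinate_holds : exists_zero_of_zetaOrdinate := by
  intro n
  have h := riemann_von_mangoldt_holds
  have key : ∃ ρ ∈ zetaZeroBox 0 (zetaOrdinate n), ρ.im = zetaOrdinate n := by
    by_contra hne
    have hne' : ∀ ρ ∈ zetaZeroBox 0 (zetaOrdinate n), ρ.im ≠ zetaOrdinate n :=
      fun ρ hρ him ↦ hne ⟨ρ, hρ, him⟩
    obtain ⟨ε, hε, hεeq⟩ := exists_pos_zetaZeroCount_sub_eq hne'
    have hmem : n + 1 ≤ zetaZeroCount (zetaOrdinate n - ε) := by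
      rw [hεeq]
      exact h.succ_le_zetaZeroCount n
    have := h.zetaOrdinate_le_iff.2 hmem
    linarith
  obtain ⟨ρ, ⟨h0, -, -, h3, -⟩, him⟩ := key
  obtain ⟨hre0, hre1⟩ := re_mem_Ioo_of_riemannZeta_eq_zero_of_im_ne_zero h0 h3.ne'
  refine ⟨ρ.re, hre0, hre1, ?_⟩
  have hρ : (ρ.re : ℂ) + zetaOrdinate n * I = ρ := by
    apply Complex.ext <;> simp [him]
  rw [hρ]
  exact h0

/-! ### `S(T)` as an integral over the whole horizontal ray: `π S(T) = −∫_{1/2}^{∞} Im ζ'/ζ(σ + iT) dσ` -/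

section ray

open LSeries
open scoped LSeries.notation ArithmeticFunction.vonMangoldt

/-- For `x ≥ 2` and `r ≥ 0`: `x^{-r} ≤ 2^{-r}`. [folklore] -/
lemma rpow_neg_le_two_rpow_neg {x r : ℝ} (hx : 2 ≤ x) (hr : 0 ≤ r) : x ^ (-r) ≤ (2 : ℝ) ^ (-r) := by
  rw [Real.rpow_neg (by linarith), Real.rpow_neg (by norm_num)]
  exact inv_anti₀ (by positivity) (Real.rpow_le_rpow (by norm_num) hx hr)

/-- **`‖ζ(s) − 1‖ ≤ 2^{2−σ} (π²/6 − 1)` for `σ = Re s ≥ 2`** (compare `Σ_{n≥2} n^{−s}` with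
`2^{2−σ} Σ_{n≥2} n^{−2}`). In particular `ζ(σ + it) → 1` as `σ → ∞`. [folklore] -/
theorem norm_riemannZeta_sub_one_le_of_two_le_re {s : ℂ} (hs : 2 ≤ s.re) :
    ‖riemannZeta s - 1‖ ≤ (2 : ℝ) ^ (2 - s.re) * (π ^ 2 / 6 - 1) := by
  have hs1 : 1 < s.re := by linarith
  have hsum : Summable fun n : ℕ ↦ 1 / ((n : ℂ) + 1) ^ s := by
    have := (Complex.summable_one_div_nat_cpow (p := s)).2 hs1
    rw [← summable_nat_add_iff 1] at this
    simpa using this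
  have hζ : riemannZeta s = ∑' n : ℕ, 1 / ((n : ℂ) + 1) ^ s :=
    zeta_eq_tsum_one_div_nat_add_one_cpow hs1
  have hsplit := hsum.tsum_eq_zero_add
  simp only [Nat.cast_zero, zero_add, one_cpow, div_one] at hsplit
  have hdiff : riemannZeta s - 1 = ∑' n : ℕ, 1 / ((n : ℂ) + 1 + 1) ^ s := by
    rw [hζ, hsplit]; push_cast; ring
  have hreal : HasSum (fun n : ℕ ↦ (1 : ℝ) / ((n : ℝ) + 2) ^ 2) (π ^ 2 / 6 - 1) := by
    have h2 := (hasSum_nat_add_iff' 2).2 hasSum_zeta_two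
    simp only [Finset.sum_range_succ, Finset.sum_range_zero, Nat.cast_zero, ne_eq,
      OfNat.ofNat_ne_zero, not_false_eq_true, zero_pow, div_zero, zero_add, Nat.cast_one,
      one_pow, div_one] at h2
    have hfun : (fun n : ℕ ↦ (1 : ℝ) / ((n : ℝ) + 2) ^ 2) = fun n : ℕ ↦ 1 / ((n + 2 : ℕ) : ℝ) ^ 2 := by
      funext n; norm_cast
    rw [hfun]; exact h2
  -- termwise bound
  have hnorm : ∀ n : ℕ, ‖1 / ((n : ℂ) + 1 + 1) ^ s‖ ≤ (2 : ℝ) ^ (2 - s.re) * (1 / ((n : ℝ) + 2) ^ 2) := by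
    intro n
    have h : ((n : ℂ) + 1 + 1) = ((n + 2 : ℕ) : ℂ) := by push_cast; ring
    rw [h, norm_div, norm_one, norm_natCast_cpow_of_pos (by omega)]
    have hn2 : (2 : ℝ) ≤ ((n + 2 : ℕ) : ℝ) := by push_cast; linarith [(Nat.cast_nonneg n : (0 : ℝ) ≤ n)]
    have hpos : (0 : ℝ) < ((n + 2 : ℕ) : ℝ) := by positivity
    have e1 : (1 : ℝ) / ((n + 2 : ℕ) : ℝ) ^ s.re =
        ((n + 2 : ℕ) : ℝ) ^ (-(s.re - 2)) * (1 / ((n + 2 : ℕ) : ℝ) ^ 2) := by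
      rw [Real.rpow_neg hpos.le, ← Real.rpow_natCast _ 2, one_div, one_div, ← mul_inv,
        ← Real.rpow_add hpos]
      norm_num
    rw [e1]
    have e2 : ((n + 2 : ℕ) : ℝ) ^ (-(s.re - 2)) ≤ (2 : ℝ) ^ (2 - s.re) := by
      have := rpow_neg_le_two_rpow_neg hn2 (by linarith : 0 ≤ s.re - 2)
      rwa [show -(s.re - 2) = 2 - s.re by ring] at this ⊢
    have e3 : (1 : ℝ) / ((n + 2 : ℕ) : ℝ) ^ 2 = 1 / ((n : ℝ) + 2) ^ 2 := by push_cast; ring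
    rw [e3]
    exact mul_le_mul_of_nonneg_right e2 (by positivity : (0 : ℝ) ≤ 1 / ((n : ℝ) + 2) ^ 2)
  rw [hdiff]
  have hsum2 : Summable fun n : ℕ ↦ (2 : ℝ) ^ (2 - s.re) * (1 / ((n : ℝ) + 2) ^ 2) :=
    hreal.summable.mul_left _
  refine (norm_tsum_le_tsum_norm (hsum2.of_nonneg_of_le (fun n ↦ norm_nonneg _) hnorm)).trans ?_
  refine (Summable.tsum_le_tsum hnorm (hsum2.of_nonneg_of_le (fun n ↦ norm_nonneg _) hnorm) hsum2).trans ?_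
  rw [tsum_mul_left, hreal.tsum_eq]

/-- **`‖ζ'/ζ(s)‖ ≤ 2^{2−σ} · Σ Λ(n)/n²` for `σ = Re s ≥ 2`** (`−ζ'/ζ = Σ Λ(n) n^{−s}`,
`n^{−σ} ≤ 2^{2−σ} n^{−2}` for `n ≥ 2`). [folklore] -/
theorem norm_logDeriv_riemannZeta_le_of_two_le_re {s : ℂ} (hs : 2 ≤ s.re) :
    ‖deriv riemannZeta s / riemannZeta s‖ ≤
      (2 : ℝ) ^ (2 - s.re) * ∑' n : ℕ, ‖term ↗Λ (2 : ℂ) n‖ := by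
  have hs1 : 1 < s.re := by linarith
  have hL := ArithmeticFunction.LSeries_vonMangoldt_eq_deriv_riemannZeta_div hs1
  have heq : deriv riemannZeta s / riemannZeta s = -L ↗Λ s := by rw [hL]; ring
  have hsum2 : Summable fun n ↦ ‖term ↗Λ (2 : ℂ) n‖ :=
    summable_norm_iff.mpr (ArithmeticFunction.LSeriesSummable_vonMangoldt (s := 2) (by norm_num))
  have hterm : ∀ n, ‖term ↗Λ s n‖ ≤ (2 : ℝ) ^ (2 - s.re) * ‖term ↗Λ (2 : ℂ) n‖ := by
    intro n
    rcases Nat.lt_or_ge n 2 with hn | hn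
    · interval_cases n <;> simp [ArithmeticFunction.vonMangoldt_apply_one]
    · have hn0 : n ≠ 0 := by omega
      rw [norm_term_eq, norm_term_eq, if_neg hn0, if_neg hn0]
      have hpos : (0 : ℝ) < n := by exact_mod_cast Nat.pos_of_ne_zero hn0
      have hΛ : 0 ≤ ‖(↗Λ n : ℂ)‖ := norm_nonneg _
      simp only [Complex.re_ofNat]
      rw [div_eq_mul_inv, div_eq_mul_inv, ← Real.rpow_neg hpos.le, ← Real.rpow_neg hpos.le]
      have e : (n : ℝ) ^ (-s.re) = (n : ℝ) ^ (-(s.re - 2)) * (n : ℝ) ^ (-(2 : ℝ)) := by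
        rw [← Real.rpow_add hpos]; ring_nf
      rw [e]
      have e2 : (n : ℝ) ^ (-(s.re - 2)) ≤ (2 : ℝ) ^ (2 - s.re) := by
        have := rpow_neg_le_two_rpow_neg (by exact_mod_cast hn : (2 : ℝ) ≤ n) (by linarith : 0 ≤ s.re - 2)
        rwa [show -(s.re - 2) = 2 - s.re by ring] at this ⊢
      calc ‖(↗Λ n : ℂ)‖ * ((n : ℝ) ^ (-(s.re - 2)) * (n : ℝ) ^ (-(2 : ℝ)))
          = (n : ℝ) ^ (-(s.re - 2)) * (‖(↗Λ n : ℂ)‖ * (n : ℝ) ^ (-(2 : ℝ))) := by ring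
        _ ≤ (2 : ℝ) ^ (2 - s.re) * (‖(↗Λ n : ℂ)‖ * (n : ℝ) ^ (-(2 : ℝ))) :=
          mul_le_mul_of_nonneg_right e2 (by positivity)
  have hsum : Summable fun n ↦ ‖term ↗Λ s n‖ :=
    (hsum2.mul_left _).of_nonneg_of_le (fun n ↦ norm_nonneg _) hterm
  rw [heq, norm_neg]
  calc ‖L ↗Λ s‖ = ‖∑' n, term ↗Λ s n‖ := rfl
    _ ≤ ∑' n, ‖term ↗Λ s n‖ := norm_tsum_le_tsum_norm hsum
    _ ≤ ∑' n, (2 : ℝ) ^ (2 - s.re) * ‖term ↗Λ (2 : ℂ) n‖ := hsum.tsum_le_tsum hterm (hsum2.mul_left _)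
    _ = _ := tsum_mul_left

/-- `x ↦ ζ'/ζ(x + it)` is integrable on `(2, ∞)` (dominated by `C · 2^{2−x}`). [folklore] -/
theorem integrableOn_logDeriv_riemannZeta_Ioi_two (t : ℝ) :
    IntegrableOn (fun x : ℝ ↦ deriv riemannZeta (x + t * I) / riemannZeta (x + t * I)) (Ioi 2) := by
  set C : ℝ := ∑' n : ℕ, ‖term ↗Λ (2 : ℂ) n‖ with hC
  have hdom : IntegrableOn (fun x : ℝ ↦ C * (4 * Real.exp (-Real.log 2 * x))) (Ioi 2) :=
    ((exp_neg_integrableOn_Ioi 2 (Real.log_pos (by norm_num))).const_mul 4).const_mul C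
  have hcont : ContinuousOn (fun x : ℝ ↦ deriv riemannZeta (x + t * I) / riemannZeta (x + t * I))
      (Ioi 2) := by
    intro x hx
    have hne1 : (x : ℂ) + t * I ≠ 1 := fun h ↦ by
      have := congrArg Complex.re h; simp at this; simp only [mem_Ioi] at hx; linarith
    have hζ : riemannZeta (x + t * I) ≠ 0 :=
      fun h ↦ (Literature.NumberTheory.LFunctions.Nicolas.riemannZeta_re_pos_of_two_le (w := x + t * I) (by simp; exact le_of_lt hx)).ne'
        (by rw [h]; simp)
    have hc : Continuous fun x : ℝ ↦ (x : ℂ) + t * I := by fun_prop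
    exact ((continuousAt_logDeriv_riemannZeta hne1 hζ).comp (f := fun x : ℝ ↦ (x : ℂ) + t * I)
      hc.continuousAt).continuousWithinAt
  refine hdom.mono' (hcont.aestronglyMeasurable measurableSet_Ioi) ?_
  refine (ae_restrict_iff' measurableSet_Ioi).2 (Eventually.of_forall fun x hx ↦ ?_)
  have h := norm_logDeriv_riemannZeta_le_of_two_le_re (s := x + t * I) (by simp; exact le_of_lt hx)
  simp only [add_re, ofReal_re, mul_re, ofReal_im, I_re, mul_zero, I_im, mul_one, sub_self,
    add_zero] at h
  refine h.trans (le_of_eq ?_)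
  rw [Real.rpow_def_of_pos (by norm_num), hC]
  have : Real.log 2 * (2 - x) = 2 * Real.log 2 + -Real.log 2 * x := by ring
  rw [this, Real.exp_add, show (2 : ℝ) * Real.log 2 = Real.log 4 by
    rw [show (4 : ℝ) = 2 ^ 2 by norm_num, Real.log_pow]; norm_num, Real.exp_log (by norm_num)]
  ring

/-- **`arg ζ(2 + it) = −Im ∫₂^∞ ζ'/ζ(x + it) dx`**: the principal `log ζ(x+it)` is a primitive of
`ζ'/ζ` along the ray `x ≥ 2` (where `Re ζ > 0`) and tends to `log 1 = 0`
(`MeasureTheory.integral_Ioi_of_hasDerivAt_of_tendsto`). [folklore] -/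
theorem integral_Ioi_logDeriv_riemannZeta (t : ℝ) :
    ∫ x in Ioi (2 : ℝ), deriv riemannZeta (x + t * I) / riemannZeta (x + t * I) =
      -Complex.log (riemannZeta (2 + t * I)) := by
  have hslit : ∀ x : ℝ, 2 ≤ x → riemannZeta (x + t * I) ∈ slitPlane := fun x hx ↦
    Or.inl (Literature.NumberTheory.LFunctions.Nicolas.riemannZeta_re_pos_of_two_le (by simpa using hx))
  have han : ∀ x : ℝ, 2 ≤ x → AnalyticAt ℂ riemannZeta (x + t * I) := fun x hx ↦
    analyticOn_riemannZeta _ (fun h ↦ by have := congrArg Complex.re h; simp at this; linarith)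
  have hderiv : ∀ x ∈ Ioi (2 : ℝ), HasDerivAt (fun x : ℝ ↦ Complex.log (riemannZeta (x + t * I)))
      (deriv riemannZeta (x + t * I) / riemannZeta (x + t * I)) x := fun x hx ↦
    Literature.Analysis.Complex.hasDerivAt_log_comp_horizontal (han x (le_of_lt hx)) (hslit x (le_of_lt hx))
  have hcont : ContinuousWithinAt (fun x : ℝ ↦ Complex.log (riemannZeta (x + t * I))) (Ici 2) 2 :=
    (Literature.Analysis.Complex.hasDerivAt_log_comp_horizontal (han 2 le_rfl) (hslit 2 le_rfl)).continuousAt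
      |>.continuousWithinAt
  -- `log ζ(x + it) → 0`
  have hlim : Tendsto (fun x : ℝ ↦ Complex.log (riemannZeta (x + t * I))) atTop (𝓝 0) := by
    have hpow : Tendsto (fun x : ℝ ↦ (2 : ℝ) ^ (2 - x)) atTop (𝓝 0) := by
      have h1 : Tendsto (fun x : ℝ ↦ Real.log 2 * (2 + -x)) atTop atBot :=
        (tendsto_atBot_add_const_left _ 2 tendsto_neg_atTop_atBot).const_mul_atBot
          (Real.log_pos (by norm_num))
      refine (Real.tendsto_exp_atBot.comp h1).congr fun x ↦ ?_
      rw [Function.comp_apply, Real.rpow_def_of_pos (by norm_num)]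
      ring_nf
    have hζ : Tendsto (fun x : ℝ ↦ riemannZeta (x + t * I)) atTop (𝓝 1) := by
      refine tendsto_iff_norm_sub_tendsto_zero.2 ?_
      have hb : Tendsto (fun x : ℝ ↦ (2 : ℝ) ^ (2 - x) * (π ^ 2 / 6 - 1)) atTop (𝓝 0) := by
        simpa using hpow.mul_const (π ^ 2 / 6 - 1)
      refine squeeze_zero_norm' ?_ hb
      filter_upwards [eventually_ge_atTop (2 : ℝ)] with x hx
      rw [norm_norm]
      have := norm_riemannZeta_sub_one_le_of_two_le_re (s := x + t * I) (by simpa using hx)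
      simpa using this
    have := ((continuousAt_clog (by simp : (1 : ℂ) ∈ slitPlane)).tendsto.comp hζ)
    rw [Complex.log_one] at this
    exact this
  have h := MeasureTheory.integral_Ioi_of_hasDerivAt_of_tendsto hcont hderiv
    (integrableOn_logDeriv_riemannZeta_Ioi_two t) hlim
  simpa using h

/-- **`σ ↦ ζ'/ζ(σ + iT)` is integrable on `(½, ∞)`** for `T > 0` not the ordinate of a zero
(continuous on `[½, 2]`, exponentially small beyond): the integrability needed to integrate
Backlund's formula in `t` (Turing's method). [folklore] -/
theorem integrableOn_logDeriv_riemannZeta_Ioi_half {T : ℝ} (hT : 0 < T)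
    (hT' : ∀ ρ : ℂ, riemannZeta ρ = 0 → ρ.im ≠ T) :
    IntegrableOn (fun x : ℝ ↦ deriv riemannZeta (x + T * I) / riemannZeta (x + T * I)) (Ioi (1 / 2 : ℝ)) := by
  have hcontF : ContinuousOn (fun x : ℝ ↦ deriv riemannZeta (x + T * I) / riemannZeta (x + T * I))
      (Icc (1 / 2) 2) := by
    intro x _
    have hne1 : (x : ℂ) + T * I ≠ 1 := fun h ↦ by
      have := congrArg Complex.im h; simp at this; exact hT.ne' this
    have hζ : riemannZeta (x + T * I) ≠ 0 := fun h0 ↦ hT' _ h0 (by simp)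
    have hc : Continuous fun x : ℝ ↦ (x : ℂ) + T * I := by fun_prop
    exact ((continuousAt_logDeriv_riemannZeta hne1 hζ).comp (f := fun x : ℝ ↦ (x : ℂ) + T * I)
      hc.continuousAt).continuousWithinAt
  have hF1 : IntegrableOn (fun x : ℝ ↦ deriv riemannZeta (x + T * I) / riemannZeta (x + T * I))
      (Ioc (1 / 2) 2) := (hcontF.integrableOn_compact isCompact_Icc).mono_set Ioc_subset_Icc_self
  rw [← Ioc_union_Ioi_eq_Ioi (show (1 / 2 : ℝ) ≤ 2 by norm_num)]
  exact hF1.union (integrableOn_logDeriv_riemannZeta_Ioi_two T)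

/-- **`π S(T) = −∫_{1/2}^{∞} Im (ζ'/ζ)(σ + iT) dσ`** for `T > 0` not an ordinate (Titchmarsh §9.3:
`S(T) = (1/π) arg ζ(½ + iT)` by continuous variation along the horizontal ray from `+∞ + iT`, where
`arg ζ = 0`): Backlund's formula `pi_mul_zetaArgS_eq` with the vertical term `arg ζ(2 + iT)`
rewritten as `−Im ∫₂^∞ ζ'/ζ` (`integral_Ioi_logDeriv_riemannZeta`). This is the form integrated in
`t` in Turing's method (Lehman 1970, Lemma 1; Edwards §8.2). [cite: Titchmarsh1986, Thm. 9.3] -/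
theorem pi_mul_zetaArgS_eq_neg_integral_Ioi {T : ℝ} (hT : 0 < T)
    (hT' : ∀ ρ : ℂ, riemannZeta ρ = 0 → ρ.im ≠ T) :
    π * zetaArgS T =
      -∫ x in Ioi (1 / 2 : ℝ), (deriv riemannZeta (x + T * I) / riemannZeta (x + T * I)).im := by
  set F : ℝ → ℂ := fun x ↦ deriv riemannZeta (x + T * I) / riemannZeta (x + T * I) with hF
  have h := pi_mul_zetaArgS_eq hT hT'
  -- the vertical term is `arg ζ(2 + iT)`
  have hvert : (I * ∫ y in (0 : ℝ)..T, deriv riemannZeta (2 + y * I) / riemannZeta (2 + y * I)).im =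
      arg (riemannZeta (2 + T * I)) := by
    have hne1 : ∀ y : ℝ, ((2 : ℝ) : ℂ) + y * I ≠ 1 := fun y h ↦ by
      have := congrArg Complex.re h; norm_num at this
    have han : ∀ y ∈ Icc 0 T, AnalyticAt ℂ riemannZeta ((2 : ℝ) + y * I) := fun y _ ↦
      analyticOn_riemannZeta _ (hne1 y)
    have hslit : ∀ y ∈ Icc 0 T, riemannZeta ((2 : ℝ) + y * I) ∈ slitPlane := fun y _ ↦
      Or.inl (by simpa using re_riemannZeta_two_add_pos y)
    have h2 := Literature.Analysis.Complex.integral_logDeriv_vertical (g := riemannZeta) 2 hT.le han hslit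
    simp only [ofReal_ofNat] at h2
    rw [h2, sub_im, log_im, log_im]
    simp only [ofReal_zero, zero_mul, add_zero]
    have h0 : arg (riemannZeta 2) = 0 := by
      have e : riemannZeta 2 = ((π ^ 2 / 6 : ℝ) : ℂ) := by
        rw [riemannZeta_two]; push_cast; ring
      rw [e, arg_ofReal_of_nonneg (by positivity)]
    rw [h0, sub_zero]
  -- `arg ζ(2+iT) = −Im ∫₂^∞ ζ'/ζ`
  have harg : arg (riemannZeta (2 + T * I)) = -(∫ x in Ioi (2 : ℝ), F x).im := by
    simp only [hF]
    rw [integral_Ioi_logDeriv_riemannZeta, neg_im, log_im, neg_neg]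
  -- integrability on `(1/2, 2]` and on `(2, ∞)`
  have hunion : IntegrableOn F (Ioi (1 / 2)) := integrableOn_logDeriv_riemannZeta_Ioi_half hT hT'
  have hF1 : IntegrableOn F (Ioc (1 / 2) 2) := hunion.mono_set Ioc_subset_Ioi_self
  have hF2 : IntegrableOn F (Ioi 2) := integrableOn_logDeriv_riemannZeta_Ioi_two T
  have hsplit : ∫ x in Ioi (1 / 2 : ℝ), F x = (∫ x in (1 / 2 : ℝ)..2, F x) + ∫ x in Ioi (2 : ℝ), F x := by
    rw [intervalIntegral.integral_of_le (by norm_num),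
      ← setIntegral_union (Ioc_disjoint_Ioi le_rfl) measurableSet_Ioi hF1 hF2,
      Ioc_union_Ioi_eq_Ioi (by norm_num)]
  have him : ∫ x in Ioi (1 / 2 : ℝ), (F x).im = (∫ x in Ioi (1 / 2 : ℝ), F x).im :=
    integral_im hunion
  rw [him, hsplit, add_im, h, hvert, harg]
  ring

end ray

/-! ### Turing's lemma: `π ∫_{t₁}^{t₂} S(t) dt = ∫_{1/2}^∞ log|ζ(σ+it₂)| dσ − ∫_{1/2}^∞ log|ζ(σ+it₁)| dσ` -/

section turing_lemma

/-- **`d/dt log ‖g(x + it)‖ = −Im (g'/g)(x + it)`** for `g` analytic and non-zero at `x + it`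
(no branch of the logarithm is involved: `log ‖g‖ = ½ log(Re² g + Im² g)`). [folklore] -/
theorem hasDerivAt_log_norm_comp_vertical {g : ℂ → ℂ} {x t : ℝ} (hg : AnalyticAt ℂ g (x + t * I))
    (h0 : g (x + t * I) ≠ 0) :
    HasDerivAt (fun t : ℝ ↦ Real.log ‖g (x + t * I)‖)
      (-(deriv g (x + t * I) / g (x + t * I)).im) t := by
  -- the complex derivative along the vertical line
  have h1 : HasDerivAt (fun w : ℂ ↦ (x : ℂ) + w * I) (1 * I) (t : ℂ) :=
    ((hasDerivAt_id (t : ℂ)).mul_const I).const_add _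
  have h2 : HasDerivAt (fun w : ℂ ↦ g (x + w * I)) (deriv g (x + t * I) * (1 * I)) (t : ℂ) :=
    hg.differentiableAt.hasDerivAt.comp (t : ℂ) h1
  have hG : HasDerivAt (fun t : ℝ ↦ g (x + t * I)) (deriv g (x + t * I) * I) t := by
    simpa using h2.comp_ofReal
  set G : ℝ → ℂ := fun t ↦ g (x + t * I) with hGdef
  set w : ℂ := deriv g (x + t * I) * I with hw
  have hre : HasDerivAt (fun t ↦ (G t).re) w.re t := reCLM.hasFDerivAt.comp_hasDerivAt t hG
  have him : HasDerivAt (fun t ↦ (G t).im) w.im t := imCLM.hasFDerivAt.comp_hasDerivAt t hG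
  -- `normSq ∘ G`
  have hnsq : HasDerivAt (fun t ↦ Complex.normSq (G t)) (2 * ((G t).re * w.re + (G t).im * w.im)) t := by
    have this : HasDerivAt (fun t ↦ (G t).re ^ 2 + (G t).im ^ 2)
        (((2 : ℕ) : ℝ) * (G t).re ^ (2 - 1) * w.re + ((2 : ℕ) : ℝ) * (G t).im ^ (2 - 1) * w.im) t :=
      (hre.pow 2).add (him.pow 2)
    have e : (fun t ↦ (G t).re ^ 2 + (G t).im ^ 2) = fun t ↦ Complex.normSq (G t) := by
      funext u; rw [Complex.normSq_apply]; ring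
    rw [e] at this
    refine this.congr_deriv ?_
    push_cast
    ring
  have hpos : 0 < Complex.normSq (G t) := Complex.normSq_pos.2 h0
  have hlog := (hnsq.log hpos.ne').const_mul (1 / 2)
  have e2 : (fun t ↦ 1 / 2 * Real.log (Complex.normSq (G t))) = fun t ↦ Real.log ‖G t‖ := by
    funext u
    rw [← Complex.sq_norm, Real.log_pow]
    ring
  rw [e2] at hlog
  refine hlog.congr_deriv ?_
  -- the value: `Re (w / G) = Re (i g'/g) = −Im (g'/g)`
  have hn0 : Complex.normSq (G t) ≠ 0 := hpos.ne'
  have e3 : -(deriv g (x + t * I) / g (x + t * I)).im = (w / G t).re := by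
    rw [hw, show deriv g (x + t * I) * I / G t = I * (deriv g (x + t * I) / g (x + t * I)) by
      simp only [hGdef]; ring, I_mul_re]
  rw [e3, div_re]
  field_simp

/-- **Vertical FTC for `log ‖g‖`**: if `g` is analytic and non-zero at every point of the segment
`{x} × [t₁, t₂]`, then `∫_{t₁}^{t₂} Im (g'/g)(x + it) dt = −(log ‖g(x+it₂)‖ − log ‖g(x+it₁)‖)`.
[folklore] -/
theorem integral_im_logDeriv_vertical {g : ℂ → ℂ} {x t₁ t₂ : ℝ} (h12 : t₁ ≤ t₂)
    (hg : ∀ t ∈ Icc t₁ t₂, AnalyticAt ℂ g (x + t * I)) (h0 : ∀ t ∈ Icc t₁ t₂, g (x + t * I) ≠ 0) :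
    ∫ t in t₁..t₂, (deriv g (x + t * I) / g (x + t * I)).im =
      -(Real.log ‖g (x + t₂ * I)‖ - Real.log ‖g (x + t₁ * I)‖) := by
  have hderiv : ∀ t ∈ Icc t₁ t₂, HasDerivAt (fun t : ℝ ↦ Real.log ‖g (x + t * I)‖)
      (-(deriv g (x + t * I) / g (x + t * I)).im) t := fun t ht ↦
    hasDerivAt_log_norm_comp_vertical (hg t ht) (h0 t ht)
  have hcont : ContinuousOn (fun t : ℝ ↦ (deriv g (x + t * I) / g (x + t * I)).im) (Icc t₁ t₂) := by
    intro t ht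
    have hc : Continuous fun t : ℝ ↦ (x : ℂ) + t * I := by fun_prop
    have h1 : ContinuousAt (fun t : ℝ ↦ deriv g (x + t * I) / g (x + t * I)) t :=
      ((hg t ht).deriv.continuousAt.comp (f := fun t : ℝ ↦ (x : ℂ) + t * I) hc.continuousAt).div
        ((hg t ht).continuousAt.comp (f := fun t : ℝ ↦ (x : ℂ) + t * I) hc.continuousAt) (h0 t ht)
    exact (continuous_im.continuousAt.comp h1).continuousWithinAt
  have h := intervalIntegral.integral_eq_sub_of_hasDerivAt (fun t ht ↦ hderiv t (by rwa [uIcc_of_le h12] at ht))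
    ((hcont.neg.mono (by rw [uIcc_of_le h12])).intervalIntegrable)
  rw [intervalIntegral.integral_neg] at h
  linarith

/-- **The two-dimensional singularity `1/|s − ρ|` is integrable**: for every `ρ` and every bounded
measurable `S ⊆ ℝ × ℝ`, `p = (t, x) ↦ 1/‖(x + it) − ρ‖` is integrable on `S` (Mathlib's
`integrableOn_ball_of_norm_le_rpow` in dimension `2`, translated to `ρ`; `|s − ρ| ≥ ‖p − p_ρ‖_∞`).
[folklore] -/
theorem integrableOn_inv_norm_vertical_sub (ρ : ℂ) {S : Set (ℝ × ℝ)} (hS : Bornology.IsBounded S) :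
    IntegrableOn (fun p : ℝ × ℝ ↦ ‖((p.2 : ℂ) + p.1 * I - ρ)‖⁻¹) S := by
  set p₀ : ℝ × ℝ := (ρ.im, ρ.re) with hp₀
  obtain ⟨r, hr⟩ := hS.subset_ball p₀
  suffices h : IntegrableOn (fun p : ℝ × ℝ ↦ ‖((p.2 : ℂ) + p.1 * I - ρ)‖⁻¹) (Metric.ball p₀ r) from
    h.mono_set hr
  set h : ℝ × ℝ → ℝ := fun q ↦ ‖((q.2 : ℂ) + q.1 * I)‖⁻¹ with hh
  have hdim : Module.finrank ℝ (ℝ × ℝ) = 2 := by simp [Module.finrank_prod]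
  have hmeas : AEStronglyMeasurable h volume := by
    refine (Measurable.inv ?_).aestronglyMeasurable
    exact (continuous_norm.comp (by fun_prop : Continuous fun q : ℝ × ℝ ↦ (q.2 : ℂ) + q.1 * I)).measurable
  have hball : IntegrableOn h (Metric.ball 0 r) := by
    refine integrableOn_ball_of_norm_le_rpow (by rw [hdim]; norm_num) (C := 1) (α := 1)
      (by rw [hdim]; norm_num) (Eventually.of_forall fun q ↦ ?_) hmeas
    rw [Real.norm_eq_abs, abs_of_nonneg (by positivity), Real.rpow_neg_one, one_mul, hh]
    simp only
    rcases eq_or_ne q 0 with hq | hq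
    · simp [hq]
    · have hqn : 0 < ‖q‖ := norm_pos_iff.2 hq
      refine inv_anti₀ hqn ?_
      rw [Prod.norm_def, max_le_iff, Real.norm_eq_abs, Real.norm_eq_abs]
      constructor
      · have := abs_im_le_norm ((q.2 : ℂ) + q.1 * I); simpa using this
      · have := abs_re_le_norm ((q.2 : ℂ) + q.1 * I); simpa using this
  have he : MeasurePreserving (fun p : ℝ × ℝ ↦ p - p₀) volume volume :=
    measurePreserving_sub_right volume p₀
  have hemb : MeasurableEmbedding (fun p : ℝ × ℝ ↦ p - p₀) := by
    have := (Homeomorph.addRight (-p₀)).measurableEmbedding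
    convert this using 1
    funext p
    simp [sub_eq_add_neg]
  have h2 := (he.integrableOn_comp_preimage hemb (f := h) (s := Metric.ball 0 r)).2 hball
  convert h2 using 1
  · funext p
    simp only [Function.comp_apply, hh, hp₀, Prod.snd_sub, Prod.fst_sub]
    congr 1
    push_cast
    apply congrArg
    apply Complex.ext <;> simp
  · ext p
    simp [dist_eq_norm]

/-- Points `x + it` with `x ∈ [½, 2]`, `|t − t₀| ≤ ½` lie in the disc `|s − (2 + it₀)| ≤ 7/4`. [folklore] -/
lemma mem_closedBall_seven_quarters {x t t₀ : ℝ} (hx : x ∈ Icc (1 / 2 : ℝ) 2) (ht : |t - t₀| ≤ 1 / 2) :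
    (x : ℂ) + t * I ∈ closedBall (2 + (t₀ : ℂ) * I) (7 / 4) := by
  rw [mem_closedBall, dist_eq_norm]
  have e : (x : ℂ) + t * I - (2 + t₀ * I) = ((x - 2 : ℝ) : ℂ) + ((t - t₀ : ℝ) : ℂ) * I := by
    push_cast; ring
  rw [e]
  have h1 : ‖((x - 2 : ℝ) : ℂ) + ((t - t₀ : ℝ) : ℂ) * I‖ ^ 2 = (x - 2) ^ 2 + (t - t₀) ^ 2 := by
    rw [Complex.sq_norm, Complex.normSq_apply]; simp; ring
  have h2 : (x - 2) ^ 2 + (t - t₀) ^ 2 ≤ (7 / 4 : ℝ) ^ 2 := by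
    have := abs_le.1 ht
    nlinarith [hx.1, hx.2]
  nlinarith [norm_nonneg (((x - 2 : ℝ) : ℂ) + ((t - t₀ : ℝ) : ℂ) * I)]

/-- **Joint integrability of `Im ζ'/ζ(x + it)` near the critical strip** on
`[t₁, t₂] × (½, 2]` (`0 < t₁ ≤ t₂ ≤ t₁ + 1`): by the local partial fraction
`ζ'/ζ(s) = −1/(s−1) + Σ_{disc} m(ρ)/(s−ρ) + O(log t)` (`Literature.NumberTheory.LFunctions.exists_norm_logDeriv_riemannZeta₁_sub_sum_le`,
Montgomery–Vaughan Lemma 12.1) the integrand is dominated, off the finitely many zeros, by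
`C log(t₀+4) + 1/t₁ + Σ m(ρ)/|s − ρ|`, and `1/|s − ρ|` is integrable in two dimensions
(`integrableOn_inv_norm_vertical_sub`). [folklore] -/
theorem integrableOn_im_logDeriv_riemannZeta_near {t₁ t₂ : ℝ} (h0 : 0 < t₁) (hlen : t₂ ≤ t₁ + 1) :
    IntegrableOn (fun p : ℝ × ℝ ↦
      (deriv riemannZeta (p.2 + p.1 * I) / riemannZeta (p.2 + p.1 * I)).im) (Icc t₁ t₂ ×ˢ Ioc (1 / 2 : ℝ) 2) := by
  set R : Set (ℝ × ℝ) := Icc t₁ t₂ ×ˢ Ioc (1 / 2 : ℝ) 2 with hR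
  set t₀ : ℝ := (t₁ + t₂) / 2 with ht₀
  set sp : ℝ × ℝ → ℂ := fun p ↦ (p.2 : ℂ) + p.1 * I with hsp
  have hRm : MeasurableSet R := measurableSet_Icc.prod measurableSet_Ioc
  have hRb : Bornology.IsBounded R := (Metric.isBounded_Icc _ _).prod (Metric.isBounded_Ioc _ _)
  have hball : ∀ p ∈ R, sp p ∈ closedBall (2 + (t₀ : ℂ) * I) (7 / 4) := by
    rintro ⟨t, x⟩ ⟨ht, hx⟩
    refine mem_closedBall_seven_quarters ⟨hx.1.le, hx.2⟩ ?_
    rw [abs_le]; constructor <;> [skip; skip] <;> simp only [ht₀] <;> linarith [ht.1, ht.2]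
  have hne1 : ∀ p ∈ R, sp p ≠ 1 := by
    rintro ⟨t, x⟩ ⟨ht, hx⟩ h
    have := congrArg Complex.im h
    simp [hsp] at this
    linarith [ht.1]
  have him_ge : ∀ p ∈ R, t₁ ≤ ‖sp p - 1‖ := by
    rintro ⟨t, x⟩ ⟨ht, hx⟩
    have := abs_im_le_norm (sp (t, x) - 1)
    simp [hsp] at this
    rw [abs_of_pos (by linarith [ht.1])] at this
    linarith [ht.1]
  obtain ⟨C, hC0, hC⟩ := Literature.NumberTheory.LFunctions.exists_norm_logDeriv_riemannZeta₁_sub_sum_le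
  set Z : Finset ℂ := Literature.NumberTheory.LFunctions.zetaDiscZeros t₀ with hZ
  set d : ℂ → ℤ := fun ρ ↦ Literature.NumberTheory.LFunctions.zetaDiscDivisor t₀ ρ with hd
  -- the dominating function
  set G : ℝ × ℝ → ℝ := fun p ↦ C * Real.log (|t₀| + 4) + 1 / t₁ +
    ∑ ρ ∈ Z, (d ρ : ℝ) * ‖sp p - ρ‖⁻¹ with hG
  have hGint : IntegrableOn G R := by
    have hfin : volume R < ⊤ := hRb.measure_lt_top
    refine ((integrableOn_const (C := C * Real.log (|t₀| + 4) + 1 / t₁) hfin.ne).add ?_)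
    refine integrable_finsetSum _ fun ρ _ ↦ ?_
    exact (integrableOn_inv_norm_vertical_sub ρ hRb).const_mul _
  -- the exceptional (finite) set of zeros
  set E : Set (ℝ × ℝ) := (fun ρ : ℂ ↦ (ρ.im, ρ.re)) '' (Z : Set ℂ) with hE
  have hEfin : E.Finite := (Z.finite_toSet).image _
  have hE0 : volume E = 0 := hEfin.measure_zero _
  have hzero_mem : ∀ p ∈ R, riemannZeta (sp p) = 0 → p ∈ E := by
    rintro p hp h0'
    have hmem : sp p ∈ Z := by
      rw [hZ, Literature.NumberTheory.LFunctions.mem_zetaDiscZeros]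
      exact ⟨closedBall_subset_closedBall (by norm_num) (hball p hp),
        (Literature.NumberTheory.LFunctions.riemannZeta₁_eq_zero_iff (hne1 p hp)).2 h0'⟩
    refine ⟨sp p, hmem, ?_⟩
    simp [hsp]
  -- the pointwise bound off the zeros
  have hbound : ∀ p ∈ R, riemannZeta (sp p) ≠ 0 →
      ‖(deriv riemannZeta (sp p) / riemannZeta (sp p)).im‖ ≤ G p := by
    intro p hp hζ
    have hζ₁ : riemannZeta₁ (sp p) ≠ 0 := fun h ↦ hζ ((Literature.NumberTheory.LFunctions.riemannZeta₁_eq_zero_iff (hne1 p hp)).1 h)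
    have h1 := hC t₀ (sp p) (hball p hp) hζ₁
    have h2 : deriv riemannZeta (sp p) / riemannZeta (sp p) =
        logDeriv riemannZeta₁ (sp p) - (sp p - 1)⁻¹ := by
      rw [← logDeriv_apply, Literature.NumberTheory.LFunctions.logDeriv_riemannZeta_eq (hne1 p hp) hζ]
    rw [Real.norm_eq_abs, h2]
    refine (abs_im_le_norm _).trans ?_
    have h3 : ‖(sp p - 1)⁻¹‖ ≤ 1 / t₁ := by
      rw [norm_inv, one_div]
      exact inv_anti₀ h0 (him_ge p hp)
    have h4 : ‖∑ ρ ∈ Z, (Literature.NumberTheory.LFunctions.zetaDiscDivisor t₀ ρ : ℂ) / (sp p - ρ)‖ ≤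
        ∑ ρ ∈ Z, (d ρ : ℝ) * ‖sp p - ρ‖⁻¹ := by
      refine (norm_sum_le _ _).trans (Finset.sum_le_sum fun ρ _ ↦ ?_)
      rw [norm_div, div_eq_mul_inv]
      gcongr
      have : (0 : ℤ) ≤ Literature.NumberTheory.LFunctions.zetaDiscDivisor t₀ ρ := Literature.NumberTheory.LFunctions.zetaDiscDivisor_nonneg t₀ ρ
      rw [Complex.norm_intCast, abs_of_nonneg (by exact_mod_cast this)]
    calc ‖logDeriv riemannZeta₁ (sp p) - (sp p - 1)⁻¹‖
        ≤ ‖logDeriv riemannZeta₁ (sp p) - ∑ ρ ∈ Z, (Literature.NumberTheory.LFunctions.zetaDiscDivisor t₀ ρ : ℂ) / (sp p - ρ)‖ +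
          ‖∑ ρ ∈ Z, (Literature.NumberTheory.LFunctions.zetaDiscDivisor t₀ ρ : ℂ) / (sp p - ρ)‖ + ‖(sp p - 1)⁻¹‖ := by
          have := norm_sub_le (logDeriv riemannZeta₁ (sp p) -
            ∑ ρ ∈ Z, (Literature.NumberTheory.LFunctions.zetaDiscDivisor t₀ ρ : ℂ) / (sp p - ρ) +
            ∑ ρ ∈ Z, (Literature.NumberTheory.LFunctions.zetaDiscDivisor t₀ ρ : ℂ) / (sp p - ρ)) ((sp p - 1)⁻¹)
          have := norm_add_le (logDeriv riemannZeta₁ (sp p) -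
            ∑ ρ ∈ Z, (Literature.NumberTheory.LFunctions.zetaDiscDivisor t₀ ρ : ℂ) / (sp p - ρ))
            (∑ ρ ∈ Z, (Literature.NumberTheory.LFunctions.zetaDiscDivisor t₀ ρ : ℂ) / (sp p - ρ))
          rw [sub_add_cancel] at *
          linarith
      _ ≤ C * Real.log (|t₀| + 4) + ∑ ρ ∈ Z, (d ρ : ℝ) * ‖sp p - ρ‖⁻¹ + 1 / t₁ := by
          gcongr
      _ = G p := by rw [hG]; ring
  -- measurability: continuity off the (null) exceptional set
  have hcont : ContinuousOn (fun p : ℝ × ℝ ↦ (deriv riemannZeta (sp p) / riemannZeta (sp p)).im)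
      (R \ E) := by
    intro p hp
    have hpR := hp.1
    have hζ : riemannZeta (sp p) ≠ 0 := fun h ↦ hp.2 (hzero_mem p hpR h)
    have hc : Continuous sp := by simp only [hsp]; fun_prop
    have h1 := (continuousAt_logDeriv_riemannZeta (hne1 p hpR) hζ).comp (f := sp) hc.continuousAt
    exact (continuous_im.continuousAt.comp h1).continuousWithinAt
  have hae : R \ E =ᵐ[volume] R := sdiff_null_ae_eq_self hE0
  have hmeas : AEStronglyMeasurable
      (fun p : ℝ × ℝ ↦ (deriv riemannZeta (sp p) / riemannZeta (sp p)).im) (volume.restrict R) := by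
    rw [← Measure.restrict_congr_set hae]
    exact hcont.aestronglyMeasurable (hRm.diff hEfin.measurableSet)
  refine hGint.mono' hmeas ?_
  rw [ae_restrict_iff' hRm]
  have hnotE : ∀ᵐ p : ℝ × ℝ ∂volume, p ∉ E := compl_mem_ae_iff.2 hE0
  filter_upwards [hnotE] with p hpE hpR
  exact hbound p hpR fun h ↦ hpE (hzero_mem p hpR h)

/-- **Joint integrability of `Im ζ'/ζ(x + it)` on `[t₁, t₂] × (2, ∞)`** (dominated by
`C · 2^{2−x}`, `norm_logDeriv_riemannZeta_le_of_two_le_re`). [folklore] -/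
theorem integrableOn_im_logDeriv_riemannZeta_far (t₁ t₂ : ℝ) :
    IntegrableOn (fun p : ℝ × ℝ ↦
      (deriv riemannZeta (p.2 + p.1 * I) / riemannZeta (p.2 + p.1 * I)).im) (Icc t₁ t₂ ×ˢ Ioi (2 : ℝ)) := by
  set R : Set (ℝ × ℝ) := Icc t₁ t₂ ×ˢ Ioi (2 : ℝ) with hR
  set sp : ℝ × ℝ → ℂ := fun p ↦ (p.2 : ℂ) + p.1 * I with hsp
  set K : ℝ := ∑' n : ℕ, ‖LSeries.term (fun n ↦ (ArithmeticFunction.vonMangoldt n : ℂ)) (2 : ℂ) n‖ with hK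
  have hRm : MeasurableSet R := measurableSet_Icc.prod measurableSet_Ioi
  have hre2 : ∀ p ∈ R, 2 ≤ (sp p).re := fun p hp ↦ by simp [hsp]; exact le_of_lt hp.2
  have hne1 : ∀ p ∈ R, sp p ≠ 1 := fun p hp h ↦ by
    have := congrArg Complex.re h; have h2 := hre2 p hp; rw [this] at h2; norm_num at h2
  have hζ : ∀ p ∈ R, riemannZeta (sp p) ≠ 0 := fun p hp h ↦
    (Literature.NumberTheory.LFunctions.Nicolas.riemannZeta_re_pos_of_two_le (hre2 p hp)).ne' (by rw [h]; simp)
  -- dominating function `K · 4 · e^{−(log 2) x}` (a function of `x` alone)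
  have hdom : Integrable (fun p : ℝ × ℝ ↦ (1 : ℝ) * (K * (4 * Real.exp (-Real.log 2 * p.2))))
      ((volume.restrict (Icc t₁ t₂)).prod (volume.restrict (Ioi (2 : ℝ)))) := by
    have h1 : Integrable (fun _ : ℝ ↦ (1 : ℝ)) (volume.restrict (Icc t₁ t₂)) := integrable_const _
    have h2 : Integrable (fun x : ℝ ↦ K * (4 * Real.exp (-Real.log 2 * x))) (volume.restrict (Ioi (2 : ℝ))) :=
      (((exp_neg_integrableOn_Ioi 2 (Real.log_pos (by norm_num))).const_mul 4).const_mul K)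
    exact h1.mul_prod h2
  rw [Measure.prod_restrict, ← Measure.volume_eq_prod] at hdom
  have hcont : ContinuousOn (fun p : ℝ × ℝ ↦ (deriv riemannZeta (sp p) / riemannZeta (sp p)).im) R := by
    intro p hp
    have hc : Continuous sp := by simp only [hsp]; fun_prop
    have h1 := (continuousAt_logDeriv_riemannZeta (hne1 p hp) (hζ p hp)).comp (f := sp) hc.continuousAt
    exact (continuous_im.continuousAt.comp h1).continuousWithinAt
  refine hdom.mono' (hcont.aestronglyMeasurable hRm) ?_
  rw [ae_restrict_iff' hRm]
  refine Eventually.of_forall fun p hp ↦ ?_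
  have h := norm_logDeriv_riemannZeta_le_of_two_le_re (hre2 p hp)
  rw [Real.norm_eq_abs, one_mul]
  refine (abs_im_le_norm _).trans (h.trans (le_of_eq ?_))
  have hre : (sp p).re = p.2 := by simp [hsp]
  rw [hre, Real.rpow_def_of_pos (by norm_num), hK]
  have : Real.log 2 * (2 - p.2) = 2 * Real.log 2 + -Real.log 2 * p.2 := by ring
  rw [this, Real.exp_add, show (2 : ℝ) * Real.log 2 = Real.log 4 by
    rw [show (4 : ℝ) = 2 ^ 2 by norm_num, Real.log_pow]; norm_num, Real.exp_log (by norm_num)]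
  ring

/-- Joint integrability of `Im ζ'/ζ(x + it)` on `[t₁, t₂] × (½, ∞)` for `0 < t₁`, `t₂ ≤ t₁ + 1`.
[folklore] -/
theorem integrableOn_im_logDeriv_riemannZeta_strip {t₁ t₂ : ℝ} (h0 : 0 < t₁) (hlen : t₂ ≤ t₁ + 1) :
    IntegrableOn (fun p : ℝ × ℝ ↦
      (deriv riemannZeta (p.2 + p.1 * I) / riemannZeta (p.2 + p.1 * I)).im)
      (Icc t₁ t₂ ×ˢ Ioi (1 / 2 : ℝ)) := by
  rw [← Ioc_union_Ioi_eq_Ioi (show (1 / 2 : ℝ) ≤ 2 by norm_num), Set.prod_union]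
  exact (integrableOn_im_logDeriv_riemannZeta_near h0 hlen).union
    (integrableOn_im_logDeriv_riemannZeta_far t₁ t₂)

/-- `|log ‖w‖| ≤ (3/2) ‖w − 1‖` when `‖w − 1‖ ≤ ½`. [folklore] -/
lemma abs_log_norm_le_of_norm_sub_one_le {w : ℂ} (hw : ‖w - 1‖ ≤ 1 / 2) :
    |Real.log ‖w‖| ≤ 3 / 2 * ‖w - 1‖ := by
  have h := Complex.norm_log_one_add_half_le_self hw
  rw [add_sub_cancel] at h
  have hw0 : w ≠ 0 := by
    intro h0; rw [h0, zero_sub, norm_neg, norm_one] at hw; norm_num at hw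
  calc |Real.log ‖w‖| = |(Complex.log w).re| := by rw [Complex.log_re]
    _ ≤ ‖Complex.log w‖ := abs_re_le_norm _
    _ ≤ 3 / 2 * ‖w - 1‖ := h

/-- **`σ ↦ log ‖ζ(σ + it)‖` is integrable on `(½, ∞)`** when `t > 0` is not the ordinate of a zero
(continuous on `[½, 3]`, and `≤ (3/2)‖ζ − 1‖ ≤ 2^{2−σ}` beyond). [folklore] -/
theorem integrableOn_log_norm_riemannZeta {t : ℝ} (ht : 0 < t)
    (ht' : ∀ ρ : ℂ, riemannZeta ρ = 0 → ρ.im ≠ t) :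
    IntegrableOn (fun x : ℝ ↦ Real.log ‖riemannZeta (x + t * I)‖) (Ioi (1 / 2 : ℝ)) := by
  have hne1 : ∀ x : ℝ, (x : ℂ) + t * I ≠ 1 := fun x h ↦ by
    have := congrArg Complex.im h; simp at this; exact ht.ne' this
  have hζ : ∀ x : ℝ, riemannZeta (x + t * I) ≠ 0 := fun x h ↦ ht' _ h (by simp)
  -- near part: continuity on `[1/2, 3]`
  have hcont : ContinuousOn (fun x : ℝ ↦ Real.log ‖riemannZeta (x + t * I)‖) (Icc (1 / 2) 3) := by
    intro x _
    have hc : Continuous fun x : ℝ ↦ (x : ℂ) + t * I := by fun_prop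
    have h1 : ContinuousAt (fun x : ℝ ↦ riemannZeta (x + t * I)) x :=
      (differentiableAt_riemannZeta (hne1 x)).continuousAt.comp (f := fun x : ℝ ↦ (x : ℂ) + t * I)
        hc.continuousAt
    exact ((h1.norm).log (norm_ne_zero_iff.2 (hζ x))).continuousWithinAt
  have hnear : IntegrableOn (fun x : ℝ ↦ Real.log ‖riemannZeta (x + t * I)‖) (Ioc (1 / 2) 3) :=
    (hcont.integrableOn_compact isCompact_Icc).mono_set Ioc_subset_Icc_self
  -- far part: domination by `(3/2) · 2^{2−x} (π²/6 − 1) ≤ 4 e^{−(log 2) x}`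
  have hfar : IntegrableOn (fun x : ℝ ↦ Real.log ‖riemannZeta (x + t * I)‖) (Ioi 3) := by
    have hdom : IntegrableOn (fun x : ℝ ↦ 4 * Real.exp (-Real.log 2 * x)) (Ioi 3) :=
      (exp_neg_integrableOn_Ioi 3 (Real.log_pos (by norm_num))).const_mul 4
    have hcont3 : ContinuousOn (fun x : ℝ ↦ Real.log ‖riemannZeta (x + t * I)‖) (Ioi 3) := by
      intro x _
      have hc : Continuous fun x : ℝ ↦ (x : ℂ) + t * I := by fun_prop
      have h1 : ContinuousAt (fun x : ℝ ↦ riemannZeta (x + t * I)) x :=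
        (differentiableAt_riemannZeta (hne1 x)).continuousAt.comp (f := fun x : ℝ ↦ (x : ℂ) + t * I)
          hc.continuousAt
      exact ((h1.norm).log (norm_ne_zero_iff.2 (hζ x))).continuousWithinAt
    refine hdom.mono' (hcont3.aestronglyMeasurable measurableSet_Ioi) ?_
    rw [ae_restrict_iff' measurableSet_Ioi]
    refine Eventually.of_forall fun x hx ↦ ?_
    have hx3 : (3 : ℝ) < x := hx
    have hb := norm_riemannZeta_sub_one_le_of_two_le_re (s := x + t * I) (by simp; linarith)
    simp only [add_re, ofReal_re, mul_re, ofReal_im, I_re, mul_zero, I_im, mul_one, sub_self,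
      add_zero] at hb
    have hpow : (2 : ℝ) ^ (2 - x) = 4 * Real.exp (-Real.log 2 * x) := by
      rw [Real.rpow_def_of_pos (by norm_num)]
      have : Real.log 2 * (2 - x) = 2 * Real.log 2 + -Real.log 2 * x := by ring
      rw [this, Real.exp_add, show (2 : ℝ) * Real.log 2 = Real.log 4 by
        rw [show (4 : ℝ) = 2 ^ 2 by norm_num, Real.log_pow]; norm_num, Real.exp_log (by norm_num)]
    have hpow_le : (2 : ℝ) ^ (2 - x) ≤ 1 / 2 := by
      have : (2 : ℝ) ^ (2 - x) ≤ (2 : ℝ) ^ (-1 : ℝ) :=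
        Real.rpow_le_rpow_of_exponent_le (by norm_num) (by linarith)
      rw [Real.rpow_neg_one] at this
      linarith
    have hπ : π ^ 2 / 6 - 1 ≤ 0.65 := by
      have := Real.pi_lt_d4; nlinarith [Real.pi_pos]
    have hπ0 : 0 ≤ π ^ 2 / 6 - 1 := by
      have := Real.pi_gt_three; nlinarith
    have hsmall : ‖riemannZeta (x + t * I) - 1‖ ≤ 1 / 2 := by
      refine hb.trans ?_
      calc (2 : ℝ) ^ (2 - x) * (π ^ 2 / 6 - 1) ≤ (1 / 2) * 0.65 := by gcongr
        _ ≤ 1 / 2 := by norm_num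
    have hlog := abs_log_norm_le_of_norm_sub_one_le hsmall
    rw [Real.norm_eq_abs]
    refine hlog.trans ?_
    have hexp0 : 0 ≤ Real.exp (-Real.log 2 * x) := (Real.exp_pos _).le
    calc 3 / 2 * ‖riemannZeta (x + t * I) - 1‖ ≤ 3 / 2 * ((2 : ℝ) ^ (2 - x) * (π ^ 2 / 6 - 1)) := by
          gcongr
      _ ≤ 3 / 2 * ((2 : ℝ) ^ (2 - x) * 0.65) := by gcongr
      _ = 3 / 2 * (4 * Real.exp (-Real.log 2 * x) * 0.65) := by rw [hpow]
      _ ≤ 4 * Real.exp (-Real.log 2 * x) := by nlinarith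
  rw [← Ioc_union_Ioi_eq_Ioi (show (1 / 2 : ℝ) ≤ 3 by norm_num)]
  exact hnear.union hfar

/-- The ordinates of the zeros of `ζ` in a bounded height range form a finite set; hence almost
every `t` is not an ordinate. [folklore] -/
theorem ae_not_ordinate (T : ℝ) :
    ∀ᵐ t : ℝ ∂volume, 0 < t → t ≤ T → ∀ ρ : ℂ, riemannZeta ρ = 0 → ρ.im ≠ t := by
  set Ords : Set ℝ := Complex.im '' zetaZeroBox 0 T with hO
  have hfin : Ords.Finite := (zetaZeroBox_finite 0 T).image _
  have hnot : ∀ᵐ t : ℝ ∂volume, t ∉ Ords := compl_mem_ae_iff.2 (hfin.measure_zero _)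
  filter_upwards [hnot] with t ht h0 hT ρ hρ him
  apply ht
  have hst := re_mem_Ioo_of_riemannZeta_eq_zero_of_im_ne_zero hρ (by rw [him]; exact h0.ne')
  exact ⟨ρ, ⟨hρ, hst.1.le, hst.2.le, by rw [him]; exact h0, by rw [him]; exact hT⟩, him⟩

/-- Off the finitely many abscissae of zeros with ordinate in `(0, T]`, the vertical segments
`{x} × [t₁, t₂]` (`0 < t₁`, `t₂ ≤ T`) carry no zero of `ζ`: for a.e. `x`. [folklore] -/
theorem ae_no_zero_on_vertical (T : ℝ) :
    ∀ᵐ x : ℝ ∂volume, ∀ t : ℝ, 0 < t → t ≤ T → riemannZeta (x + t * I) ≠ 0 := by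
  set B : Set ℝ := Complex.re '' zetaZeroBox 0 T with hB
  have hfin : B.Finite := (zetaZeroBox_finite 0 T).image _
  have hnot : ∀ᵐ x : ℝ ∂volume, x ∉ B := compl_mem_ae_iff.2 (hfin.measure_zero _)
  filter_upwards [hnot] with x hx t h0 hT hζ
  apply hx
  have hst := re_mem_Ioo_of_riemannZeta_eq_zero_of_im_ne_zero hζ (by simp; exact h0.ne')
  simp only [add_re, ofReal_re, mul_re, ofReal_im, I_re, mul_zero, I_im, mul_one, sub_self,
    add_zero] at hst
  exact ⟨x + t * I, ⟨hζ, by simp; exact hst.1.le, by simp; exact hst.2.le, by simp; exact h0,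
    by simp; exact hT⟩, by simp⟩

/-- **Turing's lemma on a short range** (Lehman 1970, Lemma 1; Trudgian 2011, Lemma 2.4; Edwards
§8.2, eq. (1), going back to Littlewood 1924 and Turing 1953): for `0 < t₁ ≤ t₂ ≤ t₁ + 1` with
`t₁, t₂` not ordinates of zeros,
`π ∫_{t₁}^{t₂} S(t) dt = ∫_{1/2}^∞ log ‖ζ(σ + it₂)‖ dσ − ∫_{1/2}^∞ log ‖ζ(σ + it₁)‖ dσ`.
Proof: integrate `π S(t) = −∫_{1/2}^∞ Im ζ'/ζ(σ+it) dσ` (`pi_mul_zetaArgS_eq_neg_integral_Ioi`, valid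
for a.e. `t`) over `[t₁, t₂]`, exchange the integrals (Fubini; joint integrability by
`integrableOn_im_logDeriv_riemannZeta_strip`) and integrate `−Im ζ'/ζ = ∂_t log ‖ζ‖` along a.e.
vertical segment (`integral_im_logDeriv_vertical`). [cite: Lehman1970, Lemma 1] -/
theorem pi_mul_integral_zetaArgS_eq_of_le_add_one {t₁ t₂ : ℝ} (h0 : 0 < t₁) (h12 : t₁ ≤ t₂)
    (hlen : t₂ ≤ t₁ + 1) (h1' : ∀ ρ : ℂ, riemannZeta ρ = 0 → ρ.im ≠ t₁)
    (h2' : ∀ ρ : ℂ, riemannZeta ρ = 0 → ρ.im ≠ t₂) :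
    π * ∫ t in t₁..t₂, zetaArgS t =
      (∫ x in Ioi (1 / 2 : ℝ), Real.log ‖riemannZeta (x + t₂ * I)‖) -
        ∫ x in Ioi (1 / 2 : ℝ), Real.log ‖riemannZeta (x + t₁ * I)‖ := by
  set f : ℝ → ℝ → ℝ := fun t x ↦ (deriv riemannZeta (x + t * I) / riemannZeta (x + t * I)).im with hf
  set L : ℝ → ℝ → ℝ := fun x t ↦ Real.log ‖riemannZeta (x + t * I)‖ with hL
  -- Step A: `π S(t) = −∫ f t` for a.e. `t ∈ [t₁, t₂]`
  have hA : ∫ t in t₁..t₂, π * zetaArgS t = ∫ t in t₁..t₂, -∫ x in Ioi (1 / 2 : ℝ), f t x := by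
    refine intervalIntegral.integral_congr_ae ?_
    filter_upwards [ae_not_ordinate t₂] with t ht hmem
    rw [uIoc_of_le h12] at hmem
    exact pi_mul_zetaArgS_eq_neg_integral_Ioi (h0.trans hmem.1) (ht (h0.trans hmem.1) hmem.2)
  -- Step B: Fubini
  have hint := integrableOn_im_logDeriv_riemannZeta_strip h0 hlen
  have hprod : Integrable (Function.uncurry f)
      ((volume.restrict (Icc t₁ t₂)).prod (volume.restrict (Ioi (1 / 2 : ℝ)))) := by
    rw [Measure.prod_restrict, ← Measure.volume_eq_prod]
    exact hint
  have hB : ∫ t in t₁..t₂, (∫ x in Ioi (1 / 2 : ℝ), f t x) =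
      ∫ x in Ioi (1 / 2 : ℝ), ∫ t in t₁..t₂, f t x := by
    rw [intervalIntegral.integral_of_le h12, ← integral_Icc_eq_integral_Ioc,
      integral_integral_swap hprod]
    refine integral_congr_ae (Eventually.of_forall fun x ↦ ?_)
    simp only
    rw [intervalIntegral.integral_of_le h12, ← integral_Icc_eq_integral_Ioc]
  -- Step C: the inner integrals, a.e. in `x`
  have hC : ∀ᵐ x : ℝ ∂(volume.restrict (Ioi (1 / 2 : ℝ))),
      ∫ t in t₁..t₂, f t x = -(L x t₂ - L x t₁) := by
    refine ae_restrict_of_ae ?_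
    filter_upwards [ae_no_zero_on_vertical t₂] with x hx
    refine integral_im_logDeriv_vertical h12 (fun t ht ↦ analyticOn_riemannZeta _ ?_)
      (fun t ht ↦ hx t (h0.trans_le ht.1) ht.2)
    intro h
    have := congrArg Complex.im h
    simp at this
    linarith [ht.1]
  have hC' : ∫ x in Ioi (1 / 2 : ℝ), (∫ t in t₁..t₂, f t x) =
      ∫ x in Ioi (1 / 2 : ℝ), -(L x t₂ - L x t₁) := integral_congr_ae hC
  have hL1 := integrableOn_log_norm_riemannZeta h0 h1'
  have hL2 := integrableOn_log_norm_riemannZeta (h0.trans_le h12) h2'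
  -- Step D
  rw [← intervalIntegral.integral_const_mul, hA, intervalIntegral.integral_neg, hB, hC',
    MeasureTheory.integral_neg, neg_neg]
  simp only [hL]
  exact integral_sub hL2 hL1

/-- **Turing's lemma** (Lehman 1970, Lemma 1; Trudgian 2011, Lemma 2.4; Edwards §8.2 (1)): for
`0 < t₁ ≤ t₂` with `t₁, t₂` not ordinates of zeros of `ζ`,
`π ∫_{t₁}^{t₂} S(t) dt = ∫_{1/2}^∞ log ‖ζ(σ + it₂)‖ dσ − ∫_{1/2}^∞ log ‖ζ(σ + it₁)‖ dσ`
(the short-range case `pi_mul_integral_zetaArgS_eq_of_le_add_one` chained across intermediate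
non-ordinates). This is the identity on which Turing's method rests: an upper bound for
`∫ log ‖ζ‖` along `Im s = t₂` and a lower bound along `Im s = t₁` bound `∫ S`, hence `N(T)`
(`TuringMethod.lean`). [cite: Lehman1970, Lemma 1] -/
theorem pi_mul_integral_zetaArgS_eq {t₁ t₂ : ℝ} (h0 : 0 < t₁) (h12 : t₁ ≤ t₂)
    (h1' : ∀ ρ : ℂ, riemannZeta ρ = 0 → ρ.im ≠ t₁) (h2' : ∀ ρ : ℂ, riemannZeta ρ = 0 → ρ.im ≠ t₂) :
    π * ∫ t in t₁..t₂, zetaArgS t =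
      (∫ x in Ioi (1 / 2 : ℝ), Real.log ‖riemannZeta (x + t₂ * I)‖) -
        ∫ x in Ioi (1 / 2 : ℝ), Real.log ‖riemannZeta (x + t₁ * I)‖ := by
  -- interval integrability of `S = N − θ/π − 1`
  have hθc : Continuous riemannSiegelTheta :=
    continuous_iff_continuousAt.2 fun t ↦ (hasDerivAt_riemannSiegelTheta_holds t).continuousAt
  have hS : ∀ a b : ℝ, IntervalIntegrable zetaArgS volume a b := by
    intro a b
    have hN : IntervalIntegrable (fun T : ℝ ↦ (zetaZeroCount T : ℝ)) volume a b :=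
      Monotone.intervalIntegrable fun x y hxy ↦ Nat.cast_le.2 (zetaZeroCount_mono hxy)
    have h := (hN.sub ((hθc.div_const π).intervalIntegrable a b)).sub
      (intervalIntegrable_const (c := (1 : ℝ)))
    have e : zetaArgS = fun T ↦ (zetaZeroCount T : ℝ) - riemannSiegelTheta T / π - 1 := by
      funext T; rfl
    rw [e]; exact h
  -- non-ordinates are dense: in every `(a, b)`, `a < b`, there is one
  have hdense : ∀ a b : ℝ, a < b → 0 ≤ a →
      ∃ t ∈ Ioo a b, ∀ ρ : ℂ, riemannZeta ρ = 0 → ρ.im ≠ t := by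
    intro a b hab ha
    set Ords : Set ℝ := Complex.im '' zetaZeroBox 0 b with hO
    have hfin : Ords.Finite := (zetaZeroBox_finite 0 b).image _
    obtain ⟨t, ht⟩ := ((Ioo_infinite hab).sdiff hfin).nonempty
    refine ⟨t, ht.1, fun ρ hρ him ↦ ht.2 ?_⟩
    have ht0 : 0 < t := ha.trans_lt ht.1.1
    have hst := re_mem_Ioo_of_riemannZeta_eq_zero_of_im_ne_zero hρ (by rw [him]; exact ht0.ne')
    exact ⟨ρ, ⟨hρ, hst.1.le, hst.2.le, by rw [him]; exact ht0, by rw [him]; exact ht.1.2.le⟩, him⟩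
  -- induction on the length
  suffices key : ∀ N : ℕ, ∀ t₁ t₂ : ℝ, 0 < t₁ → t₁ ≤ t₂ → t₂ - t₁ ≤ N / 2 →
      (∀ ρ : ℂ, riemannZeta ρ = 0 → ρ.im ≠ t₁) → (∀ ρ : ℂ, riemannZeta ρ = 0 → ρ.im ≠ t₂) →
      π * ∫ t in t₁..t₂, zetaArgS t =
        (∫ x in Ioi (1 / 2 : ℝ), Real.log ‖riemannZeta (x + t₂ * I)‖) -
          ∫ x in Ioi (1 / 2 : ℝ), Real.log ‖riemannZeta (x + t₁ * I)‖ by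
    obtain ⟨N, hN⟩ := exists_nat_ge (2 * (t₂ - t₁))
    exact key N t₁ t₂ h0 h12 (by linarith) h1' h2'
  intro N
  induction N with
  | zero =>
    intro t₁ t₂ h0 h12 hlen h1' h2'
    exact pi_mul_integral_zetaArgS_eq_of_le_add_one h0 h12 (by simp at hlen; linarith) h1' h2'
  | succ N ih =>
    intro t₁ t₂ h0 h12 hlen h1' h2'
    by_cases hshort : t₂ ≤ t₁ + 1
    · exact pi_mul_integral_zetaArgS_eq_of_le_add_one h0 h12 hshort h1' h2'
    · rw [not_le] at hshort
      obtain ⟨t', ht', hord'⟩ := hdense (t₁ + 1 / 2) (t₁ + 1) (by linarith) (by linarith)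
      have hA := pi_mul_integral_zetaArgS_eq_of_le_add_one h0 (by linarith [ht'.1]) (by linarith [ht'.2])
        h1' hord'
      have hB := ih t' t₂ (by linarith [ht'.1]) (by linarith [ht'.2]) (by push_cast at hlen ⊢; linarith [ht'.1])
        hord' h2'
      rw [← intervalIntegral.integral_add_adjacent_intervals (hS t₁ t') (hS t' t₂), mul_add, hA, hB]
      ring

end turing_lemma

/-! ### Littlewood's theorem `∫₀ᵀ S(t) dt = O(log T)` (Titchmarsh Thm. 9.9 (A)) -/

section littlewood

/-- **`d/dx log ‖g(x + iy)‖ = Re (g'/g)(x + iy)`** for `g` analytic and non-zero at `x + iy`.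
[folklore] -/
theorem hasDerivAt_log_norm_comp_horizontal {g : ℂ → ℂ} {x y : ℝ} (hg : AnalyticAt ℂ g (x + y * I))
    (h0 : g (x + y * I) ≠ 0) :
    HasDerivAt (fun x : ℝ ↦ Real.log ‖g (x + y * I)‖)
      ((deriv g (x + y * I) / g (x + y * I)).re) x := by
  have h1 : HasDerivAt (fun w : ℂ ↦ w + y * I) 1 (x : ℂ) := (hasDerivAt_id (x : ℂ)).add_const _
  have h2 : HasDerivAt (fun w : ℂ ↦ g (w + y * I)) (deriv g (x + y * I) * 1) (x : ℂ) :=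
    hg.differentiableAt.hasDerivAt.comp (x : ℂ) h1
  have hG : HasDerivAt (fun x : ℝ ↦ g (x + y * I)) (deriv g (x + y * I)) x := by
    simpa using h2.comp_ofReal
  set G : ℝ → ℂ := fun x ↦ g (x + y * I) with hGdef
  set w : ℂ := deriv g (x + y * I) with hw
  have hre : HasDerivAt (fun t ↦ (G t).re) w.re x := reCLM.hasFDerivAt.comp_hasDerivAt x hG
  have him : HasDerivAt (fun t ↦ (G t).im) w.im x := imCLM.hasFDerivAt.comp_hasDerivAt x hG
  have hnsq : HasDerivAt (fun t ↦ Complex.normSq (G t)) (2 * ((G x).re * w.re + (G x).im * w.im)) x := by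
    have this : HasDerivAt (fun t ↦ (G t).re ^ 2 + (G t).im ^ 2)
        (((2 : ℕ) : ℝ) * (G x).re ^ (2 - 1) * w.re + ((2 : ℕ) : ℝ) * (G x).im ^ (2 - 1) * w.im) x :=
      (hre.pow 2).add (him.pow 2)
    have e : (fun t ↦ (G t).re ^ 2 + (G t).im ^ 2) = fun t ↦ Complex.normSq (G t) := by
      funext u; rw [Complex.normSq_apply]; ring
    rw [e] at this
    refine this.congr_deriv ?_
    push_cast
    ring
  have hpos : 0 < Complex.normSq (G x) := Complex.normSq_pos.2 h0
  have hlog := (hnsq.log hpos.ne').const_mul (1 / 2)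
  have e2 : (fun t ↦ 1 / 2 * Real.log (Complex.normSq (G t))) = fun t ↦ Real.log ‖G t‖ := by
    funext u
    rw [← Complex.sq_norm, Real.log_pow]
    ring
  rw [e2] at hlog
  refine hlog.congr_deriv ?_
  have hn0 : Complex.normSq (G x) ≠ 0 := hpos.ne'
  rw [show (deriv g (x + y * I) / g (x + y * I)).re = (w / G x).re by simp only [hw, hGdef], div_re]
  field_simp

/-- **Horizontal FTC for `log ‖g‖`**: if `g` is analytic and non-zero on `[a, b] × {y}`, then
`∫_a^b Re (g'/g)(x + iy) dx = log ‖g(b + iy)‖ − log ‖g(a + iy)‖`. [folklore] -/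
theorem integral_re_logDeriv_horizontal {g : ℂ → ℂ} {y a b : ℝ} (hab : a ≤ b)
    (hg : ∀ x ∈ Icc a b, AnalyticAt ℂ g (x + y * I)) (h0 : ∀ x ∈ Icc a b, g (x + y * I) ≠ 0) :
    ∫ x in a..b, (deriv g (x + y * I) / g (x + y * I)).re =
      Real.log ‖g (b + y * I)‖ - Real.log ‖g (a + y * I)‖ := by
  have hderiv : ∀ x ∈ Icc a b, HasDerivAt (fun x : ℝ ↦ Real.log ‖g (x + y * I)‖)
      ((deriv g (x + y * I) / g (x + y * I)).re) x := fun x hx ↦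
    hasDerivAt_log_norm_comp_horizontal (hg x hx) (h0 x hx)
  have hcont : ContinuousOn (fun x : ℝ ↦ (deriv g (x + y * I) / g (x + y * I)).re) (Icc a b) := by
    intro x hx
    have hc : Continuous fun x : ℝ ↦ (x : ℂ) + y * I := by fun_prop
    have h1 : ContinuousAt (fun x : ℝ ↦ deriv g (x + y * I) / g (x + y * I)) x :=
      ((hg x hx).deriv.continuousAt.comp (f := fun x : ℝ ↦ (x : ℂ) + y * I) hc.continuousAt).div
        ((hg x hx).continuousAt.comp (f := fun x : ℝ ↦ (x : ℂ) + y * I) hc.continuousAt) (h0 x hx)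
    exact (continuous_re.continuousAt.comp h1).continuousWithinAt
  exact intervalIntegral.integral_eq_sub_of_hasDerivAt (fun x hx ↦ hderiv x (by rwa [uIcc_of_le hab] at hx))
    ((hcont.mono (by rw [uIcc_of_le hab])).intervalIntegrable)

/-- **`∫_p^{p + 3/2} log|u| du ≥ −2`** for every `p` (the worst case is the symmetric one,
`∫_{−3/4}^{3/4} log|u| du = −1.93…`; we compare with `∫_{−1}^{1} log|u| du = −2`). [folklore] -/
theorem neg_two_le_integral_log (p : ℝ) : -2 ≤ ∫ u in p..(p + 3 / 2), Real.log u := by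
  set g : ℝ → ℝ := (Icc (-1 : ℝ) 1).indicator Real.log with hg
  have hle : ∀ u, g u ≤ Real.log u := by
    intro u
    simp only [hg, Set.indicator_apply]
    split_ifs with h
    · exact le_rfl
    · rw [← Real.log_abs]
      refine Real.log_nonneg ?_
      rw [mem_Icc, not_and_or, not_le, not_le] at h
      rcases h with h | h
      · rw [abs_of_neg (by linarith)]; linarith
      · rw [abs_of_pos (by linarith)]; linarith
  have hg0 : ∀ u, g u ≤ 0 := by
    intro u
    simp only [hg, Set.indicator_apply]
    split_ifs with h
    · rw [← Real.log_abs]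
      rcases eq_or_ne u 0 with h0 | h0
      · simp [h0]
      · exact Real.log_nonpos (abs_nonneg _) (abs_le.2 ⟨h.1, h.2⟩)
    · exact le_rfl
  have hgint : Integrable g := by
    rw [hg, integrable_indicator_iff measurableSet_Icc]
    exact (intervalIntegral.intervalIntegrable_log'.1 : IntegrableOn Real.log (Ioc (-1) 1))
      |>.congr_set_ae Ioc_ae_eq_Icc.symm |>.mono_set subset_rfl
  have htot : ∫ u, g u = -2 := by
    rw [hg, MeasureTheory.integral_indicator measurableSet_Icc, integral_Icc_eq_integral_Ioc,
      ← intervalIntegral.integral_of_le (by norm_num), integral_log]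
    norm_num
  have h1 : ∫ u in p..(p + 3 / 2), g u ≤ ∫ u in p..(p + 3 / 2), Real.log u :=
    intervalIntegral.integral_mono_on (by linarith) (hgint.intervalIntegrable)
      intervalIntegral.intervalIntegrable_log' fun u _ ↦ hle u
  have h2 : ∫ u, g u ≤ ∫ u in p..(p + 3 / 2), g u := by
    rw [intervalIntegral.integral_of_le (by linarith),
      ← integral_add_compl (measurableSet_Ioc (a := p) (b := p + 3 / 2)) hgint]
    have : ∫ u in (Ioc p (p + 3 / 2))ᶜ, g u ≤ 0 :=
      setIntegral_nonpos (measurableSet_Ioc.compl) fun u _ ↦ hg0 u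
    linarith
  linarith

/-- `∫_{1/2}^{2} log |σ − β| dσ ≥ −2` for every real `β`. [folklore] -/
theorem neg_two_le_integral_log_abs_sub (β : ℝ) :
    -2 ≤ ∫ σ in (1 / 2 : ℝ)..2, Real.log |σ - β| := by
  simp_rw [Real.log_abs]
  rw [intervalIntegral.integral_comp_sub_right (fun u ↦ Real.log u) β]
  have := neg_two_le_integral_log (1 / 2 - β)
  rwa [show (1 / 2 : ℝ) - β + 3 / 2 = 2 - β by ring] at this

/-- For `u ∈ [½, 2]` the point `u + it` lies in the disc `|s − (2 + it)| ≤ 7/4`. [folklore] -/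
lemma mem_closedBall_of_mem_Icc_half_two {u : ℝ} (hu : u ∈ Icc (1 / 2 : ℝ) 2) (t : ℝ) :
    (u : ℂ) + t * I ∈ closedBall (2 + (t : ℂ) * I) (7 / 4) :=
  Literature.NumberTheory.LFunctions.mem_closedBall_of_re_mem_Icc ⟨by linarith [hu.1], hu.2⟩ t

/-- **Lower bound for `log ‖ζ(σ + it)‖` near the critical strip** (Titchmarsh Thm. 9.6 (B) / §9.9):
there is an absolute `C` such that for `t ≥ 2` not an ordinate and `½ ≤ σ ≤ 2`,
`log ‖ζ(σ+it)‖ ≥ −C log(t+4) − log 3 + Σ_{ρ ∈ disc} m(ρ) (log ‖σ+it−ρ‖ − log 2)`, the sum over the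
zeros in `|s − (2+it)| ≤ 37/20` with multiplicity. (Integrate the partial fraction
`ζ'/ζ = Σ m(ρ)/(s−ρ) − 1/(s−1) + O(log t)` (`Literature.NumberTheory.LFunctions.exists_norm_logDeriv_riemannZeta₁_sub_sum_le`)
along `[σ, 2] × {t}`: `Re ∫ ζ'/ζ = Δ log ‖ζ‖`, `Re ∫ 1/(s−ρ) = Δ log ‖s − ρ‖`.)
[cite: Titchmarsh1986, Thm. 9.6 (B)] -/
theorem exists_log_norm_riemannZeta_ge :
    ∃ C : ℝ, 0 < C ∧ ∀ t : ℝ, 2 ≤ t → (∀ ρ : ℂ, riemannZeta ρ = 0 → ρ.im ≠ t) →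
      ∀ σ ∈ Icc (1 / 2 : ℝ) 2,
        -(C * Real.log (|t| + 4)) - Real.log 3 +
            ∑ ρ ∈ Literature.NumberTheory.LFunctions.zetaDiscZeros t, (Literature.NumberTheory.LFunctions.zetaDiscDivisor t ρ : ℝ) *
              (Real.log ‖(σ : ℂ) + t * I - ρ‖ - Real.log 2) ≤
          Real.log ‖riemannZeta (σ + t * I)‖ := by
  obtain ⟨C₀, hC₀, hC⟩ := Literature.NumberTheory.LFunctions.exists_norm_logDeriv_riemannZeta₁_sub_sum_le
  refine ⟨3 / 2 * C₀, by positivity, fun t ht hord σ hσ ↦ ?_⟩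
  set Z := Literature.NumberTheory.LFunctions.zetaDiscZeros t with hZ
  set d : ℂ → ℤ := fun ρ ↦ Literature.NumberTheory.LFunctions.zetaDiscDivisor t ρ with hd
  set L : ℝ := Real.log (|t| + 4) with hL
  have hL0 : 0 ≤ L := Real.log_nonneg (by linarith [abs_nonneg t])
  have ht0 : 0 < t := by linarith
  -- basic facts on the segment `[σ, 2] × {t}`
  have hne1 : ∀ u : ℝ, (u : ℂ) + t * I ≠ 1 := fun u h ↦ by
    have := congrArg Complex.im h; simp at this; exact ht0.ne' this
  have hζne : ∀ u : ℝ, riemannZeta (u + t * I) ≠ 0 := fun u h ↦ hord _ h (by simp)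
  have hζ₁ne : ∀ u : ℝ, riemannZeta₁ (u + t * I) ≠ 0 := fun u h ↦
    hζne u ((Literature.NumberTheory.LFunctions.riemannZeta₁_eq_zero_iff (hne1 u)).1 h)
  have hρim : ∀ ρ ∈ Z, ρ.im ≠ t := fun ρ hρ ↦ hord ρ (Literature.NumberTheory.LFunctions.zetaDiscZeros_prop hρ).1
  have hρne : ∀ ρ ∈ Z, ∀ u : ℝ, (u : ℂ) + t * I - ρ ≠ 0 := fun ρ hρ u h ↦ by
    have := congrArg Complex.im h; simp at this; exact hρim ρ hρ (by linarith)
  have hdnn : ∀ ρ, (0 : ℝ) ≤ (d ρ : ℝ) := fun ρ ↦ by exact_mod_cast Literature.NumberTheory.LFunctions.zetaDiscDivisor_nonneg t ρ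
  have hσ2 : σ ≤ 2 := hσ.2
  -- (a) FTC for `log ‖ζ‖`
  have hA : ∫ u in σ..2, (deriv riemannZeta (u + t * I) / riemannZeta (u + t * I)).re =
      Real.log ‖riemannZeta (2 + t * I)‖ - Real.log ‖riemannZeta (σ + t * I)‖ := by
    have := integral_re_logDeriv_horizontal (g := riemannZeta) (y := t) hσ2
      (fun u _ ↦ analyticOn_riemannZeta _ (hne1 u)) (fun u _ ↦ hζne u)
    simpa using this
  -- (b) FTC for the elementary pieces
  have hB : ∀ ρ : ℂ, ρ.im ≠ t →
      ∫ u in σ..2, (1 / ((u : ℂ) + t * I - ρ)).re = Real.log ‖(2 : ℂ) + t * I - ρ‖ - Real.log ‖(σ : ℂ) + t * I - ρ‖ := by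
    intro ρ hρ
    have hne : ∀ u : ℝ, (u : ℂ) + t * I - ρ ≠ 0 := fun u h ↦ by
      have := congrArg Complex.im h; simp at this; exact hρ (by linarith)
    have h := integral_re_logDeriv_horizontal (g := fun s : ℂ ↦ s - ρ) (y := t) hσ2
      (fun u _ ↦ (analyticAt_id.sub analyticAt_const)) (fun u _ ↦ hne u)
    simp only [deriv_sub_const, deriv_id'', ofReal_ofNat] at h
    rw [← h]
  -- (c) the remainder `E(s) = ζ₁'/ζ₁(s) − Σ d/(s−ρ)` and the pointwise decomposition
  set Φ : ℝ → ℝ := fun u ↦ (∑ ρ ∈ Z, (d ρ : ℝ) * (1 / ((u : ℂ) + t * I - ρ)).re) -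
    (1 / ((u : ℂ) + t * I - 1)).re with hΦ
  have hΦcont : Continuous Φ := by
    simp only [hΦ]
    refine (continuous_finsetSum _ fun ρ hρ ↦ continuous_const.mul ?_).sub ?_
    · exact continuous_re.comp ((continuous_const.div (by fun_prop) (hρne ρ hρ)))
    · refine continuous_re.comp (continuous_const.div (by fun_prop) fun u h ↦ ?_)
      have := congrArg Complex.im h; simp at this; exact ht0.ne' this
  have hFcont : ContinuousOn (fun u : ℝ ↦ (deriv riemannZeta (u + t * I) / riemannZeta (u + t * I)).re)
      (Icc σ 2) := by
    intro u _
    have hc : Continuous fun u : ℝ ↦ (u : ℂ) + t * I := by fun_prop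
    exact (continuous_re.continuousAt.comp ((continuousAt_logDeriv_riemannZeta (hne1 u) (hζne u)).comp
      (f := fun u : ℝ ↦ (u : ℂ) + t * I) hc.continuousAt)).continuousWithinAt
  have hpt : ∀ u ∈ Icc σ 2,
      (deriv riemannZeta (u + t * I) / riemannZeta (u + t * I)).re - Φ u =
        (logDeriv riemannZeta₁ (u + t * I) - ∑ ρ ∈ Z, (Literature.NumberTheory.LFunctions.zetaDiscDivisor t ρ : ℂ) / ((u : ℂ) + t * I - ρ)).re := by
    intro u _
    rw [← logDeriv_apply, Literature.NumberTheory.LFunctions.logDeriv_riemannZeta_eq (hne1 u) (hζne u)]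
    simp only [hΦ, sub_re, Complex.re_sum, hd]
    have : ∀ ρ ∈ Z, ((Literature.NumberTheory.LFunctions.zetaDiscDivisor t ρ : ℂ) / ((u : ℂ) + t * I - ρ)).re =
        (Literature.NumberTheory.LFunctions.zetaDiscDivisor t ρ : ℝ) * (1 / ((u : ℂ) + t * I - ρ)).re := by
      intro ρ _
      rw [div_eq_mul_one_div, show (Literature.NumberTheory.LFunctions.zetaDiscDivisor t ρ : ℂ) = ((Literature.NumberTheory.LFunctions.zetaDiscDivisor t ρ : ℝ) : ℂ) by
        norm_cast, re_ofReal_mul]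
    rw [Finset.sum_congr rfl this, one_div]
    ring
  have hbound : ∀ u ∈ Icc σ 2,
      ‖(deriv riemannZeta (u + t * I) / riemannZeta (u + t * I)).re - Φ u‖ ≤ C₀ * L := by
    intro u hu
    rw [hpt u hu, Real.norm_eq_abs]
    refine (abs_re_le_norm _).trans ?_
    exact hC t _ (mem_closedBall_of_mem_Icc_half_two ⟨by linarith [hσ.1, hu.1], hu.2⟩ t) (hζ₁ne u)
  -- (d) integrate
  have hIF : IntervalIntegrable (fun u : ℝ ↦ (deriv riemannZeta (u + t * I) / riemannZeta (u + t * I)).re)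
      volume σ 2 := (hFcont.mono (by rw [uIcc_of_le hσ2])).intervalIntegrable
  have hIΦ : IntervalIntegrable Φ volume σ 2 := hΦcont.intervalIntegrable _ _
  have hE : |(∫ u in σ..2, (deriv riemannZeta (u + t * I) / riemannZeta (u + t * I)).re) -
      ∫ u in σ..2, Φ u| ≤ 3 / 2 * C₀ * L := by
    rw [← intervalIntegral.integral_sub hIF hIΦ]
    have h := intervalIntegral.norm_integral_le_of_norm_le_const (a := σ) (b := 2) (C := C₀ * L)
      (f := fun u ↦ (deriv riemannZeta (u + t * I) / riemannZeta (u + t * I)).re - Φ u)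
      (fun u hu ↦ hbound u (by rw [uIoc_of_le hσ2] at hu; exact ⟨hu.1.le, hu.2⟩))
    rw [Real.norm_eq_abs] at h
    refine h.trans ?_
    rw [abs_of_nonneg (by linarith : (0 : ℝ) ≤ 2 - σ)]
    have hCL : 0 ≤ C₀ * L := by positivity
    nlinarith [mul_le_mul_of_nonneg_left (show (2 : ℝ) - σ ≤ 3 / 2 by linarith [hσ.1]) hCL]
  have hΦint : ∫ u in σ..2, Φ u =
      (∑ ρ ∈ Z, (d ρ : ℝ) * (Real.log ‖(2 : ℂ) + t * I - ρ‖ - Real.log ‖(σ : ℂ) + t * I - ρ‖)) -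
        (Real.log ‖(2 : ℂ) + t * I - 1‖ - Real.log ‖(σ : ℂ) + t * I - 1‖) := by
    simp only [hΦ]
    rw [intervalIntegral.integral_sub, intervalIntegral.integral_finsetSum]
    · congr 1
      · refine Finset.sum_congr rfl fun ρ hρ ↦ ?_
        rw [intervalIntegral.integral_const_mul, hB ρ (hρim ρ hρ)]
      · have := hB 1 (by simp; exact ht0.ne)
        simpa using this
    · intro ρ hρ
      exact ((continuous_const.mul (continuous_re.comp
        (continuous_const.div (by fun_prop) (hρne ρ hρ)))).intervalIntegrable _ _)
    · exact (continuous_finsetSum _ fun ρ hρ ↦ continuous_const.mul (continuous_re.comp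
        (continuous_const.div (by fun_prop) (hρne ρ hρ)))).intervalIntegrable _ _
    · exact (continuous_re.comp (continuous_const.div (by fun_prop) fun u h ↦ by
        have := congrArg Complex.im h; simp at this; exact ht0.ne' this)).intervalIntegrable _ _
  -- (e) the elementary estimates
  have hζ2 : -Real.log 3 ≤ Real.log ‖riemannZeta (2 + t * I)‖ := by
    have h13 := Literature.NumberTheory.LFunctions.one_third_le_norm_riemannZeta_two_add t
    rw [show -Real.log 3 = Real.log (1 / 3) by rw [one_div, Real.log_inv]]
    exact Real.log_le_log (by norm_num) h13
  have hone : 0 ≤ Real.log ‖(2 : ℂ) + t * I - 1‖ - Real.log ‖(σ : ℂ) + t * I - 1‖ := by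
    rw [sub_nonneg]
    apply Real.log_le_log
    · exact norm_pos_iff.2 (sub_ne_zero.2 (hne1 σ))
    · have e1 : ‖(σ : ℂ) + t * I - 1‖ ^ 2 = (σ - 1) ^ 2 + t ^ 2 := by
        rw [Complex.sq_norm, Complex.normSq_apply]; simp; ring
      have e2 : ‖(2 : ℂ) + t * I - 1‖ ^ 2 = 1 + t ^ 2 := by
        rw [Complex.sq_norm, Complex.normSq_apply]; simp; ring
      have : (σ - 1) ^ 2 ≤ 1 := by nlinarith [hσ.1, hσ.2]
      exact (pow_le_pow_iff_left₀ (norm_nonneg _) (norm_nonneg _) two_ne_zero).1 (by rw [e1, e2]; linarith)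
  have hρlog : ∀ ρ ∈ Z, Real.log ‖(2 : ℂ) + t * I - ρ‖ ≤ Real.log 2 := by
    intro ρ hρ
    have hmem := (Literature.NumberTheory.LFunctions.mem_zetaDiscZeros.1 hρ).1
    rw [mem_closedBall, dist_comm, dist_eq_norm] at hmem
    apply Real.log_le_log (norm_pos_iff.2 (by simpa using hρne ρ hρ 2))
    linarith
  -- (f) assemble
  have key : Real.log ‖riemannZeta (σ + t * I)‖ =
      Real.log ‖riemannZeta (2 + t * I)‖ - ∫ u in σ..2,
        (deriv riemannZeta (u + t * I) / riemannZeta (u + t * I)).re := by rw [hA]; ring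
  have hsum_le : ∑ ρ ∈ Z, (d ρ : ℝ) * (Real.log ‖(2 : ℂ) + t * I - ρ‖ - Real.log ‖(σ : ℂ) + t * I - ρ‖) ≤
      ∑ ρ ∈ Z, (d ρ : ℝ) * (Real.log 2 - Real.log ‖(σ : ℂ) + t * I - ρ‖) :=
    Finset.sum_le_sum fun ρ hρ ↦ mul_le_mul_of_nonneg_left (by linarith [hρlog ρ hρ]) (hdnn ρ)
  have habs := abs_le.1 hE
  rw [hΦint] at habs
  have e : ∑ ρ ∈ Z, (d ρ : ℝ) * (Real.log ‖(σ : ℂ) + t * I - ρ‖ - Real.log 2) =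
      -∑ ρ ∈ Z, (d ρ : ℝ) * (Real.log 2 - Real.log ‖(σ : ℂ) + t * I - ρ‖) := by
    rw [← Finset.sum_neg_distrib]; refine Finset.sum_congr rfl fun ρ _ ↦ by ring
  rw [key]
  simp only [hd] at e hsum_le habs
  rw [e]
  linarith [habs.1, habs.2]

/-- `σ ↦ log |σ − β|` is interval integrable. [folklore] -/
lemma intervalIntegrable_log_abs_sub (β a b : ℝ) :
    IntervalIntegrable (fun σ : ℝ ↦ Real.log |σ - β|) volume a b := by
  have h := (intervalIntegral.intervalIntegrable_log' (a := a - β) (b := b - β)).comp_sub_right β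
  simp only [sub_add_cancel] at h
  refine h.congr fun σ _ ↦ ?_
  simp [Real.log_abs]

/-- `∫_{1/2}^{2} log ‖σ + it − ρ‖ dσ ≥ −2` (`‖σ + it − ρ‖ ≥ |σ − Re ρ|` off `σ = Re ρ`, and
`neg_two_le_integral_log_abs_sub`). [folklore] -/
theorem neg_two_le_integral_log_norm_sub (t : ℝ) (ρ : ℂ) (hρ : ρ.im ≠ t) :
    -2 ≤ ∫ σ in (1 / 2 : ℝ)..2, Real.log ‖(σ : ℂ) + t * I - ρ‖ := by
  have hne : ∀ σ : ℝ, (σ : ℂ) + t * I - ρ ≠ 0 := fun σ h ↦ by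
    have := congrArg Complex.im h; simp at this; exact hρ (by linarith)
  have hcont : Continuous fun σ : ℝ ↦ Real.log ‖(σ : ℂ) + t * I - ρ‖ :=
    (continuous_norm.comp (by fun_prop : Continuous fun σ : ℝ ↦ (σ : ℂ) + t * I - ρ)).log
      fun σ ↦ norm_ne_zero_iff.2 (hne σ)
  refine (neg_two_le_integral_log_abs_sub ρ.re).trans ?_
  refine intervalIntegral.integral_mono_ae (by norm_num) (intervalIntegrable_log_abs_sub _ _ _)
    (hcont.intervalIntegrable _ _) ?_
  have hae : ∀ᵐ σ : ℝ ∂volume, σ ≠ ρ.re := by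
    have : ({ρ.re} : Set ℝ)ᶜ ∈ ae volume := compl_mem_ae_iff.2 (measure_singleton _)
    filter_upwards [this] with σ hσ
    simpa using hσ
  filter_upwards [hae] with σ hσ
  have hpos : 0 < |σ - ρ.re| := abs_pos.2 (sub_ne_zero.2 hσ)
  refine Real.log_le_log hpos ?_
  have := abs_re_le_norm ((σ : ℂ) + t * I - ρ)
  simpa using this

/-- **Lower bound for `∫_{1/2}^{2} log ‖ζ(σ + it)‖ dσ`** (the step of Titchmarsh §9.9 that needs
Jensen): there are `A, B` with `∫_{1/2}^{2} log ‖ζ(σ+it)‖ dσ ≥ −(A log(t+4) + B)` for all `t ≥ 2` not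
an ordinate. (From `exists_log_norm_riemannZeta_ge`, `Σ_{disc} m(ρ) ≤ C₂ log(t+4)`
(`Literature.NumberTheory.LFunctions.exists_sum_zetaDiscZeros_le`) and `∫ log ‖σ+it−ρ‖ ≥ −2`.) [cite: Titchmarsh1986, Thm. 9.9] -/
theorem exists_integral_log_norm_riemannZeta_ge :
    ∃ A B : ℝ, ∀ t : ℝ, 2 ≤ t → (∀ ρ : ℂ, riemannZeta ρ = 0 → ρ.im ≠ t) →
      -(A * Real.log (|t| + 4) + B) ≤ ∫ σ in (1 / 2 : ℝ)..2, Real.log ‖riemannZeta (σ + t * I)‖ := by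
  obtain ⟨C, hC0, hC⟩ := exists_log_norm_riemannZeta_ge
  obtain ⟨C₂, hC₂0, hC₂⟩ := Literature.NumberTheory.LFunctions.exists_sum_zetaDiscZeros_le
  refine ⟨3 / 2 * C + C₂ * (2 + 3 / 2 * Real.log 2), 3 / 2 * Real.log 3, fun t ht hord ↦ ?_⟩
  set Z := Literature.NumberTheory.LFunctions.zetaDiscZeros t with hZ
  set L : ℝ := Real.log (|t| + 4) with hL
  have hL0 : 0 ≤ L := Real.log_nonneg (by linarith [abs_nonneg t])
  have ht0 : 0 < t := by linarith
  have hne1 : ∀ u : ℝ, (u : ℂ) + t * I ≠ 1 := fun u h ↦ by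
    have := congrArg Complex.im h; simp at this; exact ht0.ne' this
  have hζne : ∀ u : ℝ, riemannZeta (u + t * I) ≠ 0 := fun u h ↦ hord _ h (by simp)
  have hρim : ∀ ρ ∈ Z, ρ.im ≠ t := fun ρ hρ ↦ hord ρ (Literature.NumberTheory.LFunctions.zetaDiscZeros_prop hρ).1
  have hρne : ∀ ρ ∈ Z, ∀ u : ℝ, (u : ℂ) + t * I - ρ ≠ 0 := fun ρ hρ u h ↦ by
    have := congrArg Complex.im h; simp at this; exact hρim ρ hρ (by linarith)
  have hdnn : ∀ ρ, (0 : ℝ) ≤ (Literature.NumberTheory.LFunctions.zetaDiscDivisor t ρ : ℝ) := fun ρ ↦ by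
    exact_mod_cast Literature.NumberTheory.LFunctions.zetaDiscDivisor_nonneg t ρ
  set D : ℝ := ∑ ρ ∈ Z, (Literature.NumberTheory.LFunctions.zetaDiscDivisor t ρ : ℝ) with hD
  have hD0 : 0 ≤ D := Finset.sum_nonneg fun ρ _ ↦ hdnn ρ
  have hDle : D ≤ C₂ * L := hC₂ t
  -- the pointwise bound, integrated
  set R : ℝ → ℝ := fun σ ↦ -(C * L) - Real.log 3 +
    ∑ ρ ∈ Z, (Literature.NumberTheory.LFunctions.zetaDiscDivisor t ρ : ℝ) * (Real.log ‖(σ : ℂ) + t * I - ρ‖ - Real.log 2) with hR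
  have hRcont : Continuous R := by
    simp only [hR]
    refine continuous_const.add (continuous_finsetSum _ fun ρ hρ ↦ continuous_const.mul ?_)
    exact ((continuous_norm.comp (by fun_prop : Continuous fun σ : ℝ ↦ (σ : ℂ) + t * I - ρ)).log
      fun σ ↦ norm_ne_zero_iff.2 (hρne ρ hρ σ)).sub continuous_const
  have hFcont : Continuous fun σ : ℝ ↦ Real.log ‖riemannZeta (σ + t * I)‖ := by
    refine continuous_iff_continuousAt.2 fun σ ↦ ?_
    have hc : Continuous fun σ : ℝ ↦ (σ : ℂ) + t * I := by fun_prop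
    have h1 : ContinuousAt (fun σ : ℝ ↦ riemannZeta (σ + t * I)) σ :=
      (differentiableAt_riemannZeta (hne1 σ)).continuousAt.comp (f := fun σ : ℝ ↦ (σ : ℂ) + t * I)
        hc.continuousAt
    exact (h1.norm).log (norm_ne_zero_iff.2 (hζne σ))
  have hmono : ∫ σ in (1 / 2 : ℝ)..2, R σ ≤ ∫ σ in (1 / 2 : ℝ)..2, Real.log ‖riemannZeta (σ + t * I)‖ :=
    intervalIntegral.integral_mono_on (by norm_num) (hRcont.intervalIntegrable _ _)
      (hFcont.intervalIntegrable _ _) fun σ hσ ↦ hC t ht hord σ hσ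
  -- evaluate `∫ R`
  have hlogρ : ∀ ρ ∈ Z, IntervalIntegrable (fun σ : ℝ ↦ Real.log ‖(σ : ℂ) + t * I - ρ‖) volume (1 / 2) 2 :=
    fun ρ hρ ↦ ((continuous_norm.comp (by fun_prop : Continuous fun σ : ℝ ↦ (σ : ℂ) + t * I - ρ)).log
      fun σ ↦ norm_ne_zero_iff.2 (hρne ρ hρ σ)).intervalIntegrable _ _
  have htermInt : ∀ ρ ∈ Z, IntervalIntegrable (fun σ : ℝ ↦ (Literature.NumberTheory.LFunctions.zetaDiscDivisor t ρ : ℝ) *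
      (Real.log ‖(σ : ℂ) + t * I - ρ‖ - Real.log 2)) volume (1 / 2) 2 :=
    fun ρ hρ ↦ ((hlogρ ρ hρ).sub intervalIntegrable_const).const_mul _
  have hterm : ∀ ρ ∈ Z, ∫ σ in (1 / 2 : ℝ)..2, (Literature.NumberTheory.LFunctions.zetaDiscDivisor t ρ : ℝ) *
      (Real.log ‖(σ : ℂ) + t * I - ρ‖ - Real.log 2) =
        (Literature.NumberTheory.LFunctions.zetaDiscDivisor t ρ : ℝ) *
          ((∫ σ in (1 / 2 : ℝ)..2, Real.log ‖(σ : ℂ) + t * I - ρ‖) - 3 / 2 * Real.log 2) := by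
    intro ρ hρ
    rw [intervalIntegral.integral_const_mul, intervalIntegral.integral_sub (hlogρ ρ hρ)
      intervalIntegrable_const, intervalIntegral.integral_const, smul_eq_mul]
    ring
  have hRint : ∫ σ in (1 / 2 : ℝ)..2, R σ = 3 / 2 * (-(C * L) - Real.log 3) +
      ∑ ρ ∈ Z, (Literature.NumberTheory.LFunctions.zetaDiscDivisor t ρ : ℝ) *
        ((∫ σ in (1 / 2 : ℝ)..2, Real.log ‖(σ : ℂ) + t * I - ρ‖) - 3 / 2 * Real.log 2) := by
    have hsumInt : IntervalIntegrable (fun σ : ℝ ↦ ∑ ρ ∈ Z, (Literature.NumberTheory.LFunctions.zetaDiscDivisor t ρ : ℝ) *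
        (Real.log ‖(σ : ℂ) + t * I - ρ‖ - Real.log 2)) volume (1 / 2) 2 :=
      (IntervalIntegrable.sum Z htermInt).congr fun σ _ ↦ by simp [Finset.sum_apply]
    simp only [hR]
    rw [intervalIntegral.integral_add intervalIntegrable_const hsumInt, intervalIntegral.integral_const,
      smul_eq_mul, intervalIntegral.integral_finsetSum htermInt, Finset.sum_congr rfl hterm]
    ring
  have hsum : -(D * (2 + 3 / 2 * Real.log 2)) ≤ ∑ ρ ∈ Z, (Literature.NumberTheory.LFunctions.zetaDiscDivisor t ρ : ℝ) *
      ((∫ σ in (1 / 2 : ℝ)..2, Real.log ‖(σ : ℂ) + t * I - ρ‖) - 3 / 2 * Real.log 2) := by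
    rw [hD, Finset.sum_mul, ← Finset.sum_neg_distrib]
    refine Finset.sum_le_sum fun ρ hρ ↦ ?_
    have h2 := neg_two_le_integral_log_norm_sub t ρ (hρim ρ hρ)
    have := hdnn ρ
    nlinarith
  have hlog2 : 0 < Real.log 2 := Real.log_pos (by norm_num)
  rw [hRint] at hmono
  have : C₂ * (2 + 3 / 2 * Real.log 2) * L ≥ D * (2 + 3 / 2 * Real.log 2) := by nlinarith
  linarith

/-- **Upper bound**: `∫_{1/2}^{2} log ‖ζ(σ + it)‖ dσ ≤ (3/2) log(40(|t| + 4))` for `|t| ≥ 2`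
(`‖ζ‖ ≤ 40(|t|+4)` on the disc, `Literature.NumberTheory.LFunctions.norm_riemannZeta_le_of_mem_jensenDisc`). [folklore] -/
theorem integral_log_norm_riemannZeta_le {t : ℝ} (ht : 2 ≤ t)
    (hord : ∀ ρ : ℂ, riemannZeta ρ = 0 → ρ.im ≠ t) :
    ∫ σ in (1 / 2 : ℝ)..2, Real.log ‖riemannZeta (σ + t * I)‖ ≤ 3 / 2 * Real.log (40 * (|t| + 4)) := by
  have ht0 : 0 < t := by linarith
  have hT : 2 ≤ |t| := by rwa [abs_of_pos ht0]
  have hne1 : ∀ u : ℝ, (u : ℂ) + t * I ≠ 1 := fun u h ↦ by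
    have := congrArg Complex.im h; simp at this; exact ht0.ne' this
  have hζne : ∀ u : ℝ, riemannZeta (u + t * I) ≠ 0 := fun u h ↦ hord _ h (by simp)
  have hFcont : Continuous fun σ : ℝ ↦ Real.log ‖riemannZeta (σ + t * I)‖ := by
    refine continuous_iff_continuousAt.2 fun σ ↦ ?_
    have hc : Continuous fun σ : ℝ ↦ (σ : ℂ) + t * I := by fun_prop
    have h1 : ContinuousAt (fun σ : ℝ ↦ riemannZeta (σ + t * I)) σ :=
      (differentiableAt_riemannZeta (hne1 σ)).continuousAt.comp (f := fun σ : ℝ ↦ (σ : ℂ) + t * I)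
        hc.continuousAt
    exact (h1.norm).log (norm_ne_zero_iff.2 (hζne σ))
  have h := intervalIntegral.integral_mono_on (a := 1 / 2) (b := 2) (by norm_num)
    (hFcont.intervalIntegrable _ _) (intervalIntegrable_const (μ := volume) (c := Real.log (40 * (|t| + 4))))
    (fun σ hσ ↦ Real.log_le_log (norm_pos_iff.2 (hζne σ))
      (Literature.NumberTheory.LFunctions.norm_riemannZeta_le_of_mem_jensenDisc hT
        (closedBall_subset_closedBall (by norm_num) (mem_closedBall_of_mem_Icc_half_two hσ t))))
  rw [intervalIntegral.integral_const] at h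
  simp at h
  linarith

/-- `2^{2−x} = 4 e^{−(log 2) x}`. [folklore] -/
lemma two_rpow_two_sub (x : ℝ) : (2 : ℝ) ^ (2 - x) = 4 * Real.exp (-Real.log 2 * x) := by
  rw [Real.rpow_def_of_pos (by norm_num)]
  have : Real.log 2 * (2 - x) = 2 * Real.log 2 + -Real.log 2 * x := by ring
  rw [this, Real.exp_add, show (2 : ℝ) * Real.log 2 = Real.log 4 by
    rw [show (4 : ℝ) = 2 ^ 2 by norm_num, Real.log_pow]; norm_num, Real.exp_log (by norm_num)]

/-- **Tail estimate**: `|log ‖ζ(x + it)‖| ≤ 4 e^{−(log 2) x}` for `x ≥ 3` (`‖ζ − 1‖ ≤ ½` there).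
[folklore] -/
theorem abs_log_norm_riemannZeta_le_of_three_le {x : ℝ} (hx : 3 ≤ x) (t : ℝ) :
    |Real.log ‖riemannZeta (x + t * I)‖| ≤ 4 * Real.exp (-Real.log 2 * x) := by
  have hb := norm_riemannZeta_sub_one_le_of_two_le_re (s := x + t * I) (by simp; linarith)
  simp only [add_re, ofReal_re, mul_re, ofReal_im, I_re, mul_zero, I_im, mul_one, sub_self,
    add_zero] at hb
  have hpow_le : (2 : ℝ) ^ (2 - x) ≤ 1 / 2 := by
    have : (2 : ℝ) ^ (2 - x) ≤ (2 : ℝ) ^ (-1 : ℝ) :=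
      Real.rpow_le_rpow_of_exponent_le (by norm_num) (by linarith)
    rw [Real.rpow_neg_one] at this
    linarith
  have hπ : π ^ 2 / 6 - 1 ≤ 0.65 := by
    have := Real.pi_lt_d4; nlinarith [Real.pi_pos]
  have hπ0 : 0 ≤ π ^ 2 / 6 - 1 := by
    have := Real.pi_gt_three; nlinarith
  have hsmall : ‖riemannZeta (x + t * I) - 1‖ ≤ 1 / 2 := by
    refine hb.trans ?_
    calc (2 : ℝ) ^ (2 - x) * (π ^ 2 / 6 - 1) ≤ (1 / 2) * 0.65 := by gcongr
      _ ≤ 1 / 2 := by norm_num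
  refine (abs_log_norm_le_of_norm_sub_one_le hsmall).trans ?_
  have hexp0 : 0 ≤ Real.exp (-Real.log 2 * x) := (Real.exp_pos _).le
  calc 3 / 2 * ‖riemannZeta (x + t * I) - 1‖ ≤ 3 / 2 * ((2 : ℝ) ^ (2 - x) * (π ^ 2 / 6 - 1)) := by
        gcongr
    _ ≤ 3 / 2 * ((2 : ℝ) ^ (2 - x) * 0.65) := by gcongr
    _ = 3 / 2 * (4 * Real.exp (-Real.log 2 * x) * 0.65) := by rw [two_rpow_two_sub]
    _ ≤ 4 * Real.exp (-Real.log 2 * x) := by nlinarith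

/-- **The tail `∫₂^∞ log ‖ζ(σ + it)‖ dσ` is bounded**: `|∫_{Ioi 2} log ‖ζ(σ+it)‖ dσ| ≤ 3` for every
`t > 0` not an ordinate (`|log ‖ζ‖| ≤ 2` on `(2, 3]`, `≤ 4e^{−(log 2)σ}` beyond). [folklore] -/
theorem abs_integral_Ioi_two_log_norm_riemannZeta_le {t : ℝ} (ht : 0 < t)
    (hord : ∀ ρ : ℂ, riemannZeta ρ = 0 → ρ.im ≠ t) :
    |∫ x in Ioi (2 : ℝ), Real.log ‖riemannZeta (x + t * I)‖| ≤ 3 := by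
  have hint : IntegrableOn (fun x : ℝ ↦ Real.log ‖riemannZeta (x + t * I)‖) (Ioi 2) :=
    (integrableOn_log_norm_riemannZeta ht hord).mono_set (Ioi_subset_Ioi (by norm_num))
  have hsplit : ∫ x in Ioi (2 : ℝ), Real.log ‖riemannZeta (x + t * I)‖ =
      (∫ x in Ioc (2 : ℝ) 3, Real.log ‖riemannZeta (x + t * I)‖) +
        ∫ x in Ioi (3 : ℝ), Real.log ‖riemannZeta (x + t * I)‖ := by
    rw [← setIntegral_union (Ioc_disjoint_Ioi le_rfl) measurableSet_Ioi
      (hint.mono_set Ioc_subset_Ioi_self) (hint.mono_set (Ioi_subset_Ioi (by norm_num))),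
      Ioc_union_Ioi_eq_Ioi (by norm_num)]
  -- `(2, 3]`
  have h1 : ‖∫ x in Ioc (2 : ℝ) 3, Real.log ‖riemannZeta (x + t * I)‖‖ ≤ 2 * volume.real (Ioc (2 : ℝ) 3) := by
    refine norm_setIntegral_le_of_norm_le_const_ae (by simp) ?_
    refine (ae_restrict_iff' measurableSet_Ioc).2 (Eventually.of_forall fun x hx ↦ ?_)
    have hb := norm_riemannZeta_sub_one_le_of_two_le_re (s := x + t * I) (by simp; exact hx.1.le)
    simp only [add_re, ofReal_re, mul_re, ofReal_im, I_re, mul_zero, I_im, mul_one, sub_self,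
      add_zero] at hb
    have hpow : (2 : ℝ) ^ (2 - x) ≤ 1 := Real.rpow_le_one_of_one_le_of_nonpos (by norm_num) (by linarith [hx.1])
    have hπ : π ^ 2 / 6 - 1 ≤ 0.65 := by
      have := Real.pi_lt_d4; nlinarith [Real.pi_pos]
    have hπ0 : 0 ≤ π ^ 2 / 6 - 1 := by
      have := Real.pi_gt_three; nlinarith
    have hd : ‖riemannZeta (x + t * I) - 1‖ ≤ 0.65 := by
      refine hb.trans ?_
      calc (2 : ℝ) ^ (2 - x) * (π ^ 2 / 6 - 1) ≤ 1 * 0.65 := by gcongr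
        _ = 0.65 := one_mul _
    have hlo : 0.35 ≤ ‖riemannZeta (x + t * I)‖ := by
      have := norm_sub_norm_le (1 : ℂ) (riemannZeta (x + t * I))
      rw [norm_one, norm_sub_rev] at this
      linarith
    have hhi : ‖riemannZeta (x + t * I)‖ ≤ 1.65 := by
      have := norm_le_norm_add_norm_sub' (riemannZeta (x + t * I)) 1
      rw [norm_one] at this
      linarith
    have hpos : 0 < ‖riemannZeta (x + t * I)‖ := by linarith
    rw [Real.norm_eq_abs, abs_le]
    constructor
    · have := Real.one_sub_inv_le_log_of_pos hpos
      have hinv : (‖riemannZeta (x + t * I)‖)⁻¹ ≤ (0.35 : ℝ)⁻¹ := inv_anti₀ (by norm_num) hlo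
      norm_num at hinv
      linarith
    · have := Real.log_le_sub_one_of_pos hpos
      linarith
  have hvol : volume.real (Ioc (2 : ℝ) 3) = 1 := by simp; norm_num
  rw [hvol, mul_one, Real.norm_eq_abs] at h1
  -- `(3, ∞)`
  have h2 : ‖∫ x in Ioi (3 : ℝ), Real.log ‖riemannZeta (x + t * I)‖‖ ≤ 1 := by
    have hg : IntegrableOn (fun x : ℝ ↦ 4 * Real.exp (-Real.log 2 * x)) (Ioi 3) :=
      (exp_neg_integrableOn_Ioi 3 (Real.log_pos (by norm_num))).const_mul 4
    have hle := norm_integral_le_of_norm_le (μ := volume.restrict (Ioi (3 : ℝ))) hg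
      ((ae_restrict_iff' measurableSet_Ioi).2 (Eventually.of_forall fun x hx ↦ by
        rw [Real.norm_eq_abs]
        exact abs_log_norm_riemannZeta_le_of_three_le (le_of_lt hx) t))
    refine hle.trans ?_
    rw [MeasureTheory.integral_const_mul, integral_exp_mul_Ioi (by
      have := Real.log_pos (show (1 : ℝ) < 2 by norm_num); linarith) 3]
    have hlog2 : 0.69 < Real.log 2 := by
      have := Real.log_two_gt_d9; linarith
    have hexp : Real.exp (-Real.log 2 * 3) = 1 / 8 := by
      rw [show -Real.log 2 * 3 = -(3 * Real.log 2) by ring, Real.exp_neg,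
        show (3 : ℝ) * Real.log 2 = Real.log 8 by
          rw [show (8 : ℝ) = 2 ^ 3 by norm_num, Real.log_pow]; norm_num, Real.exp_log (by norm_num)]
      norm_num
    rw [hexp]
    rw [show (4 : ℝ) * (-(1 / 8) / -Real.log 2) = 1 / (2 * Real.log 2) by field_simp; ring]
    rw [div_le_one (by positivity)]
    linarith
  rw [Real.norm_eq_abs] at h2
  rw [hsplit]
  have := abs_add_le (∫ x in Ioc (2 : ℝ) 3, Real.log ‖riemannZeta (x + t * I)‖)
    (∫ x in Ioi (3 : ℝ), Real.log ‖riemannZeta (x + t * I)‖)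
  linarith

/-- **Littlewood's theorem** (Littlewood 1924; Titchmarsh Thm. 9.9 (A): `∫₀ᵀ S(t) dt = O(log T)`),
in the form used by Turing's method: there are absolute `A, B` with
`|∫_{t₁}^{t₂} S(t) dt| ≤ A log(t₂ + 4) + B` for all `2 ≤ t₁ ≤ t₂` that are not ordinates of zeros.
(Turing's lemma `pi_mul_integral_zetaArgS_eq` and the two-sided bounds for
`∫_{1/2}^∞ log ‖ζ(σ+it)‖ dσ`: `exists_integral_log_norm_riemannZeta_ge`, `integral_log_norm_riemannZeta_le`,
`abs_integral_Ioi_two_log_norm_riemannZeta_le`.) The explicit versions with numerical constants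
(Turing 1953, Lehman 1970, Trudgian 2011) are the named facts of `TuringMethod.lean`.
[cite: Titchmarsh1986, Thm. 9.9] -/
theorem exists_abs_integral_zetaArgS_le_of_not_ordinate :
    ∃ A B : ℝ, 0 ≤ A ∧ 0 ≤ B ∧ ∀ t₁ t₂ : ℝ, 2 ≤ t₁ → t₁ ≤ t₂ →
      (∀ ρ : ℂ, riemannZeta ρ = 0 → ρ.im ≠ t₁) → (∀ ρ : ℂ, riemannZeta ρ = 0 → ρ.im ≠ t₂) →
      |∫ t in t₁..t₂, zetaArgS t| ≤ A * Real.log (t₂ + 4) + B := by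
  obtain ⟨A₁, B₁, hlow⟩ := exists_integral_log_norm_riemannZeta_ge
  -- `|U(t)| ≤ A₂ log(t+4) + B₂` for the whole ray integral
  set A₂ : ℝ := |A₁| + 3 / 2 with hA₂
  set B₂ : ℝ := |B₁| + 3 / 2 * Real.log 40 + 3 with hB₂
  have hU : ∀ t : ℝ, 2 ≤ t → (∀ ρ : ℂ, riemannZeta ρ = 0 → ρ.im ≠ t) →
      |∫ x in Ioi (1 / 2 : ℝ), Real.log ‖riemannZeta (x + t * I)‖| ≤ A₂ * Real.log (t + 4) + B₂ := by
    intro t ht hord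
    have ht0 : 0 < t := by linarith
    have hint := integrableOn_log_norm_riemannZeta ht0 hord
    have hsplit : ∫ x in Ioi (1 / 2 : ℝ), Real.log ‖riemannZeta (x + t * I)‖ =
        (∫ x in (1 / 2 : ℝ)..2, Real.log ‖riemannZeta (x + t * I)‖) +
          ∫ x in Ioi (2 : ℝ), Real.log ‖riemannZeta (x + t * I)‖ := by
      rw [intervalIntegral.integral_of_le (by norm_num),
        ← setIntegral_union (Ioc_disjoint_Ioi le_rfl) measurableSet_Ioi
          (hint.mono_set Ioc_subset_Ioi_self) (hint.mono_set (Ioi_subset_Ioi (by norm_num))),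
        Ioc_union_Ioi_eq_Ioi (by norm_num)]
    have h1 := hlow t ht hord
    have h2 := integral_log_norm_riemannZeta_le ht hord
    have h3 := abs_integral_Ioi_two_log_norm_riemannZeta_le ht0 hord
    rw [abs_of_pos ht0] at h1 h2
    have hL0 : 0 ≤ Real.log (t + 4) := Real.log_nonneg (by linarith)
    have hlog40 : Real.log (40 * (t + 4)) = Real.log 40 + Real.log (t + 4) :=
      Real.log_mul (by norm_num) (by linarith)
    rw [hlog40] at h2
    rw [hsplit, abs_le]
    have hA1 : -(|A₁| * Real.log (t + 4)) ≤ -(A₁ * Real.log (t + 4)) ∧ A₁ * Real.log (t + 4) ≤ |A₁| * Real.log (t + 4) := by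
      constructor <;> nlinarith [le_abs_self A₁, neg_abs_le A₁]
    have hB1 := le_abs_self B₁
    have hB1' := abs_nonneg B₁
    have h3' := abs_le.1 h3
    have hl40 : 0 ≤ Real.log 40 := Real.log_nonneg (by norm_num)
    have hAL : 0 ≤ |A₁| * Real.log (t + 4) := by positivity
    have eA : A₂ * Real.log (t + 4) = |A₁| * Real.log (t + 4) + 3 / 2 * Real.log (t + 4) := by
      rw [hA₂]; ring
    rw [eA, hB₂]
    constructor <;> linarith [hA1.1, hA1.2, h3'.1, h3'.2]
  refine ⟨2 * A₂ / π, 2 * B₂ / π, by positivity, by positivity, fun t₁ t₂ ht₁ h12 h1' h2' ↦ ?_⟩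
  have hπ := Real.pi_pos
  have hT := pi_mul_integral_zetaArgS_eq (by linarith) h12 h1' h2'
  have hU1 := hU t₁ ht₁ h1'
  have hU2 := hU t₂ (ht₁.trans h12) h2'
  have hlog : Real.log (t₁ + 4) ≤ Real.log (t₂ + 4) := Real.log_le_log (by linarith) (by linarith)
  have hA₂0 : 0 ≤ A₂ := by positivity
  have key : π * |∫ t in t₁..t₂, zetaArgS t| ≤ 2 * A₂ * Real.log (t₂ + 4) + 2 * B₂ := by
    rw [← abs_of_pos hπ, ← abs_mul, hT]
    have := abs_sub (∫ x in Ioi (1 / 2 : ℝ), Real.log ‖riemannZeta (x + t₂ * I)‖)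
      (∫ x in Ioi (1 / 2 : ℝ), Real.log ‖riemannZeta (x + t₁ * I)‖)
    nlinarith
  rw [show 2 * A₂ / π * Real.log (t₂ + 4) + 2 * B₂ / π = (2 * A₂ * Real.log (t₂ + 4) + 2 * B₂) / π by
    ring]
  rw [le_div_iff₀ hπ]
  linarith

/-- **Littlewood's theorem, all endpoints** (Titchmarsh Thm. 9.9 (A)): there are absolute `A, B`
with `|∫_{t₁}^{t₂} S(t) dt| ≤ A log(t₂ + 4) + B` for all `2 ≤ t₁ ≤ t₂` (the non-ordinate case
`exists_abs_integral_zetaArgS_le_of_not_ordinate` extended by the density of non-ordinates and the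
continuity of `u ↦ ∫ S`). In particular `∫₀ᵀ S(t) dt = O(log T)`. [cite: Titchmarsh1986, Thm. 9.9] -/
theorem exists_abs_integral_zetaArgS_le :
    ∃ A B : ℝ, 0 ≤ A ∧ 0 ≤ B ∧ ∀ t₁ t₂ : ℝ, 2 ≤ t₁ → t₁ ≤ t₂ →
      |∫ t in t₁..t₂, zetaArgS t| ≤ A * Real.log (t₂ + 4) + B := by
  obtain ⟨A, B, hA, hB, h⟩ := exists_abs_integral_zetaArgS_le_of_not_ordinate
  refine ⟨A, B, hA, hB, fun t₁ t₂ ht₁ h12 ↦ ?_⟩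
  rcases h12.eq_or_lt with heq | hlt
  · subst heq
    have : 0 ≤ Real.log (t₁ + 4) := Real.log_nonneg (by linarith)
    simp only [intervalIntegral.integral_same, abs_zero]
    exact add_nonneg (mul_nonneg hA this) hB
  -- interval integrability of `S` and continuity of its primitives
  have hθc : Continuous riemannSiegelTheta :=
    continuous_iff_continuousAt.2 fun t ↦ (hasDerivAt_riemannSiegelTheta_holds t).continuousAt
  have hS : ∀ a b : ℝ, IntervalIntegrable zetaArgS volume a b := by
    intro a b
    have hN : IntervalIntegrable (fun T : ℝ ↦ (zetaZeroCount T : ℝ)) volume a b :=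
      Monotone.intervalIntegrable fun x y hxy ↦ Nat.cast_le.2 (zetaZeroCount_mono hxy)
    have h := (hN.sub ((hθc.div_const π).intervalIntegrable a b)).sub
      (intervalIntegrable_const (c := (1 : ℝ)))
    have e : zetaArgS = fun T ↦ (zetaZeroCount T : ℝ) - riemannSiegelTheta T / π - 1 := by
      funext T; rfl
    rw [e]; exact h
  have hprim : ∀ a : ℝ, Continuous fun b ↦ ∫ t in a..b, zetaArgS t := fun a ↦
    intervalIntegral.continuous_primitive hS a
  -- non-ordinate sequences `t₁ₙ ↓ t₁`, `t₂ₙ ↓ t₂`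
  have hdense : ∀ a b : ℝ, a < b → 0 ≤ a →
      ∃ t ∈ Ioo a b, ∀ ρ : ℂ, riemannZeta ρ = 0 → ρ.im ≠ t := by
    intro a b hab ha
    set Ords : Set ℝ := Complex.im '' zetaZeroBox 0 b with hO
    have hfin : Ords.Finite := (zetaZeroBox_finite 0 b).image _
    obtain ⟨t, ht⟩ := ((Ioo_infinite hab).sdiff hfin).nonempty
    refine ⟨t, ht.1, fun ρ hρ him ↦ ht.2 ?_⟩
    have ht0 : 0 < t := ha.trans_lt ht.1.1
    have hst := re_mem_Ioo_of_riemannZeta_eq_zero_of_im_ne_zero hρ (by rw [him]; exact ht0.ne')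
    exact ⟨ρ, ⟨hρ, hst.1.le, hst.2.le, by rw [him]; exact ht0, by rw [him]; exact ht.1.2.le⟩, him⟩
  have hδ : ∀ n : ℕ, (0 : ℝ) < min (1 / ((n : ℝ) + 1)) (t₂ - t₁) := fun n ↦
    lt_min (by positivity) (by linarith)
  choose u₁ hu₁ hu₁' using fun n : ℕ ↦ hdense t₁ (t₁ + min (1 / ((n : ℝ) + 1)) (t₂ - t₁))
    (by linarith [hδ n]) (by linarith)
  choose u₂ hu₂ hu₂' using fun n : ℕ ↦ hdense t₂ (t₂ + 1 / ((n : ℝ) + 1)) (by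
    have : (0 : ℝ) < 1 / ((n : ℝ) + 1) := by positivity
    linarith) (by linarith)
  have hlim1 : Tendsto u₁ atTop (𝓝 t₁) := by
    have h0 : Tendsto (fun n : ℕ ↦ t₁ + 1 / ((n : ℝ) + 1)) atTop (𝓝 (t₁ + 0)) :=
      tendsto_const_nhds.add tendsto_one_div_add_atTop_nhds_zero_nat
    rw [add_zero] at h0
    refine tendsto_of_tendsto_of_tendsto_of_le_of_le tendsto_const_nhds h0 (fun n ↦ (hu₁ n).1.le)
      fun n ↦ (hu₁ n).2.le.trans (by linarith [min_le_left (1 / ((n : ℝ) + 1)) (t₂ - t₁)])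
  have hlim2 : Tendsto u₂ atTop (𝓝 t₂) := by
    have h0 : Tendsto (fun n : ℕ ↦ t₂ + 1 / ((n : ℝ) + 1)) atTop (𝓝 (t₂ + 0)) :=
      tendsto_const_nhds.add tendsto_one_div_add_atTop_nhds_zero_nat
    rw [add_zero] at h0
    exact tendsto_of_tendsto_of_tendsto_of_le_of_le tendsto_const_nhds h0 (fun n ↦ (hu₂ n).1.le)
      fun n ↦ (hu₂ n).2.le
  -- the bound along the sequences
  have hbound : ∀ n, |∫ t in u₁ n..u₂ n, zetaArgS t| ≤ A * Real.log (u₂ n + 4) + B := fun n ↦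
    h (u₁ n) (u₂ n) (by linarith [(hu₁ n).1]) (by
      have := (hu₁ n).2; have := (hu₂ n).1
      linarith [min_le_right (1 / ((n : ℝ) + 1)) (t₂ - t₁)]) (hu₁' n) (hu₂' n)
  -- pass to the limit
  have hL : Tendsto (fun n ↦ |∫ t in u₁ n..u₂ n, zetaArgS t|) atTop (𝓝 |∫ t in t₁..t₂, zetaArgS t|) := by
    have e : ∀ n, ∫ t in u₁ n..u₂ n, zetaArgS t =
        (∫ t in t₁..u₂ n, zetaArgS t) - ∫ t in t₁..u₁ n, zetaArgS t := fun n ↦ by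
      rw [eq_sub_iff_add_eq, add_comm, intervalIntegral.integral_add_adjacent_intervals (hS _ _) (hS _ _)]
    simp_rw [e]
    have h1 := (hprim t₁).continuousAt.tendsto.comp hlim1
    have h2 := (hprim t₁).continuousAt.tendsto.comp hlim2
    simp only [Function.comp_def, intervalIntegral.integral_same] at h1 h2
    have := (h2.sub h1).abs
    simpa using this
  have hR : Tendsto (fun n ↦ A * Real.log (u₂ n + 4) + B) atTop (𝓝 (A * Real.log (t₂ + 4) + B)) := by
    have hc : ContinuousAt (fun x : ℝ ↦ A * Real.log (x + 4) + B) t₂ := by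
      have : ContinuousAt (fun x : ℝ ↦ Real.log (x + 4)) t₂ :=
        (Real.continuousAt_log (by linarith)).comp (continuous_add_const 4).continuousAt
      exact (this.const_mul A).add continuousAt_const
    exact hc.tendsto.comp hlim2
  exact le_of_tendsto_of_tendsto' hL hR hbound

/-- **`S₁(T) = ∫₀ᵀ S(t) dt = O(log T)`** (Littlewood 1924; Titchmarsh Thm. 9.9 (A)), as an
`IsBigO` statement at `+∞`. [cite: Titchmarsh1986, Thm. 9.9] -/
theorem isBigO_integral_zetaArgS_log :
    (fun T : ℝ ↦ ∫ t in (0 : ℝ)..T, zetaArgS t) =O[atTop] Real.log := by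
  obtain ⟨A, B, hA, hB, h⟩ := exists_abs_integral_zetaArgS_le
  have hθc : Continuous riemannSiegelTheta :=
    continuous_iff_continuousAt.2 fun t ↦ (hasDerivAt_riemannSiegelTheta_holds t).continuousAt
  have hS : ∀ a b : ℝ, IntervalIntegrable zetaArgS volume a b := by
    intro a b
    have hN : IntervalIntegrable (fun T : ℝ ↦ (zetaZeroCount T : ℝ)) volume a b :=
      Monotone.intervalIntegrable fun x y hxy ↦ Nat.cast_le.2 (zetaZeroCount_mono hxy)
    have h := (hN.sub ((hθc.div_const π).intervalIntegrable a b)).sub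
      (intervalIntegrable_const (c := (1 : ℝ)))
    have e : zetaArgS = fun T ↦ (zetaZeroCount T : ℝ) - riemannSiegelTheta T / π - 1 := by
      funext T; rfl
    rw [e]; exact h
  set K : ℝ := |∫ t in (0 : ℝ)..2, zetaArgS t| with hK
  rw [Asymptotics.isBigO_iff]
  refine ⟨2 * A + (B + K), ?_⟩
  filter_upwards [eventually_ge_atTop (4 : ℝ)] with T hT
  have hsplit : ∫ t in (0 : ℝ)..T, zetaArgS t =
      (∫ t in (0 : ℝ)..2, zetaArgS t) + ∫ t in (2 : ℝ)..T, zetaArgS t :=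
    (intervalIntegral.integral_add_adjacent_intervals (hS 0 2) (hS 2 T)).symm
  have hb := h 2 T le_rfl (by linarith)
  have hlogT : 1 ≤ Real.log T := by
    rw [← Real.log_exp 1]
    refine Real.log_le_log (Real.exp_pos 1) ?_
    have := Real.exp_one_lt_d9
    linarith
  have hlog2 : Real.log (T + 4) ≤ 2 * Real.log T := by
    rw [← Real.log_rpow (by linarith), Real.rpow_two]
    exact Real.log_le_log (by linarith) (by nlinarith)
  rw [Real.norm_eq_abs, Real.norm_eq_abs, abs_of_pos (by linarith : 0 < Real.log T), hsplit]
  have := abs_add_le (∫ t in (0 : ℝ)..2, zetaArgS t) (∫ t in (2 : ℝ)..T, zetaArgS t)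
  have hK0 : 0 ≤ K := abs_nonneg _
  nlinarith

end littlewood

end Literature.NumberTheory.LFunctions
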